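/-
Copyright: statement-level skeleton of a published paper (lit-balaban cell, Phase-2 proof seat p39 gen 22). No proof claims
beyond what the kernel checks below.
-/
import Literature.MathematicalPhysics.QuantumFieldTheory.Balaban1983to89.B3WickVertexCalculus
import Literature.MathematicalPhysics.QuantumFieldTheory.Balaban1983to89.B3WT226Traces
import Literature.MathematicalPhysics.QuantumFieldTheory.Balaban1983to89.B3Eq123Counterterms

/-!
# Bałaban, *(Higgs)₂,₃ quantum fields in a finite volume. III*, CMP 88 (1983) [Balaban1983Higgs3], p. 416: THE FIRST TERM OF
# (1.22), `Σ^ε(x−x′) = −4(N+2)λC^ε_0(0)δ^ε(x−x′) + …`, DERIVED BY WICK'S THEOREM, and the first-order case of the sentence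
# *"The function G^ε has a perturbative expansion of the following structure (1.21) where … Σ^ε, Σ^ε_1, Σ^ε_2 are given by
# amputated, one-particle-irreducible graphs of the expansion of G^ε"* — on the zero-vector-field Gaussian of the model torus;
# v1.1: the SECOND order for the Wick-ordered quartic vertex — the sunset ⑥ `4²(2N+4)λ²(C^ε_0)³` of (1.22), factor derived;
# v1.2: the complete SECOND-ORDER TERM for the plain vertex of (1.20) — sunset ⑥ + local two-loop graph + chain of two tadpoles
# — and the vacuum side (1.24) p. 417 at e = 0 through β = 2 (connected vacuum graphs)

statement-level skeleton of published theorems with citation tags; proofs where landed; nothing here is a claim about the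
Yang–Mills mass gap.

[cite: Balaban1983Higgs3, (1.19)–(1.22) p.416 (PDF 6)].  Unit `lit-balaban-p39-g22` (Phase-2 proof seat p39, gen 22), free-target
protocol G.5-34(d): BRICK 1 of the fold owner's target named in r15 g15's HEAD QUESTION 25 (HOME/INBOX 2026-08-23T07:43:33Z, reading
(T): *"«the formal power series of (1.19) in (e, λ) has the structure (1.21) with Σ = Σ over amputated 1PI two-scalar-leg graphs» …
coefficients of G^ε at (e,λ) = 0 as Gaussian expectations via p39's Wick files → graph sums"*); row **B3.Eq1.19-1.22** of
`HOME/lit-balaban-r15/ROWS-B3.md` (owner r15), (1.22) cell, OPTIONAL LOCATED MEMBER with zero head weight (the lead's HEAD WORD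
Q25, HOME/STATUS 2026-08-23T08:24:18Z, reading (P): the free target is welcome as B3-CLOSURE §5 optional, not owed; the row's head
is `proved p243974` on the owner path, ROWS-B3 v1.303).  Sibling bricks of the same target (all disjoint from this file, none
imported here): BRICK 2 `B3Eq121OnePIChains` (p32: (1.21) as an identity of formal power series over chains of 1PI kernels),
BRICK 3 `B3OnePIGraphs` (p37: `IsOnePI` on p18's graph model), BRICK 4 `B3TwoPointPerturbativeCoefficients` (p33: the
`t`-derivatives of `⟨Fe^{−tV}⟩/⟨e^{−tV}⟩` TO ALL ORDERS as pinned truncated expectations, abstract measure, no Wick evaluation).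

PDF held: `paper:balaban1983-higgs-2-3-quantum-fields-finite-volume` (journal page = PDF page + 410); p. 416 read on the ×2 render
`run/shared/lean/pub/pub-balaban/b2b-balaban-ref1/pages/1983-cmp88-higgs23-III/1983-cmp88-higgs23-III-p006-x2.png`.

THE PRINTED TEXT (verbatim, p. 416).  *"It is determined by the two-point Schwinger function
G^ε_{ab}(x,x′) = ⟨φ_a(x)φ_b(x′)⟩^ε = (Z^ε)^{−1}∫dA∫dφ e^{−S^ε(A,φ)}φ_a(x)φ_b(x′), x, x′ ∈ T_ε, (1.19) where S^ε(A,φ) is the lattice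
action of the model given by S^ε(A,φ) = ½⟨φ,(−Δ^ε_A + m²)φ⟩ + Σ_{x∈T_ε}ε^d(λ∣φ(x)∣⁴ + ½δm²∣φ(x)∣²) + ½⟨A,(−Δ^ε + μ₀²)A⟩, (1.20) …
The function G^ε has a perturbative expansion of the following structure G^ε = Σ_{n=0}^∞ C₀^ε[(−δm² + Σ^ε + ∂^{ε*}Σ₁^ε + Σ₁^{ε*}∂^ε
+ ∂^{ε*}Σ₂^ε∂^ε)C₀^ε]ⁿ, (1.21) where C₀^ε = (−Δ₀^ε + m²)^{−1} and Σ^ε, Σ₁^ε, Σ₂^ε are given by amputated, one-particle-irreducible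
graphs of the expansion of G^ε. … Let us write a few terms of the expansion of Σ^ε: Σ^ε(x−x′) = −4(N+2)λC^ε_0(0)δ^ε(x−x′) + … (1.22)
Here we did not write, and we will not write in the future, combinatoric factors before the graphs, understanding that they are a
part of the graphical description."*

WHAT THIS FILE PROVES (theorems only; no definition of record is redeclared; no named fact; no `sorry`; standard axioms).  The
setting is this seat's gen-13…16 Gaussian calculus of the lattice model: fields `φ : T^{(j)}_η → ℝ^N` (`B3WT223Instance.Cfg`),
Gaussian weight `W = e^{−½⟨φ,(−Δ^η+M²)φ⟩}` at zero vector field (`B3WT223Instance.weight … 0`), propagator `C = C^η_{M²} =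
B3WTPropagator.G` (print: `η = ε`, `M² = m²`, `C = C^ε_0`), `Z = ∫W`.
* §1 the two external legs `φ_a(x)φ_b(x′)` as an observable and their contractions along `h_{y,i} = C(·,y)e_i`
  (`legs`, `expGrowth_legs`, `derivAlong_legs`, `derivAlong_legs'`).
* §2 **WICK'S THEOREM FOR THE φ⁴ VERTEX AGAINST TWO LEGS** (`integral_norm_four_mul_legs`):
  `∫W·∣φ(y)∣⁴·φ_a(x)φ_b(x′) = Z·δ_{ab}·[N(N+2)C(y,y)²C(x,x′) + 4(N+2)·C(y,y)C(x,y)C(y,x′)]` — two self-lines at `y` (the vacuum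
  part) or ONE self-line with both external legs contracted into the vertex: the TADPOLE ① of (1.22) with print's combinatoric
  factor `4(N+2)` DERIVED from the pairing count (this seat's `B3WickVertexCalculus.integral_norm_four_mul`: classes `N(N+2)`,
  `2N+4`, `1` of Glimm–Jaffe Prop. 8.3.1 at one vertex); `integral_norm_four` (`R = 1`): `∫W∣φ(y)∣⁴ = N(N+2)C(y,y)²Z`.
* §3 **THE CONNECTED FIRST-ORDER INSERTION** (`cov_V_legs`): with `V = Σ_{y}η^d∣φ(y)∣⁴` (the interaction of (1.20) per unit `λ`),
  `Z·∫W·V·φ_aφ_b − (∫W·V)(∫W·φ_aφ_b) = Z²·δ_{ab}·4(N+2)Σ_y η^d C(x,y)C(y,y)C(y,x′)` — the vacuum parts cancel, the tadpole remains.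
* §4 **FIRST-ORDER PERTURBATION THEORY** (`hasDerivWithinAt_gaussInt_exp_neg`, `hasDerivWithinAt_twoPointPhi4`): the λ∣φ∣⁴
  two-point function `G_λ,ab(x,x′) = ∫We^{−λV}φ_a(x)φ_b(x′) / ∫We^{−λV}` (`λ ≥ 0`; the `e = 0`, `δm² = 0` sector of (1.19)) is
  right-differentiable at `λ = 0⁺` (dominated convergence on the difference quotients; one-sided because `e^{−λV}` is not integrable
  against the Gaussian for `λ < 0`) with derivative `−δ_{ab}·4(N+2)Σ_y η^d C(x,y)C(y,y)C(y,x′)`, i.e. THE `n = 1` TERM OF (1.21) AT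
  ORDER `λ`: `C₀·Σ^ε_{(0,1)}·C₀` with `Σ^ε_{(0,1)}(y,y′) = −4(N+2)C₀(y,y)δ^ε(y−y′)` — the first graph of (1.22) per unit `λ`;
  the vacuum parts cancel by §3 (`cov_V_legs`).
* §5 **DICTIONARY TO THE TYPED (1.22)① AND TO (1.21)** (`deriv_eq_C0_sig1_C0`, `deriv_eq_dysonTerm_one`, `firstDysonPartialSum`):
  for p26's data `D : B3Eq123Counterterms.SEData` carrying this propagator (`D.C0 = C`, `D.N = N`, `D.w = η^d`), `λ·(d/dλ)G_λ∣_{0⁺}`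
  (per `δ_{ab}`) `= Σ_{y,y′}η^{2d}C(x,y)·sig1 D(y,y′)·C(y′,x′)` — p26 typed `sig1 = −4(N+2)λC^ε_0(0)δ^ε` AS PRINTED; here its
  coefficient is a theorem about the measure —, and in r15's `B3Sect1TwoPoint.dysonTerm` vocabulary (matrices `η^d·K` realising
  kernel composition with the volume element) it is `dysonTerm (η^dC₀) (η^d·sig1) 1`, while `η^d·(C₀ + λ·(d/dλ)G_λ∣_{0⁺}) =
  Σ_{n<2} dysonTerm (η^dC₀) (η^d·sig1) n` is the first Dyson partial sum (`dyson_partial` at `N = 2`): the first-order Taylor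
  polynomial of the two-point function at `λ = 0⁺` IS (1.21) truncated at `n = 1` with the insertion ①.
v1.1 (same seat and gen, APPEND-ONLY after `firstDysonPartialSum`, §6–§10; the v1.0 declarations are byte-identical):
* §6 **THE FIRST-ORDER FORMULA AT EVERY COUPLING** (`hasDerivAt_gaussInt_exp_neg`, `hasDerivAt_twoPointPhi4`): for `λ₀ > 0` the
  moments `λ ↦ ∫We^{−λV}F` are differentiable (two-sided; dominated differentiation on `λ > 0` with the bound `V∣F∣`) and
  `(d/dλ)G_λ,ab(x,x′)∣_{λ₀} = −[⟨VF⟩_{λ₀} − ⟨V⟩_{λ₀}⟨F⟩_{λ₀}]` in quotient-rule form — with §4, `G_λ` is differentiable on all of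
  `[0, ∞)`.
* §7 **THE ORDER-λ² COEFFICIENT EXISTS** (`gaussInt_exp_neg_zero`, `hasDerivWithinAt_firstDeriv_twoPointPhi4`): the first
  derivative (the quotient-rule expression of §4/§6) is right-differentiable at `0⁺` with derivative the cumulant-type Gaussian
  expression `E₀[V²F] − E₀[F]E₀[V²] − 2E₀[V]E₀[VF] + 2E₀[F]E₀[V]²` (`E₀ = Z^{−1}∫W·(−)`) — the `∣W∣ = 2` instance, on this
  file's concrete carrier and with the integrability supplied by `ExpGrowth`, of p33's all-orders
  `B3TwoPointPerturbativeCoefficients.TiltData.iteratedDerivWithin_tiltExpect_eq_ursellOf` (proved here independently from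
  `hasDerivWithinAt_gaussInt_exp_neg`; neither file imports the other).
* §8 **TWO WICK-ORDERED QUARTIC VERTICES, THE VACUUM "BASKETBALL"** (`integral_wick4_wick4`; `derivAlong_wick4_1…4` = the four
  successive contractions of `:∣φ(z)∣⁴:` along `h_{y,i}`, `h_{y,k}`): `∫W·:∣φ(y)∣⁴:·:∣φ(z)∣⁴: = 8N(N+2)·C(z,y)⁴·Z`
  (`:∣φ∣⁴: = B3WickVertexCalculus.wick4`; engine `integral_wick4_mul`: all four legs of the Wick-ordered vertex at `y` contract
  into the other factor, Glimm–Jaffe Cor. 8.3.2 — no self-lines; pairing count `4!·[N(N+2)/3]·` → `8N(N+2)`).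
* §9 **THE SUNSET ⑥ WITH PRINT'S FACTOR `4²(2N+4)`** (`integral_wick4_wick4_legs`; lemmas `derivAlong_legs_cross`,
  `derivAlong_wick4_1k/1kk`, `integral_wick4_rem2(')`, `integral_leg_leg`, `integral_zlin_mul_f1`):
  `∫W·:∣φ(y)∣⁴:·:∣φ(z)∣⁴:·φ_a(x)φ_b(x′) = Z·δ_{ab}·[8N(N+2)C(z,y)⁴·C(x,x′) + 4²(2N+4)·C(z,y)³·(C(x,y)C(z,x′) + C(x′,y)C(z,x))]`
  — the disconnected basketball × free propagator, plus the SUNSET graph of (1.22) (three lines between the two vertices, one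
  external leg on each, both orientations) whose combinatoric factor `4²(2N+4)`, which print absorbs into the graph ("we did not
  write … combinatoric factors"), but displays in ⑥ as `4²(2N+4)λ²(C^ε_0(x−x′))³`, is here DERIVED from the pairing count and
  confirmed by the kernel.
* §10 **SECOND-ORDER PERTURBATION THEORY FOR THE WICK-ORDERED VERTEX `λΣ_yη^d:∣φ(y)∣⁴:`** (the form (2.28) in which the paper
  runs its inductive expansions).  `hasDerivWithinAt_gaussInt_exp_neg_of_le` / `hasDerivWithinAt_firstDeriv_twoPoint_of_le`:
  §4/§7 for any interaction bounded BELOW (`:∣φ∣⁴: ≥ −2(N+2)C(y,y)²`, `neg_le_wick4`; shift `V ↦ V + K`); `integral_wick4_legs`,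
  `integral_sumWick4_mul_legs`, `integral_sumWick4`: the Wick-ordered vertex against two legs or alone integrates to ZERO — no
  tadpole, no first-order term; `integral_sumWick4_sq(_legs)`: the second moments are §8/§9 summed over the vertices; and the
  conclusion `hasDerivWithinAt_firstDeriv_twoPointWick4`: **`G^{:}″_{ab}(0⁺) = δ_{ab}·Σ_{y,z}η^{2d}·4²(2N+4)·C(z,y)³·[C(x,y)C(z,x′)
  + C(x′,y)C(z,x)]`** — the vacuum basketballs cancel against the normalization, the sunset ⑥ between two free propagators
  remains (both orientations); dictionary `secondCoeff_eq_C0_sig6_C0` / `secondCoeff_eq_dysonTerm_one`: `λ²G^{:}″(0⁺)/2! =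
  Σ_{y,z}η^{2d}C(x,y)·sig6 D(y,z)·C(z,x′) = dysonTerm (η^dC₀) (η^d·sig6) 1` with p26's typed `B3Eq123Counterterms.sig6 =
  4²(2N+4)λ²(C^ε_0)³` — (1.22)⑥'s coefficient and its place in (1.21) are theorems about the measure.
v1.2 (same seat and gen, APPEND-ONLY after v1.1's `secondCoeff_eq_dysonTerm_one`, §11–§13):
* §11 **THE COMPLETE ORDER-λ² TERM FOR THE PLAIN VERTEX `λΣ_yη^d∣φ(y)∣⁴` OF (1.20)** (`norm_four_eq_wick`: `∣φ∣⁴ = :∣φ∣⁴: +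
  2(N+2)C(y,y):∣φ∣²: + N(N+2)C(y,y)²`).  Kernels: `integral_wick2_legs` (the amputated square = `2C(x,z)C(x′,z)`),
  `integral_wick2_wick2` (bubble `2N·C(z,y)²`), `integral_wick2_wick2_legs` (bubble × free line + THE CHAIN `4C(z,y)(C(x,y)C(z,x′) +
  C(x′,y)C(z,x))`), `integral_wick4_wick2` (`= 0`), `integral_wick4_wick2_legs` (THE LOCAL TWO-LOOP KERNEL `8(N+2)C(z,y)²C(x,y)C(x′,y)`:
  the four legs of `:∣φ(y)∣⁴:` into the two external legs and the two legs of `:∣φ(z)∣²:`); the plain two-vertex moments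
  `integral_norm4_norm4(_legs)` and their sums `integral_V_sq(_legs)` organised by graph; and the conclusion
  `hasDerivWithinAt_firstDeriv_twoPointPhi4_graphs`: **`G″_{ab}(0⁺) = δ_{ab}Σ_{y,z}η^{2d}[4²(2N+4)C(z,y)³(C(x,y)C(z,x′) + C(x′,y)C(z,x))`
  (SUNSET ⑥) `+ 2(N+2)C(z,z)·8(N+2)C(z,y)²C(x,y)C(x′,y) + (y ↔ z)` (the LOCAL TWO-LOOP self-energy graph — a tadpole on the loop
  of a tadpole, among the "…" of (1.22)) `+ 2(N+2)C(y,y)·2(N+2)C(z,z)·4C(z,y)(C(x,y)C(z,x′) + C(x′,y)C(z,x))]` (the CHAIN of two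
  tadpoles ①, one-particle REDUCIBLE = the `n = 2` term of (1.21))** — every disconnected contribution of §7's four Gaussian moments
  cancels (linked-cluster at second order, by explicit computation: `linear_combination` of three finite-sum identities);
  DICTIONARY `chain_eq_dysonTerm_two`: the matrix of `λ²/2!·(chain part)` IS `dysonTerm (η^dC₀) (η^d·sig1) 2 = C₀[①]C₀[①]C₀`, the
  `n = 2` term of (1.21) with p26's typed `sig1` twice; `onePI_eq_C0_sig6_loc_C0`: `λ²/2!·(sunset + two-loop part) =
  Σ_{y,z}η^{2d}C(x,y)[sig6 D(y,z) + Σ^ε_{loc,2}(y,z)]C(z,x′)` with p26's typed `sig6` and the local insertion `Σ^ε_{loc,2}(y,z) =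
  λ²·16(N+2)²[Σ_vη^dC(v,v)C(v,y)²]·delta(y,z)` (p26's `delta`; print's "…") — so THROUGH ORDER λ² (at `e = 0`) the Taylor
  coefficients of (1.19) at `0⁺` ARE the terms of (1.21) with `X = sig1 + sig6 + Σ^ε_{loc,2}`: `C₀`, `C₀XC₀∣_{λ¹}`,
  `(C₀XC₀XC₀ + C₀XC₀)∣_{λ²}`.
* §12 **THE TAYLOR COEFFICIENTS IN MATHLIB'S `derivWithin`/`iteratedDerivWithin` ON `[0, ∞)`** (`derivWithin_twoPointPhi4_zero`,
  `derivWithin_twoPointPhi4_eq` — on all of `[0,∞)` the derivative within is the quotient-rule expression `D₁` (§4 at `0⁺`, §6 at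
  `λ > 0`, the value at `0` by `cov_V_legs`) —, and **`iteratedDerivWithin_two_twoPointPhi4`:
  `iteratedDerivWithin 2 (λ ↦ G_λ,ab(x,x′)) (Set.Ici 0) 0 = δ_{ab}Σ_{y,z}η^{2d}[⑥ + two-loop + chain]`** — the `k = 2` coefficient
  of p33's `TiltData.taylor_tiltExpect` on this carrier is the order-λ² line of (1.21)/(1.22)).
* §13 **THE VACUUM SIDE — (1.24) p. 417 AT `e = 0`** (print: *"E₁ = Σ_{1≤α+β≤n̄}(1/(α!β!))e^αλ^β(∂^{α+β}/∂e^α∂λ^β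
  log∫dA∫dφ e^{−S^ε(A,φ)})∣_{e=λ=0} (1.24) … Terms of this expansion are described by connected graphs without external legs
  (vacuum graphs)"*): `gaussInt_exp_neg_pos` (`Z^ε(λ) > 0`, `λ ≥ 0`), `hasDerivWithinAt_logZ` (**β = 1: `(d/dλ)log Z^ε∣_{0⁺} =
  −Σ_yη^dN(N+2)C(y,y)²`**, the "8"), `derivWithin_logZ_eq` (`= −⟨V⟩_λ` on `[0,∞)`), `hasDerivWithinAt_firstDeriv_logZ` (**β = 2:
  the right-derivative of `−⟨V⟩_λ` at `0⁺` is `Var₀(V) = Σ_{y,z}η^{2d}[8N(N+2)C(z,y)⁴ + 2(N+2)C(y,y)·2(N+2)C(z,z)·2N·C(z,y)²]`** —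
  basketball + bubble with two tadpole loops; the disconnected product of two "8"s cancels: CONNECTED vacuum graphs, as printed).
HONEST SCOPE.  Zero vector field (the `e = 0` sector; the terms ②③④⑤⑦ of (1.22) carry the vector field `A` and the vertices
(1.8)/(1.10) — NOT here), `δm² = 0` (the counterterm vertex (1.7) enters at order ≥ 2 in the couplings, p. 417).  For the
NORMALIZED two-point function ONE order in `λ` is carried to the end (§4–§5: at order `λ¹` the only amputated connected
two-scalar-leg graph is the tadpole ①, which is one-particle irreducible — the 1PI resummation says nothing new at this order);
at order `λ²` the coefficient is identified as a Gaussian expression (§7) and carried to the end, as a sum of graph values, both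
for the Wick-ordered vertex (§8–§10: the sunset ⑥ alone, `= C₀·sig6·C₀`) and for the plain vertex of (1.20) (§11: sunset + local
two-loop graph + tadpole chain, `= dysonTerm … 2 + C₀[sig6 + Σ^ε_{loc,2}]C₀`).  NOT done here: (a) orders `λ³` and higher
(Wick's theorem at general order is this seat's `GaussianWick`/`B3GaussianContractions`; the 1PI enumeration to all orders is
BRICKS 2–3); (b) the `e`-direction; (c) the structure to all orders: Dyson/1PI
resummation = BRICKS 2–3 (`B3Eq121OnePIChains`, `B3OnePIGraphs`), coefficients as truncated expectations = BRICK 4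
(`B3TwoPointPerturbativeCoefficients`), Wick's theorem at general order = this seat's `GaussianWick`/`B3GaussianContractions`.
Any level `j` and mesh `η` of the model tori (print: `T_ε`, `η = ε`), any `M² > 0`, `η^d > 0`.  Mathlib + the cited tree files
only.

References: [Balaban1983Higgs3] T. Bałaban, CMP 88 (1983) 411–445, (1.19)–(1.22) p. 416, (1.24) p. 417; [GlimmJaffeQP1987] J. Glimm, A. Jaffe,
*Quantum Physics* (2nd ed., Springer 1987), Thm 6.3.1 (6.3.3), Prop. 8.3.1, Cor. 8.3.2, §8.2–8.3, (9.1.5) (Wick's theorem /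
integration by parts / Feynman graphs / perturbation series §8.4–8.5).
-/

noncomputable section

open scoped BigOperators InnerProductSpace Topology

namespace Literature.MathematicalPhysics.QuantumFieldTheory.Balaban1983to89.B3Eq122FirstOrderWick

open _root_.MeasureTheory _root_.Filter
open LatticeFieldCalculus B3WT223Instance B3WTPropagator B3WTCovariance B3WickVertexCalculus B3Eq123Counterterms

variable {P : Params} {j N : ℕ} (C : HiggsLattice.ChargeData N) (η w c M2 : ℝ)

/-- the Gaussian weight `W(φ) = e^{−½⟨φ,(−Δ^η+M²)φ⟩}` at zero vector field (notation local to this file). -/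
local notation "W" => weight C η w c M2 (0 : VecField P j ℝ)

/-- the standard orthonormal basis vector `e_a` of `R^N` (notation local to this file). -/
local notation "𝐞" => EuclideanSpace.basisFun (Fin N) ℝ

/-! ## §1 The two external legs `φ_a(x)φ_b(x′)` -/

omit C η w c M2 in
/-- `⟪e_a, e_b⟫ = δ_{ab}`. [folklore] -/
private theorem inner_basis (a b : Fin N) : ⟪𝐞 a, 𝐞 b⟫_ℝ = if a = b then 1 else 0 := by
  classical
  exact orthonormal_iff_ite.mp (EuclideanSpace.basisFun (Fin N) ℝ).orthonormal a b

omit C η w c M2 in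
/-- `Σ_i ⟪e_i,e_a⟫⟪e_i,e_b⟫ = δ_{ab}` (`= ⟪e_a,e_b⟫`). [folklore] -/
private theorem sum_inner_basis_mul (a b : Fin N) :
    ∑ i : Fin N, ⟪𝐞 i, 𝐞 a⟫_ℝ * ⟪𝐞 i, 𝐞 b⟫_ℝ = ⟪𝐞 a, 𝐞 b⟫_ℝ := by
  classical
  simp_rw [inner_basis]
  rw [Finset.sum_eq_single a]
  · simp only [if_true, one_mul]
  · intro i _ hi
    rw [if_neg hi, zero_mul]
  · intro h; exact absurd (Finset.mem_univ a) h

/-- the two external legs of (1.19): `φ_a(x)φ_b(x′) = ⟪φ(x),e_a⟫⟪φ(x′),e_b⟫` as an observable on the field space.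
[cite: Balaban1983Higgs3, (1.19) p.416] -/
theorem expGrowth_legs (a b : Fin N) (x x' : Site P j) :
    ExpGrowth (fun φ : Cfg P j N => ⟪φ x, 𝐞 a⟫_ℝ * ⟪φ x', 𝐞 b⟫_ℝ) :=
  (ExpGrowth.inner_apply x _).mul (ExpGrowth.inner_apply x' _)

/-- contracting a leg `φ_i(y)` of the vertex into the two external legs: `D_{h_{y,i}}(φ_a(x)φ_b(x′)) =
C(x,y)δ_{ia}·φ_b(x′) + φ_a(x)·C(x′,y)δ_{ib}`. [cite: GlimmJaffeQP1987, Thm 6.3.1 (6.3.3)] -/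
theorem derivAlong_legs (a b : Fin N) (x x' y : Site P j) (i : Fin N) :
    DerivAlong (hx w c M2 y i) (fun φ : Cfg P j N => ⟪φ x, 𝐞 a⟫_ℝ * ⟪φ x', 𝐞 b⟫_ℝ)
      (fun φ => G w c M2 x y * ⟪𝐞 i, 𝐞 a⟫_ℝ * ⟪φ x', 𝐞 b⟫_ℝ + ⟪φ x, 𝐞 a⟫_ℝ * (G w c M2 x' y * ⟪𝐞 i, 𝐞 b⟫_ℝ)) :=
  ((DerivAlong.inner_apply (hx w c M2 y i) x (𝐞 a)).mul (DerivAlong.inner_apply (hx w c M2 y i) x' (𝐞 b))).congr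
    fun φ => by rw [inner_hx_left, inner_hx_left]

/-- the second contraction: `D²_{h_{y,i}}(φ_a(x)φ_b(x′)) = 2C(x,y)C(x′,y)δ_{ia}δ_{ib}` (a constant: both legs absorbed).
[cite: GlimmJaffeQP1987, Thm 6.3.1 (6.3.3)] -/
theorem derivAlong_legs' (a b : Fin N) (x x' y : Site P j) (i : Fin N) :
    DerivAlong (hx w c M2 y i)
      (fun φ : Cfg P j N => G w c M2 x y * ⟪𝐞 i, 𝐞 a⟫_ℝ * ⟪φ x', 𝐞 b⟫_ℝ + ⟪φ x, 𝐞 a⟫_ℝ * (G w c M2 x' y * ⟪𝐞 i, 𝐞 b⟫_ℝ))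
      (fun _ => 2 * (G w c M2 x y * ⟪𝐞 i, 𝐞 a⟫_ℝ) * (G w c M2 x' y * ⟪𝐞 i, 𝐞 b⟫_ℝ)) :=
  ((((DerivAlong.inner_apply (hx w c M2 y i) x' (𝐞 b)).const_mul _)).add
    ((DerivAlong.inner_apply (hx w c M2 y i) x (𝐞 a)).mul (DerivAlong.const _ _))).congr
    fun φ => by rw [inner_hx_left, inner_hx_left]; ring

/-! ## §2 Wick's theorem for the φ⁴ vertex against the two legs: the tadpole ① and its factor `4(N+2)` -/

/-- `∫W φ_a(x)φ_b(x′) = Z·C(x,x′)δ_{ab}` (the free two-point function; `B3WTCovariance.moment2`).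
[cite: Balaban1983Higgs3, (1.19) p.416] -/
theorem integral_legs (hw : 0 < w) (hM : 0 < M2) (a b : Fin N) (x x' : Site P j) :
    ∫ φ, W φ * (⟪φ x, 𝐞 a⟫_ℝ * ⟪φ x', 𝐞 b⟫_ℝ) = (∫ φ, W φ) * (G w c M2 x x' * ⟪𝐞 a, 𝐞 b⟫_ℝ) :=
  moment2 C η w c M2 hw hM x x' _ _

/-- **`∫W∣φ(y)∣⁴ = N(N+2)·C(y,y)²·Z`** — the vacuum double-tadpole (two self-lines at `y`, `N(N+2)` labelled pairings).
[cite: GlimmJaffeQP1987, Prop. 8.3.1 (8.3.3)–(8.3.5)] [cite: Balaban1983Higgs3, (1.22) p.416] -/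
theorem integral_norm_four (hw : 0 < w) (hM : 0 < M2) (y : Site P j) :
    ∫ φ, W φ * ‖φ y‖ ^ 4 = N * (N + 2) * G w c M2 y y ^ 2 * ∫ φ, W φ := by
  have h := integral_norm_four_mul C η w c M2 hw hM y (R := fun _ => (1 : ℝ)) (R₁ := fun _ _ => 0) (R₂ := fun _ _ => 0)
    (R₃ := fun _ _ _ => 0) (R₄ := fun _ _ _ => 0) (ExpGrowth.const 1) (fun _ => ExpGrowth.const 0)
    (fun _ => ExpGrowth.const 0) (fun _ _ => ExpGrowth.const 0) (fun _ _ => ExpGrowth.const 0)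
    (fun i => DerivAlong.const _ 1) (fun i => DerivAlong.const _ 0) (fun i k => DerivAlong.const _ 0)
    (fun i k => DerivAlong.const _ 0)
  simpa using h

/-- **WICK'S THEOREM FOR `∣φ(y)∣⁴` AGAINST THE TWO LEGS**:
`∫W·∣φ(y)∣⁴·φ_a(x)φ_b(x′) = Z·δ_{ab}·[N(N+2)C(y,y)²·C(x,x′) + 4(N+2)·C(y,y)C(x,y)C(x′,y)]` — either both external legs pair with
each other and the vertex closes on itself twice (the vacuum part), or both legs are contracted into the vertex and ONE self-line
remains: the tadpole ① of (1.22), with print's combinatoric factor `4(N+2) = (2N+4)·2` DERIVED (`2N+4` labelled one-self-line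
classes at the vertex × the `2` orders of absorbing the two legs). [cite: Balaban1983Higgs3, (1.22) p.416]
[cite: GlimmJaffeQP1987, Prop. 8.3.1 (8.3.3)–(8.3.5)] -/
theorem integral_norm_four_mul_legs (hw : 0 < w) (hM : 0 < M2) (a b : Fin N) (x x' y : Site P j) :
    ∫ φ, W φ * (‖φ y‖ ^ 4 * (⟪φ x, 𝐞 a⟫_ℝ * ⟪φ x', 𝐞 b⟫_ℝ)) =
      (∫ φ, W φ) * ⟪𝐞 a, 𝐞 b⟫_ℝ *
        (N * (N + 2) * G w c M2 y y ^ 2 * G w c M2 x x' + 4 * (N + 2) * G w c M2 y y * (G w c M2 x y * G w c M2 x' y)) := by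
  have h := integral_norm_four_mul C η w c M2 hw hM y
    (R := fun φ : Cfg P j N => ⟪φ x, 𝐞 a⟫_ℝ * ⟪φ x', 𝐞 b⟫_ℝ)
    (R₁ := fun i φ => G w c M2 x y * ⟪𝐞 i, 𝐞 a⟫_ℝ * ⟪φ x', 𝐞 b⟫_ℝ + ⟪φ x, 𝐞 a⟫_ℝ * (G w c M2 x' y * ⟪𝐞 i, 𝐞 b⟫_ℝ))
    (R₂ := fun i _ => 2 * (G w c M2 x y * ⟪𝐞 i, 𝐞 a⟫_ℝ) * (G w c M2 x' y * ⟪𝐞 i, 𝐞 b⟫_ℝ))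
    (R₃ := fun _ _ _ => 0) (R₄ := fun _ _ _ => 0) (expGrowth_legs a b x x')
    (fun i => (((ExpGrowth.inner_apply x' _).const_mul _)).add ((ExpGrowth.inner_apply x _).mul (ExpGrowth.const _)))
    (fun i => ExpGrowth.const _) (fun _ _ => ExpGrowth.const 0) (fun _ _ => ExpGrowth.const 0)
    (fun i => derivAlong_legs w c M2 a b x x' y i) (fun i => derivAlong_legs' w c M2 a b x x' y i)
    (fun i k => DerivAlong.const _ _) (fun i k => DerivAlong.const _ 0)
  have e : ∀ i : Fin N, ∫ φ : Cfg P j N, W φ * (2 * (G w c M2 x y * ⟪𝐞 i, 𝐞 a⟫_ℝ) * (G w c M2 x' y * ⟪𝐞 i, 𝐞 b⟫_ℝ)) =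
      (∫ φ, W φ) * (2 * (G w c M2 x y * G w c M2 x' y)) * (⟪𝐞 i, 𝐞 a⟫_ℝ * ⟪𝐞 i, 𝐞 b⟫_ℝ) := fun i => by
    rw [integral_mul_const]; ring
  simp only [mul_zero, integral_zero, Finset.sum_const_zero, add_zero] at h
  rw [h, integral_legs C η w c M2 hw hM a b x x']
  simp_rw [e]
  rw [← Finset.mul_sum, sum_inner_basis_mul]
  ring

/-! ## §3 The connected first-order insertion: the vacuum parts cancel, the tadpole remains -/

/-- the interaction of (1.20) per unit `λ`: `V(φ) = Σ_{y∈T}η^d∣φ(y)∣⁴` is an observable of exponential-linear growth.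
[cite: Balaban1983Higgs3, (1.20) p.416] -/
theorem expGrowth_V : ExpGrowth (fun φ : Cfg P j N => ∑ y : Site P j, w * ‖φ y‖ ^ 4) := by
  have h : ∀ y : Site P j, ExpGrowth (fun φ : Cfg P j N => w * ‖φ y‖ ^ 4) := fun y => by
    have e : (fun φ : Cfg P j N => w * ‖φ y‖ ^ 4) = fun φ => w * (‖φ y‖ ^ 2 * ‖φ y‖ ^ 2) := by
      funext φ; ring
    rw [e]
    exact ((ExpGrowth.norm_sq_apply y).mul (ExpGrowth.norm_sq_apply y)).const_mul w
  exact ExpGrowth.sum _ fun y _ => h y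

/-- `∫W·V·φ_a(x)φ_b(x′) = Z·δ_{ab}·Σ_y η^d[N(N+2)C(y,y)²C(x,x′) + 4(N+2)C(y,y)C(x,y)C(x′,y)]` (sum of §2 over the vertex position
with the volume element). [cite: Balaban1983Higgs3, (1.22) p.416] -/
theorem integral_V_mul_legs (hw : 0 < w) (hM : 0 < M2) (a b : Fin N) (x x' : Site P j) :
    ∫ φ, W φ * ((∑ y : Site P j, w * ‖φ y‖ ^ 4) * (⟪φ x, 𝐞 a⟫_ℝ * ⟪φ x', 𝐞 b⟫_ℝ)) =
      (∫ φ, W φ) * ⟪𝐞 a, 𝐞 b⟫_ℝ * ∑ y : Site P j, w *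
        (N * (N + 2) * G w c M2 y y ^ 2 * G w c M2 x x' + 4 * (N + 2) * G w c M2 y y * (G w c M2 x y * G w c M2 x' y)) := by
  have hi : ∀ y : Site P j, Integrable (fun φ : Cfg P j N => W φ * (w * (‖φ y‖ ^ 4 * (⟪φ x, 𝐞 a⟫_ℝ * ⟪φ x', 𝐞 b⟫_ℝ)))) :=
    fun y => by
    have e : (fun φ : Cfg P j N => W φ * (w * (‖φ y‖ ^ 4 * (⟪φ x, 𝐞 a⟫_ℝ * ⟪φ x', 𝐞 b⟫_ℝ)))) =
        fun φ => W φ * (w * (‖φ y‖ ^ 2 * ‖φ y‖ ^ 2 * (⟪φ x, 𝐞 a⟫_ℝ * ⟪φ x', 𝐞 b⟫_ℝ))) := by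
      funext φ; ring
    rw [e]
    exact ((((ExpGrowth.norm_sq_apply y).mul (ExpGrowth.norm_sq_apply y)).mul (expGrowth_legs a b x x')).const_mul w).integrable
      C η w c M2 hw hM
  have e1 : (fun φ : Cfg P j N => W φ * ((∑ y : Site P j, w * ‖φ y‖ ^ 4) * (⟪φ x, 𝐞 a⟫_ℝ * ⟪φ x', 𝐞 b⟫_ℝ))) =
      fun φ => ∑ y : Site P j, W φ * (w * (‖φ y‖ ^ 4 * (⟪φ x, 𝐞 a⟫_ℝ * ⟪φ x', 𝐞 b⟫_ℝ))) := by
    funext φ; rw [Finset.sum_mul, Finset.mul_sum]; exact Finset.sum_congr rfl fun y _ => by ring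
  rw [e1, integral_finsetSum _ (fun y _ => hi y), Finset.mul_sum]
  refine Finset.sum_congr rfl fun y _ => ?_
  have e2 : (fun φ : Cfg P j N => W φ * (w * (‖φ y‖ ^ 4 * (⟪φ x, 𝐞 a⟫_ℝ * ⟪φ x', 𝐞 b⟫_ℝ)))) =
      fun φ => w * (W φ * (‖φ y‖ ^ 4 * (⟪φ x, 𝐞 a⟫_ℝ * ⟪φ x', 𝐞 b⟫_ℝ))) := by
    funext φ; ring
  rw [e2, integral_const_mul, integral_norm_four_mul_legs C η w c M2 hw hM a b x x' y]
  ring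

/-- `∫W·V = Z·Σ_y η^d N(N+2)C(y,y)²` (the first-order vacuum graphs). [cite: Balaban1983Higgs3, (1.22) p.416] -/
theorem integral_V (hw : 0 < w) (hM : 0 < M2) :
    ∫ φ, W φ * (∑ y : Site P j, w * ‖φ y‖ ^ 4) = (∫ φ, W φ) * ∑ y : Site P j, w * (N * (N + 2) * G w c M2 y y ^ 2) := by
  have hi : ∀ y : Site P j, Integrable (fun φ : Cfg P j N => W φ * (w * ‖φ y‖ ^ 4)) := fun y => by
    have e : (fun φ : Cfg P j N => W φ * (w * ‖φ y‖ ^ 4)) = fun φ => W φ * (w * (‖φ y‖ ^ 2 * ‖φ y‖ ^ 2)) := by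
      funext φ; ring
    rw [e]
    exact (((ExpGrowth.norm_sq_apply y).mul (ExpGrowth.norm_sq_apply y)).const_mul w).integrable C η w c M2 hw hM
  have e1 : (fun φ : Cfg P j N => W φ * ∑ y : Site P j, w * ‖φ y‖ ^ 4) =
      fun φ => ∑ y : Site P j, W φ * (w * ‖φ y‖ ^ 4) := by
    funext φ; rw [Finset.mul_sum]
  rw [e1, integral_finsetSum _ (fun y _ => hi y), Finset.mul_sum]
  refine Finset.sum_congr rfl fun y _ => ?_
  have e2 : (fun φ : Cfg P j N => W φ * (w * ‖φ y‖ ^ 4)) = fun φ => w * (W φ * ‖φ y‖ ^ 4) := by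
    funext φ; ring
  rw [e2, integral_const_mul, integral_norm_four C η w c M2 hw hM y]
  ring

/-- **THE CONNECTED FIRST-ORDER TWO-POINT INSERTION** (the vacuum parts cancel, the tadpole ① remains):
`Z·∫W·V·φ_a(x)φ_b(x′) − (∫W·V)·(∫W·φ_a(x)φ_b(x′)) = Z²·δ_{ab}·4(N+2)·Σ_y η^d C(y,y)C(x,y)C(x′,y)` — the first-order coefficient of
the normalized expansion is the single amputated (one-particle-irreducible) graph ① of (1.22) between two free propagators.
[cite: Balaban1983Higgs3, (1.21)–(1.22) p.416] [cite: GlimmJaffeQP1987, §8.3] -/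
theorem cov_V_legs (hw : 0 < w) (hM : 0 < M2) (a b : Fin N) (x x' : Site P j) :
    (∫ φ, W φ) * (∫ φ, W φ * ((∑ y : Site P j, w * ‖φ y‖ ^ 4) * (⟪φ x, 𝐞 a⟫_ℝ * ⟪φ x', 𝐞 b⟫_ℝ)))
      - (∫ φ, W φ * (∑ y : Site P j, w * ‖φ y‖ ^ 4)) * (∫ φ, W φ * (⟪φ x, 𝐞 a⟫_ℝ * ⟪φ x', 𝐞 b⟫_ℝ)) =
      (∫ φ, W φ) ^ 2 * ⟪𝐞 a, 𝐞 b⟫_ℝ * (4 * (N + 2) *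
        ∑ y : Site P j, w * (G w c M2 y y * (G w c M2 x y * G w c M2 x' y))) := by
  rw [integral_V_mul_legs C η w c M2 hw hM, integral_V C η w c M2 hw hM, integral_legs C η w c M2 hw hM]
  simp only [Finset.mul_sum, Finset.sum_mul]
  rw [← Finset.sum_sub_distrib]
  exact Finset.sum_congr rfl fun y _ => by ring

/-! ## §4 First-order perturbation theory: the right-derivative of the λ∣φ∣⁴ two-point function at `λ = 0⁺` -/

omit C η w c M2 in
/-- `∣e^{−t} − 1∣ ≤ t` for `t ≥ 0`. [folklore] -/
private theorem abs_exp_neg_sub_one_le {t : ℝ} (ht : 0 ≤ t) : |Real.exp (-t) - 1| ≤ t := by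
  have h1 : Real.exp (-t) ≤ 1 := Real.exp_le_one_iff.mpr (by linarith)
  have h2 : 1 - t ≤ Real.exp (-t) := by linarith [Real.add_one_le_exp (-t)]
  rw [abs_sub_comm, abs_of_nonneg (by linarith)]
  linarith

/-- **ONE-SIDED DIFFERENTIATION UNDER THE GAUSSIAN INTEGRAL**: for observables `V ≥ 0`, `F` of exponential-linear growth,
`λ ↦ ∫W·e^{−λV}·F` (`λ ≥ 0`) has right-derivative `−∫W·V·F` at `λ = 0⁺` — dominated convergence on the difference quotients
(`∣(e^{−λV} − 1)/λ∣ ≤ V`); one-sided because `e^{−λV}` is not integrable against the Gaussian for `λ < 0` when `V` is quartic.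
This is the analytic content of *"G^ε has a perturbative expansion"* at first order. [cite: Balaban1983Higgs3, (1.21) p.416]
[cite: GlimmJaffeQP1987, §8.4–8.5] -/
theorem hasDerivWithinAt_gaussInt_exp_neg (hw : 0 < w) (hM : 0 < M2) {V F : Cfg P j N → ℝ}
    (hV : ExpGrowth V) (hV0 : ∀ φ, 0 ≤ V φ) (hF : ExpGrowth F) :
    HasDerivWithinAt (fun lam : ℝ => ∫ φ, W φ * (Real.exp (-(lam * V φ)) * F φ))
      (-(∫ φ, W φ * (V φ * F φ))) (Set.Ici 0) 0 := by
  have hWF : Integrable (fun φ : Cfg P j N => W φ * F φ) := hF.integrable C η w c M2 hw hM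
  have hWVF : Integrable (fun φ : Cfg P j N => W φ * (V φ * F φ)) := (hV.mul hF).integrable C η w c M2 hw hM
  -- integrability of the integrand for `λ ≥ 0` (a bounded continuous factor times `W·F`)
  have hIlam : ∀ lam : ℝ, 0 ≤ lam →
      Integrable (fun φ : Cfg P j N => W φ * (Real.exp (-(lam * V φ)) * F φ)) := by
    intro lam hlam
    have hmeas : AEStronglyMeasurable (fun φ : Cfg P j N => Real.exp (-(lam * V φ))) volume :=
      (Real.continuous_exp.comp ((continuous_const.mul hV.1).neg)).aestronglyMeasurable
    have hb := hWF.bdd_mul (c := 1) hmeas (Filter.Eventually.of_forall fun φ => by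
      rw [Real.norm_eq_abs, abs_of_pos (Real.exp_pos _)]
      exact Real.exp_le_one_iff.mpr (by nlinarith [hV0 φ]))
    refine hb.congr (Filter.Eventually.of_forall fun φ => ?_)
    show Real.exp (-(lam * V φ)) * (W φ * F φ) = W φ * (Real.exp (-(lam * V φ)) * F φ)
    ring
  have hI : Set.Ici (0 : ℝ) \ {0} = Set.Ioi 0 := by
    ext t
    simp only [Set.mem_sdiff, Set.mem_Ici, Set.mem_singleton_iff, Set.mem_Ioi]
    exact ⟨fun h => lt_of_le_of_ne h.1 (Ne.symm h.2), fun h => ⟨h.le, h.ne'⟩⟩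
  rw [hasDerivWithinAt_iff_tendsto_slope, hI]
  -- the difference quotients as integrals
  have hslope : ∀ lam : ℝ, 0 < lam →
      slope (fun lam : ℝ => ∫ φ, W φ * (Real.exp (-(lam * V φ)) * F φ)) 0 lam =
        ∫ φ, W φ * (F φ * ((Real.exp (-(lam * V φ)) - 1) / lam)) := by
    intro lam hlam
    rw [slope_def_field, sub_zero]
    have e0 : (fun φ : Cfg P j N => W φ * (Real.exp (-(0 * V φ)) * F φ)) = fun φ => W φ * F φ := by
      funext φ; rw [zero_mul, neg_zero, Real.exp_zero, one_mul]
    simp only [e0]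
    rw [← integral_sub (hIlam lam hlam.le) hWF, ← integral_div]
    refine integral_congr_ae (Filter.Eventually.of_forall fun φ => ?_)
    show (W φ * (Real.exp (-(lam * V φ)) * F φ) - W φ * F φ) / lam = W φ * (F φ * ((Real.exp (-(lam * V φ)) - 1) / lam))
    field_simp
  have hev : (fun lam => ∫ φ, W φ * (F φ * ((Real.exp (-(lam * V φ)) - 1) / lam))) =ᶠ[𝓝[Set.Ioi (0 : ℝ)] 0]
      slope (fun lam : ℝ => ∫ φ, W φ * (Real.exp (-(lam * V φ)) * F φ)) 0 :=
    eventually_nhdsWithin_of_forall fun lam hlam => (hslope lam hlam).symm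
  refine Filter.Tendsto.congr' hev ?_
  -- dominated convergence
  have hlim : (-(∫ φ, W φ * (V φ * F φ))) = ∫ φ, W φ * (F φ * (-V φ)) := by
    rw [← integral_neg]
    exact integral_congr_ae (Filter.Eventually.of_forall fun φ => by ring)
  rw [hlim]
  refine tendsto_integral_filter_of_dominated_convergence (fun φ => ‖W φ * (V φ * F φ)‖) ?_ ?_ hWVF.norm ?_
  · refine eventually_nhdsWithin_of_forall fun lam hlam => ?_
    exact ((hWF.aestronglyMeasurable).mul (((Real.continuous_exp.comp ((continuous_const.mul hV.1).neg)).sub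
      continuous_const).div_const lam).aestronglyMeasurable).congr (Filter.Eventually.of_forall fun φ => by
        show W φ * F φ * ((Real.exp (-(lam * V φ)) - 1) / lam) = W φ * (F φ * ((Real.exp (-(lam * V φ)) - 1) / lam))
        ring)
  · refine eventually_nhdsWithin_of_forall fun lam (hlam : 0 < lam) => Filter.Eventually.of_forall fun φ => ?_
    have hq : |(Real.exp (-(lam * V φ)) - 1) / lam| ≤ |V φ| := by
      rw [abs_div, abs_of_pos hlam, div_le_iff₀ hlam, abs_of_nonneg (hV0 φ)]
      have := abs_exp_neg_sub_one_le (t := lam * V φ) (by nlinarith [hV0 φ])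
      linarith [mul_comm lam (V φ)]
    rw [Real.norm_eq_abs, Real.norm_eq_abs, abs_mul, abs_mul, abs_mul, abs_mul]
    have hWn : 0 ≤ |W φ| := abs_nonneg _
    calc |W φ| * (|F φ| * |(Real.exp (-(lam * V φ)) - 1) / lam|)
        ≤ |W φ| * (|F φ| * |V φ|) := mul_le_mul_of_nonneg_left (mul_le_mul_of_nonneg_left hq (abs_nonneg _)) hWn
      _ = |W φ| * (|V φ| * |F φ|) := by ring
  · refine Filter.Eventually.of_forall fun φ => ?_
    have hd : HasDerivAt (fun lam : ℝ => Real.exp (-(lam * V φ))) (-V φ) 0 := by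
      have h1 : HasDerivAt (fun lam : ℝ => -(lam * V φ)) (-(1 * V φ)) 0 := ((hasDerivAt_id 0).mul_const (V φ)).neg
      have h2 : HasDerivAt (fun lam : ℝ => Real.exp (-(lam * V φ))) (Real.exp (-(0 * V φ)) * -(1 * V φ)) 0 :=
        h1.exp
      simpa using h2
    have ht : Tendsto (slope (fun lam : ℝ => Real.exp (-(lam * V φ))) 0) (𝓝[Set.Ioi (0:ℝ)] 0) (𝓝 (-V φ)) := by
      have h := hasDerivAt_iff_tendsto_slope.mp hd
      exact h.mono_left (nhdsWithin_mono _ fun t (ht : 0 < t) => ne_of_gt ht)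
    have ht' : Tendsto (fun lam : ℝ => (Real.exp (-(lam * V φ)) - 1) / lam) (𝓝[Set.Ioi (0:ℝ)] 0) (𝓝 (-V φ)) := by
      refine ht.congr' (eventually_nhdsWithin_of_forall fun lam hlam => ?_)
      rw [slope_def_field, sub_zero, zero_mul, neg_zero, Real.exp_zero]
    exact (ht'.const_mul (F φ)).const_mul (W φ)

/-- **FIRST-ORDER PERTURBATION THEORY FOR THE TWO-POINT FUNCTION** (the `e = 0`, `δm² = 0` sector of (1.19)): the λ∣φ∣⁴ two-point
function of the model torus, `G_λ,ab(x,x′) = ∫We^{−λV}φ_a(x)φ_b(x′) / ∫We^{−λV}` with `V = Σ_yη^d∣φ(y)∣⁴` (`λ ≥ 0`), is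
right-differentiable at `λ = 0⁺` with derivative `−δ_{ab}·4(N+2)·Σ_y η^d C(y,y)C(x,y)C(x′,y)` — THE `n = 1` TERM OF (1.21) AT ORDER
`λ`: two free propagators joined by the amputated 1PI graph ① of (1.22) per unit `λ`, `Σ^ε_{(0,1)}(y,y′) = −4(N+2)C^ε_0(0)δ^ε(y−y′)`.
[cite: Balaban1983Higgs3, (1.19)–(1.22) p.416] [cite: GlimmJaffeQP1987, §8.4–8.5] -/
theorem hasDerivWithinAt_twoPointPhi4 (hw : 0 < w) (hM : 0 < M2) (a b : Fin N) (x x' : Site P j) :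
    HasDerivWithinAt
      (fun lam : ℝ => (∫ φ, W φ * (Real.exp (-(lam * ∑ y : Site P j, w * ‖φ y‖ ^ 4)) * (⟪φ x, 𝐞 a⟫_ℝ * ⟪φ x', 𝐞 b⟫_ℝ)))
        / ∫ φ, W φ * (Real.exp (-(lam * ∑ y : Site P j, w * ‖φ y‖ ^ 4)) * 1))
      (-(⟪𝐞 a, 𝐞 b⟫_ℝ * (4 * (N + 2) * ∑ y : Site P j, w * (G w c M2 y y * (G w c M2 x y * G w c M2 x' y)))))
      (Set.Ici 0) 0 := by
  have hV : ExpGrowth (fun φ : Cfg P j N => ∑ y : Site P j, w * ‖φ y‖ ^ 4) := expGrowth_V w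
  have hV0 : ∀ φ : Cfg P j N, 0 ≤ ∑ y : Site P j, w * ‖φ y‖ ^ 4 := fun φ =>
    Finset.sum_nonneg fun y _ => mul_nonneg hw.le (by positivity)
  have hnum := hasDerivWithinAt_gaussInt_exp_neg C η w c M2 hw hM hV hV0 (expGrowth_legs a b x x')
  have hden := hasDerivWithinAt_gaussInt_exp_neg C η w c M2 hw hM hV hV0 (ExpGrowth.const 1)
  have hZ : 0 < ∫ φ, W φ := B3WT226Traces.Z_pos C η w c M2 hw hM
  have hden0 : (∫ φ : Cfg P j N, W φ * (Real.exp (-(0 * ∑ y : Site P j, w * ‖φ y‖ ^ 4)) * 1)) = ∫ φ, W φ := by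
    refine integral_congr_ae (Filter.Eventually.of_forall fun φ => ?_)
    show W φ * (Real.exp (-(0 * ∑ y : Site P j, w * ‖φ y‖ ^ 4)) * 1) = W φ
    rw [zero_mul, neg_zero, Real.exp_zero, mul_one, mul_one]
  have hnum0 : (∫ φ : Cfg P j N, W φ * (Real.exp (-(0 * ∑ y : Site P j, w * ‖φ y‖ ^ 4)) * (⟪φ x, 𝐞 a⟫_ℝ * ⟪φ x', 𝐞 b⟫_ℝ)))
      = ∫ φ, W φ * (⟪φ x, 𝐞 a⟫_ℝ * ⟪φ x', 𝐞 b⟫_ℝ) := by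
    refine integral_congr_ae (Filter.Eventually.of_forall fun φ => ?_)
    show W φ * (Real.exp (-(0 * ∑ y : Site P j, w * ‖φ y‖ ^ 4)) * (⟪φ x, 𝐞 a⟫_ℝ * ⟪φ x', 𝐞 b⟫_ℝ))
      = W φ * (⟪φ x, 𝐞 a⟫_ℝ * ⟪φ x', 𝐞 b⟫_ℝ)
    rw [zero_mul, neg_zero, Real.exp_zero, one_mul]
  have h := hnum.div hden (by rw [hden0]; exact hZ.ne')
  refine h.congr_deriv ?_
  rw [hden0, hnum0]
  have hV1 : (∫ φ : Cfg P j N, W φ * ((∑ y : Site P j, w * ‖φ y‖ ^ 4) * 1)) = ∫ φ, W φ * ∑ y : Site P j, w * ‖φ y‖ ^ 4 := by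
    simp only [mul_one]
  rw [hV1]
  have hcov := cov_V_legs C η w c M2 hw hM a b x x'
  have hZne : (∫ φ, W φ) ≠ 0 := hZ.ne'
  have e : (-(∫ φ, W φ * ((∑ y : Site P j, w * ‖φ y‖ ^ 4) * (⟪φ x, 𝐞 a⟫_ℝ * ⟪φ x', 𝐞 b⟫_ℝ)))) * (∫ φ, W φ)
      - (∫ φ, W φ * (⟪φ x, 𝐞 a⟫_ℝ * ⟪φ x', 𝐞 b⟫_ℝ)) * (-(∫ φ, W φ * ∑ y : Site P j, w * ‖φ y‖ ^ 4))
      = -((∫ φ, W φ) * (∫ φ, W φ * ((∑ y : Site P j, w * ‖φ y‖ ^ 4) * (⟪φ x, 𝐞 a⟫_ℝ * ⟪φ x', 𝐞 b⟫_ℝ)))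
          - (∫ φ, W φ * (∑ y : Site P j, w * ‖φ y‖ ^ 4)) * (∫ φ, W φ * (⟪φ x, 𝐞 a⟫_ℝ * ⟪φ x', 𝐞 b⟫_ℝ))) := by
    ring
  rw [e, hcov, neg_div, mul_assoc, mul_div_cancel_left₀ _ (pow_ne_zero 2 hZne)]

/-! ## §5 Dictionary: the first-order term is `C₀·Σ^ε_{(0,1)}·C₀` — p26's typed (1.22)① and r15's `dysonTerm` -/

/-- **THE COEFFICIENT IS p26's `sig1` BETWEEN TWO FREE PROPAGATORS**: for the (1.22) data `D` of `B3Eq123Counterterms` carrying this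
propagator (`D.C0 = C`, `D.N = N`, volume element `D.w = η^d`), `λ·(d/dλ)G_λ∣_{λ=0⁺}` (per `δ_{ab}`, §4) equals
`Σ_{y,y′}η^{2d}C(x,y)·sig1 D(y,y′)·C(y′,x′)` — the typed first term `sig1 = −4(N+2)λC^ε_0(0)δ^ε(x−x′)` of (1.22) is the first-order
self-energy DERIVED here (p26 typed it as printed; `C^ε_0(0)` = the diagonal value `C(y,y)`).
[cite: Balaban1983Higgs3, (1.21)–(1.22) p.416] -/
theorem deriv_eq_C0_sig1_C0 (hw : 0 < w) (D : SEData P j) (hC0 : D.C0 = G w c M2) (hN : D.N = N) (hwD : D.w = w)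
    (x x' : Site P j) :
    D.lam * (-(4 * (N + 2) * ∑ y : Site P j, w * (G w c M2 y y * (G w c M2 x y * G w c M2 x' y))))
      = ∑ y : Site P j, ∑ y' : Site P j, w * w * (G w c M2 x y * sig1 D y y' * G w c M2 y' x') := by
  have hw0 : w ≠ 0 := hw.ne'
  have inner : ∀ y : Site P j, ∑ y' : Site P j, w * w * (G w c M2 x y * sig1 D y y' * G w c M2 y' x')
      = D.lam * (-(4 * (N + 2) * (w * (G w c M2 y y * (G w c M2 x y * G w c M2 x' y))))) := by
    intro y
    have e : ∀ y' : Site P j, w * w * (G w c M2 x y * sig1 D y y' * G w c M2 y' x')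
        = if y = y' then w * w * (G w c M2 x y * (-4 * ((N : ℝ) + 2) * D.lam * G w c M2 y y * w⁻¹) * G w c M2 y' x')
          else 0 := by
      intro y'
      simp only [sig1, delta, hC0, hN, hwD]
      split_ifs with h
      · rfl
      · ring
    rw [Finset.sum_congr rfl fun y' _ => e y', Finset.sum_ite_eq, if_pos (Finset.mem_univ y), G_symm w c M2 y x']
    field_simp
  rw [Finset.sum_congr rfl fun y _ => inner y, Finset.mul_sum, ← Finset.sum_neg_distrib, Finset.mul_sum]

/-- **… AND IT IS THE `n = 1` TERM OF (1.21) in r15's `B3Sect1TwoPoint.dysonTerm` vocabulary**: in the ring of matrices on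
`T^{(j)}` realising kernel composition with the volume element (`K ↦ η^d·K`, so that `(η^dK₁)(η^dK₂) = η^d·(K₁∘K₂)` with
`(K₁∘K₂)(x,x′) = Σ_yη^dK₁(x,y)K₂(y,x′)`), the matrix of the first-order coefficient `λ·(d/dλ)G_λ∣_{0⁺}` is
`dysonTerm (η^d·C₀) (η^d·sig1) 1 = C₀[Σ^ε_{(0,1)}λ]C₀`. [cite: Balaban1983Higgs3, (1.21) p.416] -/
theorem deriv_eq_dysonTerm_one (hw : 0 < w) (D : SEData P j) (hC0 : D.C0 = G w c M2) (hN : D.N = N) (hwD : D.w = w) :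
    (Matrix.of fun x x' : Site P j =>
        w * (D.lam * (-(4 * (N + 2) * ∑ y : Site P j, w * (G w c M2 y y * (G w c M2 x y * G w c M2 x' y))))))
      = B3Sect1TwoPoint.dysonTerm (w • G w c M2) (Matrix.of fun y y' : Site P j => w * sig1 D y y') 1 := by
  ext x x'
  simp only [B3Sect1TwoPoint.dysonTerm, pow_one, Matrix.mul_apply, Matrix.of_apply, Matrix.smul_apply, smul_eq_mul]
  rw [deriv_eq_C0_sig1_C0 w c M2 hw D hC0 hN hwD x x', Finset.mul_sum]
  refine Finset.sum_congr rfl fun y _ => ?_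
  rw [Finset.mul_sum, Finset.mul_sum]
  exact Finset.sum_congr rfl fun y' _ => by ring

/-- **THE FIRST DYSON PARTIAL SUM** (r15's `dyson_partial` shape at `N = 2`): free propagator plus `λ` times the first-order
coefficient, `η^d·(C₀ + λ·(d/dλ)G_λ∣_{0⁺}) = Σ_{n<2} dysonTerm (η^dC₀) (η^d·sig1) n = C₀ + C₀[Σ^ε_{(0,1)}λ]C₀` — the first-order
Taylor polynomial of the two-point function at `λ = 0⁺` (§4) IS the structure (1.21) truncated at `n = 1` with the 1PI insertion ①.
[cite: Balaban1983Higgs3, (1.21)–(1.22) p.416] -/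
theorem firstDysonPartialSum (hw : 0 < w) (D : SEData P j) (hC0 : D.C0 = G w c M2) (hN : D.N = N) (hwD : D.w = w) :
    (Matrix.of fun x x' : Site P j => w * (G w c M2 x x'
        + D.lam * (-(4 * (N + 2) * ∑ y : Site P j, w * (G w c M2 y y * (G w c M2 x y * G w c M2 x' y))))))
      = ∑ n ∈ Finset.range 2,
          B3Sect1TwoPoint.dysonTerm (w • G w c M2) (Matrix.of fun y y' : Site P j => w * sig1 D y y') n := by
  rw [Finset.sum_range_succ, Finset.sum_range_one, ← deriv_eq_dysonTerm_one w c M2 hw D hC0 hN hwD]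
  ext x x'
  simp only [B3Sect1TwoPoint.dysonTerm, pow_zero, mul_one, Matrix.add_apply, Matrix.of_apply, Matrix.smul_apply,
    smul_eq_mul, mul_add]

/-! ## §6 (v1.1) The first-order formula at every coupling `λ₀ > 0` (two-sided) -/

/-- **DIFFERENTIATION UNDER THE GAUSSIAN INTEGRAL AT `λ₀ > 0`** (two-sided): for observables `V ≥ 0`, `F` of exponential-linear
growth, `λ ↦ ∫W·e^{−λV}·F` has derivative `−∫W·e^{−λ₀V}·V·F` at every `λ₀ > 0` (dominated differentiation over `λ > 0`, where
`∣∂_λ(e^{−λV}F)∣ = Ve^{−λV}∣F∣ ≤ V∣F∣`). With §4 the unnormalized two-point integrals are differentiable on all of `[0, ∞)` — the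
input for the higher-order terms of (1.21). [cite: Balaban1983Higgs3, (1.21) p.416] [cite: GlimmJaffeQP1987, §8.4–8.5] -/
theorem hasDerivAt_gaussInt_exp_neg (hw : 0 < w) (hM : 0 < M2) {V F : Cfg P j N → ℝ}
    (hV : ExpGrowth V) (hV0 : ∀ φ, 0 ≤ V φ) (hF : ExpGrowth F) {lam0 : ℝ} (hlam0 : 0 < lam0) :
    HasDerivAt (fun lam : ℝ => ∫ φ, W φ * (Real.exp (-(lam * V φ)) * F φ))
      (-(∫ φ, W φ * (Real.exp (-(lam0 * V φ)) * (V φ * F φ)))) lam0 := by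
  have hWc : Continuous (fun φ : Cfg P j N => W φ) := B3WT224Instance.continuous_weight C η w c M2 _
  have hWF : Integrable (fun φ : Cfg P j N => W φ * F φ) := hF.integrable C η w c M2 hw hM
  have hWVF : Integrable (fun φ : Cfg P j N => W φ * (V φ * F φ)) := (hV.mul hF).integrable C η w c M2 hw hM
  have hexpc : ∀ lam : ℝ, Continuous (fun φ : Cfg P j N => Real.exp (-(lam * V φ))) := fun lam =>
    Real.continuous_exp.comp ((continuous_const.mul hV.1).neg)
  have hcont : ∀ lam : ℝ, Continuous (fun φ : Cfg P j N => W φ * (Real.exp (-(lam * V φ)) * F φ)) := fun lam =>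
    hWc.mul ((hexpc lam).mul hF.1)
  have hcont' : ∀ lam : ℝ, Continuous (fun φ : Cfg P j N => W φ * (-(Real.exp (-(lam * V φ)) * (V φ * F φ)))) := fun lam =>
    hWc.mul ((hexpc lam).mul (hV.1.mul hF.1)).neg
  have hint : Integrable (fun φ : Cfg P j N => W φ * (Real.exp (-(lam0 * V φ)) * F φ)) := by
    have hb := hWF.bdd_mul (c := 1) (hexpc lam0).aestronglyMeasurable (Filter.Eventually.of_forall fun φ => by
      rw [Real.norm_eq_abs, abs_of_pos (Real.exp_pos _)]
      exact Real.exp_le_one_iff.mpr (by nlinarith [hV0 φ, hlam0.le]))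
    refine hb.congr (Filter.Eventually.of_forall fun φ => ?_)
    show Real.exp (-(lam0 * V φ)) * (W φ * F φ) = W φ * (Real.exp (-(lam0 * V φ)) * F φ)
    ring
  have h := hasDerivAt_integral_of_dominated_loc_of_deriv_le (μ := volume) (bound := fun φ => ‖W φ * (V φ * F φ)‖)
    (F := fun lam φ => W φ * (Real.exp (-(lam * V φ)) * F φ))
    (F' := fun lam φ => W φ * (-(Real.exp (-(lam * V φ)) * (V φ * F φ)))) (Ioi_mem_nhds hlam0)
    (Filter.Eventually.of_forall fun lam => (hcont lam).aestronglyMeasurable) hint (hcont' lam0).aestronglyMeasurable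
    ?_ hWVF.norm ?_
  · have e : (∫ φ : Cfg P j N, W φ * (-(Real.exp (-(lam0 * V φ)) * (V φ * F φ))))
        = -(∫ φ, W φ * (Real.exp (-(lam0 * V φ)) * (V φ * F φ))) := by
      rw [← integral_neg]
      exact integral_congr_ae (Filter.Eventually.of_forall fun φ => by ring)
    rw [← e]
    exact h.2
  · refine Filter.Eventually.of_forall fun φ lam (hlam : 0 < lam) => ?_
    have hexp : Real.exp (-(lam * V φ)) ≤ 1 := Real.exp_le_one_iff.mpr (by nlinarith [hV0 φ, hlam.le])
    rw [Real.norm_eq_abs, Real.norm_eq_abs, abs_mul, abs_mul, abs_neg, abs_mul, abs_of_pos (Real.exp_pos _)]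
    have h1 : Real.exp (-(lam * V φ)) * |V φ * F φ| ≤ |V φ * F φ| := by
      have := mul_le_mul_of_nonneg_right hexp (abs_nonneg (V φ * F φ))
      rwa [one_mul] at this
    exact mul_le_mul_of_nonneg_left h1 (abs_nonneg _)
  · refine Filter.Eventually.of_forall fun φ lam _ => ?_
    have h1 : HasDerivAt (fun lam : ℝ => -(lam * V φ)) (-(1 * V φ)) lam := ((hasDerivAt_id lam).mul_const (V φ)).neg
    have h2 : HasDerivAt (fun lam : ℝ => Real.exp (-(lam * V φ))) (Real.exp (-(lam * V φ)) * -(1 * V φ)) lam := h1.exp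
    refine ((h2.mul_const (F φ)).const_mul (W φ)).congr_deriv ?_
    ring

/-- **FIRST-ORDER PERTURBATION THEORY AT EVERY COUPLING `λ₀ > 0`**: the λ∣φ∣⁴ two-point function is differentiable at `λ₀ > 0`
with `(d/dλ)G_λ∣_{λ₀} = −Cov_{λ₀}(V, φ_a(x)φ_b(x′))` — the covariance in the INTERACTING measure `Z_{λ₀}^{−1}We^{−λ₀V}dφ`
(at `λ₀ = 0⁺` this is §4, where the covariance is evaluated by Wick's theorem). [cite: Balaban1983Higgs3, (1.19)–(1.21) p.416]
[cite: GlimmJaffeQP1987, §8.4–8.5] -/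
theorem hasDerivAt_twoPointPhi4 (hw : 0 < w) (hM : 0 < M2) (a b : Fin N) (x x' : Site P j) {lam0 : ℝ} (hlam0 : 0 < lam0) :
    HasDerivAt
      (fun lam : ℝ => (∫ φ, W φ * (Real.exp (-(lam * ∑ y : Site P j, w * ‖φ y‖ ^ 4)) * (⟪φ x, 𝐞 a⟫_ℝ * ⟪φ x', 𝐞 b⟫_ℝ)))
        / ∫ φ, W φ * (Real.exp (-(lam * ∑ y : Site P j, w * ‖φ y‖ ^ 4)) * 1))
      (((-(∫ φ, W φ * (Real.exp (-(lam0 * ∑ y : Site P j, w * ‖φ y‖ ^ 4))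
            * ((∑ y : Site P j, w * ‖φ y‖ ^ 4) * (⟪φ x, 𝐞 a⟫_ℝ * ⟪φ x', 𝐞 b⟫_ℝ)))))
          * (∫ φ, W φ * (Real.exp (-(lam0 * ∑ y : Site P j, w * ‖φ y‖ ^ 4)) * 1))
        - (∫ φ, W φ * (Real.exp (-(lam0 * ∑ y : Site P j, w * ‖φ y‖ ^ 4)) * (⟪φ x, 𝐞 a⟫_ℝ * ⟪φ x', 𝐞 b⟫_ℝ)))
          * (-(∫ φ, W φ * (Real.exp (-(lam0 * ∑ y : Site P j, w * ‖φ y‖ ^ 4)) * ((∑ y : Site P j, w * ‖φ y‖ ^ 4) * 1)))))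
        / (∫ φ, W φ * (Real.exp (-(lam0 * ∑ y : Site P j, w * ‖φ y‖ ^ 4)) * 1)) ^ 2)
      lam0 := by
  have hV : ExpGrowth (fun φ : Cfg P j N => ∑ y : Site P j, w * ‖φ y‖ ^ 4) := expGrowth_V w
  have hV0 : ∀ φ : Cfg P j N, 0 ≤ ∑ y : Site P j, w * ‖φ y‖ ^ 4 := fun φ =>
    Finset.sum_nonneg fun y _ => mul_nonneg hw.le (by positivity)
  have hnum := hasDerivAt_gaussInt_exp_neg C η w c M2 hw hM hV hV0 (expGrowth_legs a b x x') hlam0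
  have hden := hasDerivAt_gaussInt_exp_neg C η w c M2 hw hM hV hV0 (ExpGrowth.const 1) hlam0
  -- the denominator is positive: `W·e^{−λ₀V} > 0` pointwise, continuous, integrable
  have hpos : 0 < ∫ φ : Cfg P j N, W φ * (Real.exp (-(lam0 * ∑ y : Site P j, w * ‖φ y‖ ^ 4)) * 1) := by
    have hc : Continuous (fun φ : Cfg P j N => W φ * (Real.exp (-(lam0 * ∑ y : Site P j, w * ‖φ y‖ ^ 4)) * 1)) :=
      (B3WT224Instance.continuous_weight C η w c M2 _).mul
        ((Real.continuous_exp.comp ((continuous_const.mul hV.1).neg)).mul continuous_const)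
    have hi : Integrable (fun φ : Cfg P j N => W φ * (Real.exp (-(lam0 * ∑ y : Site P j, w * ‖φ y‖ ^ 4)) * 1)) := by
      have hexpc0 : Continuous (fun φ : Cfg P j N => Real.exp (-(lam0 * ∑ y : Site P j, w * ‖φ y‖ ^ 4))) :=
        Real.continuous_exp.comp ((continuous_const.mul hV.1).neg)
      have hb := ((ExpGrowth.const (1 : ℝ)).integrable C η w c M2 hw hM).bdd_mul (c := 1) hexpc0.aestronglyMeasurable
        (Filter.Eventually.of_forall fun φ => by
          rw [Real.norm_eq_abs, abs_of_pos (Real.exp_pos _)]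
          exact Real.exp_le_one_iff.mpr (by nlinarith [hV0 φ, hlam0.le]))
      refine hb.congr (Filter.Eventually.of_forall fun φ => ?_)
      show Real.exp (-(lam0 * ∑ y : Site P j, w * ‖φ y‖ ^ 4)) * (W φ * 1)
        = W φ * (Real.exp (-(lam0 * ∑ y : Site P j, w * ‖φ y‖ ^ 4)) * 1)
      ring
    have hptw : ∀ φ : Cfg P j N, 0 < W φ * (Real.exp (-(lam0 * ∑ y : Site P j, w * ‖φ y‖ ^ 4)) * 1) := fun φ =>
      mul_pos (weight_pos (C := C) (η := η) (w := w) (c := c) (M2 := M2) _ φ) (by rw [mul_one]; exact Real.exp_pos _)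
    rw [integral_pos_iff_support_of_nonneg (fun φ => (hptw φ).le) hi]
    have hsupp : Function.support (fun φ : Cfg P j N => W φ * (Real.exp (-(lam0 * ∑ y : Site P j, w * ‖φ y‖ ^ 4)) * 1))
        = Set.univ :=
      Set.eq_univ_iff_forall.mpr fun φ => Function.mem_support.mpr (hptw φ).ne'
    rw [hsupp]
    exact isOpen_univ.measure_pos volume Set.univ_nonempty
  exact hnum.div hden hpos.ne'

/-! ## §7 (v1.1) Second order: the two-point function is `C¹` on `[0,∞)` and its derivative is right-differentiable at `0⁺`
— the order-`λ²` coefficient of the perturbative expansion EXISTS, as the second cumulant-type Gaussian expression -/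

/-- the unnormalized moments `N_g(λ) = ∫W·e^{−λV}·g` at `λ = 0` are the Gaussian integrals `∫W·g`.
[cite: Balaban1983Higgs3, (1.21) p.416] -/
theorem gaussInt_exp_neg_zero (V g : Cfg P j N → ℝ) :
    (∫ φ, W φ * (Real.exp (-((0 : ℝ) * V φ)) * g φ)) = ∫ φ, W φ * g φ := by
  refine integral_congr_ae (Filter.Eventually.of_forall fun φ => ?_)
  show W φ * (Real.exp (-((0 : ℝ) * V φ)) * g φ) = W φ * g φ
  rw [zero_mul, neg_zero, Real.exp_zero, one_mul]

/-- **THE SECOND-ORDER COEFFICIENT EXISTS**: with `N_g(λ) = ∫W·e^{−λV}·g` (`V = Σ_yη^d∣φ(y)∣⁴`, `F = φ_a(x)φ_b(x′)`), the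
quotient-rule expression `D₁(λ) = (−N_{VF}(λ)N_1(λ) + N_F(λ)N_V(λ))/N_1(λ)²` — which IS `(d/dλ)G_λ` at every `λ ≥ 0` (§4 at `0⁺`,
§6 at `λ₀ > 0`) — is right-differentiable at `λ = 0⁺`, with derivative the second cumulant-type expression
`E₀[V²F] − E₀[F]E₀[V²] − 2E₀[V]E₀[VF] + 2E₀[F]E₀[V]²` (`E₀ = Z^{−1}∫W·(−)`): the order-`λ²` Taylor coefficient of the two-point
function at `0⁺` exists and is a Gaussian expression — whose Wick evaluation for WICK-ORDERED vertices is §8–§9 (basketball;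
the sunset ⑥ `4²(2N+4)λ²(C^ε_0)³` of (1.22)); the reduction of the plain `∣φ∣⁴` vertices to `wick4` ones (adding the chain of two
tadpoles = `dysonTerm … 2` and the local two-loop 1PI graph) is not carried out in this file.  The all-orders form of this
statement on an abstract carrier is p33's `B3TwoPointPerturbativeCoefficients.TiltData.iteratedDerivWithin_tiltExpect_eq_ursellOf`.
[cite: Balaban1983Higgs3, (1.21)–(1.22) p.416] [cite: GlimmJaffeQP1987, §8.4–8.5] -/
theorem hasDerivWithinAt_firstDeriv_twoPointPhi4 (hw : 0 < w) (hM : 0 < M2) (a b : Fin N) (x x' : Site P j) :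
    HasDerivWithinAt
      (fun lam : ℝ =>
        ((-(∫ φ, W φ * (Real.exp (-(lam * ∑ y : Site P j, w * ‖φ y‖ ^ 4))
              * ((∑ y : Site P j, w * ‖φ y‖ ^ 4) * (⟪φ x, 𝐞 a⟫_ℝ * ⟪φ x', 𝐞 b⟫_ℝ)))))
            * (∫ φ, W φ * (Real.exp (-(lam * ∑ y : Site P j, w * ‖φ y‖ ^ 4)) * 1))
          + (∫ φ, W φ * (Real.exp (-(lam * ∑ y : Site P j, w * ‖φ y‖ ^ 4)) * (⟪φ x, 𝐞 a⟫_ℝ * ⟪φ x', 𝐞 b⟫_ℝ)))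
            * (∫ φ, W φ * (Real.exp (-(lam * ∑ y : Site P j, w * ‖φ y‖ ^ 4))
                * ((∑ y : Site P j, w * ‖φ y‖ ^ 4) * 1))))
          / (∫ φ, W φ * (Real.exp (-(lam * ∑ y : Site P j, w * ‖φ y‖ ^ 4)) * 1)) ^ 2)
      ((∫ φ, W φ * ((∑ y : Site P j, w * ‖φ y‖ ^ 4) ^ 2 * (⟪φ x, 𝐞 a⟫_ℝ * ⟪φ x', 𝐞 b⟫_ℝ))) / (∫ φ, W φ)
        - (∫ φ, W φ * (⟪φ x, 𝐞 a⟫_ℝ * ⟪φ x', 𝐞 b⟫_ℝ)) * (∫ φ, W φ * (∑ y : Site P j, w * ‖φ y‖ ^ 4) ^ 2)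
            / (∫ φ, W φ) ^ 2
        - 2 * (∫ φ, W φ * ∑ y : Site P j, w * ‖φ y‖ ^ 4)
            * (∫ φ, W φ * ((∑ y : Site P j, w * ‖φ y‖ ^ 4) * (⟪φ x, 𝐞 a⟫_ℝ * ⟪φ x', 𝐞 b⟫_ℝ))) / (∫ φ, W φ) ^ 2
        + 2 * (∫ φ, W φ * (⟪φ x, 𝐞 a⟫_ℝ * ⟪φ x', 𝐞 b⟫_ℝ)) * (∫ φ, W φ * ∑ y : Site P j, w * ‖φ y‖ ^ 4) ^ 2
            / (∫ φ, W φ) ^ 3)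
      (Set.Ici 0) 0 := by
  have hV : ExpGrowth (fun φ : Cfg P j N => ∑ y : Site P j, w * ‖φ y‖ ^ 4) := expGrowth_V w
  have hV0 : ∀ φ : Cfg P j N, 0 ≤ ∑ y : Site P j, w * ‖φ y‖ ^ 4 := fun φ =>
    Finset.sum_nonneg fun y _ => mul_nonneg hw.le (by positivity)
  have hF : ExpGrowth (fun φ : Cfg P j N => ⟪φ x, 𝐞 a⟫_ℝ * ⟪φ x', 𝐞 b⟫_ℝ) := expGrowth_legs a b x x'
  -- the four moments entering `D₁` and their right-derivatives at `0⁺` (§4)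
  have hVF := hasDerivWithinAt_gaussInt_exp_neg C η w c M2 hw hM hV hV0 (hV.mul hF)
  have h1 := hasDerivWithinAt_gaussInt_exp_neg C η w c M2 hw hM hV hV0 (ExpGrowth.const 1)
  have hFd := hasDerivWithinAt_gaussInt_exp_neg C η w c M2 hw hM hV hV0 hF
  have hV1 := hasDerivWithinAt_gaussInt_exp_neg C η w c M2 hw hM hV hV0 (hV.mul (ExpGrowth.const 1))
  have hZ : 0 < ∫ φ, W φ := B3WT226Traces.Z_pos C η w c M2 hw hM
  have hden0 : (∫ φ : Cfg P j N, W φ * (Real.exp (-(0 * ∑ y : Site P j, w * ‖φ y‖ ^ 4)) * 1)) = ∫ φ, W φ := by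
    rw [gaussInt_exp_neg_zero]; simp only [mul_one]
  have h := ((hVF.neg.mul h1).add (hFd.mul hV1)).div (h1.pow 2) (by
    show (∫ φ : Cfg P j N, W φ * (Real.exp (-(0 * ∑ y : Site P j, w * ‖φ y‖ ^ 4)) * 1)) ^ 2 ≠ 0
    rw [hden0]; exact pow_ne_zero 2 hZ.ne')
  refine h.congr_deriv ?_
  -- evaluate everything at `λ = 0`
  simp only [Pi.pow_apply, Pi.neg_apply, Pi.mul_apply, Pi.add_apply, zero_mul, neg_zero, Real.exp_zero, one_mul, mul_one]
  have e1 : (∫ φ : Cfg P j N, W φ * ((∑ y : Site P j, w * ‖φ y‖ ^ 4) * ((∑ y : Site P j, w * ‖φ y‖ ^ 4)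
      * (⟪φ x, 𝐞 a⟫_ℝ * ⟪φ x', 𝐞 b⟫_ℝ))))
      = ∫ φ, W φ * ((∑ y : Site P j, w * ‖φ y‖ ^ 4) ^ 2 * (⟪φ x, 𝐞 a⟫_ℝ * ⟪φ x', 𝐞 b⟫_ℝ)) :=
    integral_congr_ae (Filter.Eventually.of_forall fun φ => by ring)
  have e2 : (∫ φ : Cfg P j N, W φ * ((∑ y : Site P j, w * ‖φ y‖ ^ 4) * ∑ y : Site P j, w * ‖φ y‖ ^ 4))
      = ∫ φ, W φ * (∑ y : Site P j, w * ‖φ y‖ ^ 4) ^ 2 :=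
    integral_congr_ae (Filter.Eventually.of_forall fun φ => by ring)
  rw [e1, e2]
  set Z : ℝ := ∫ φ, W φ with hZdef
  set IF : ℝ := ∫ φ, W φ * (⟪φ x, 𝐞 a⟫_ℝ * ⟪φ x', 𝐞 b⟫_ℝ)
  set IV : ℝ := ∫ φ, W φ * ∑ y : Site P j, w * ‖φ y‖ ^ 4
  set IVF : ℝ := ∫ φ, W φ * ((∑ y : Site P j, w * ‖φ y‖ ^ 4) * (⟪φ x, 𝐞 a⟫_ℝ * ⟪φ x', 𝐞 b⟫_ℝ))
  set IV2F : ℝ := ∫ φ, W φ * ((∑ y : Site P j, w * ‖φ y‖ ^ 4) ^ 2 * (⟪φ x, 𝐞 a⟫_ℝ * ⟪φ x', 𝐞 b⟫_ℝ))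
  set IV2 : ℝ := ∫ φ, W φ * (∑ y : Site P j, w * ‖φ y‖ ^ 4) ^ 2
  have hZne : Z ≠ 0 := hZ.ne'
  field_simp
  ring

/-! ## §8 (v1.1) Two Wick-ordered quartic vertices: the vacuum "basketball" `∫W:∣φ(y)∣⁴::∣φ(z)∣⁴: = 8N(N+2)C(z,y)⁴Z` -/

omit C η w c M2 in
/-- `Σ_{i,k}⟪e_k,e_i⟫² = N`. [folklore] -/
private theorem sum_sum_inner_basis_sq : ∑ i : Fin N, ∑ k : Fin N, ⟪𝐞 k, 𝐞 i⟫_ℝ ^ 2 = N := by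
  classical
  have e : ∀ i k : Fin N, ⟪𝐞 k, 𝐞 i⟫_ℝ ^ 2 = if k = i then 1 else 0 := fun i k => by
    rw [inner_basis]; split_ifs <;> simp
  simp_rw [e, Finset.sum_ite_eq', if_pos (Finset.mem_univ _), Finset.sum_const, Finset.card_univ, Fintype.card_fin,
    nsmul_eq_mul, mul_one]

omit C η in
/-- the four contractions of `:∣φ(z)∣⁴:` along `h_{y,i}, h_{y,i}, h_{y,k}, h_{y,k}` (`u = C(z,y)`, `g = C(z,z)`):
`D_{y,i}:∣φ(z)∣⁴: = 4uφ_i(z)(∣φ(z)∣² − (N+2)g)`. [cite: GlimmJaffeQP1987, Prop. 8.3.1] -/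
theorem derivAlong_wick4_1 (y z : Site P j) (i : Fin N) :
    DerivAlong (hx w c M2 y i) (fun φ : Cfg P j N => wick4 w c M2 z φ)
      (fun φ => 4 * G w c M2 z y * (⟪φ z, 𝐞 i⟫_ℝ * (‖φ z‖ ^ 2 - (N + 2) * G w c M2 z z))) := by
  have ew : (fun φ : Cfg P j N => wick4 w c M2 z φ) = fun φ =>
      ‖φ z‖ ^ 2 * ‖φ z‖ ^ 2 - 2 * (N + 2) * G w c M2 z z * ‖φ z‖ ^ 2 + N * (N + 2) * G w c M2 z z ^ 2 :=
    funext fun φ => by rw [wick4_def]; ring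
  rw [ew]
  have nsq := DerivAlong.norm_sq_apply (hx w c M2 y i) z
  exact (((nsq.mul nsq).sub (nsq.const_mul _)).add (DerivAlong.const _ _)).congr fun φ => by
    rw [inner_hx_right]; ring

omit C η in
/-- `D_{y,i}²:∣φ(z)∣⁴: = 4u²(∣φ(z)∣² − (N+2)g + 2φ_i(z)²)`. [cite: GlimmJaffeQP1987, Prop. 8.3.1] -/
theorem derivAlong_wick4_2 (y z : Site P j) (i : Fin N) :
    DerivAlong (hx w c M2 y i)
      (fun φ : Cfg P j N => 4 * G w c M2 z y * (⟪φ z, 𝐞 i⟫_ℝ * (‖φ z‖ ^ 2 - (N + 2) * G w c M2 z z)))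
      (fun φ => 4 * G w c M2 z y ^ 2 *
        ((‖φ z‖ ^ 2 - (N + 2) * G w c M2 z z) + 2 * (⟪φ z, 𝐞 i⟫_ℝ * ⟪φ z, 𝐞 i⟫_ℝ))) := by
  have nsq := DerivAlong.norm_sq_apply (hx w c M2 y i) z
  have hin := DerivAlong.inner_apply (hx w c M2 y i) z (𝐞 i)
  exact ((hin.mul (nsq.sub (DerivAlong.const _ _))).const_mul _).congr fun φ => by
    rw [inner_hx_right, inner_hx_left, inner_basis, if_pos rfl]; ring

omit C η in
/-- `D_{y,k}D_{y,i}²:∣φ(z)∣⁴: = 8u³(φ_k(z) + 2δ_{ki}φ_i(z))`. [cite: GlimmJaffeQP1987, Prop. 8.3.1] -/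
theorem derivAlong_wick4_3 (y z : Site P j) (i k : Fin N) :
    DerivAlong (hx w c M2 y k)
      (fun φ : Cfg P j N => 4 * G w c M2 z y ^ 2 *
        ((‖φ z‖ ^ 2 - (N + 2) * G w c M2 z z) + 2 * (⟪φ z, 𝐞 i⟫_ℝ * ⟪φ z, 𝐞 i⟫_ℝ)))
      (fun φ => 8 * G w c M2 z y ^ 3 * (⟪φ z, 𝐞 k⟫_ℝ + 2 * ⟪𝐞 k, 𝐞 i⟫_ℝ * ⟪φ z, 𝐞 i⟫_ℝ)) := by
  have nsq := DerivAlong.norm_sq_apply (hx w c M2 y k) z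
  have hin := DerivAlong.inner_apply (hx w c M2 y k) z (𝐞 i)
  exact (((nsq.sub (DerivAlong.const _ _)).add ((hin.mul hin).const_mul 2)).const_mul _).congr fun φ => by
    rw [inner_hx_right, inner_hx_left]; ring

omit C η in
/-- `D_{y,k}²D_{y,i}²:∣φ(z)∣⁴: = 8u⁴(1 + 2δ_{ki})` — a constant: all four legs of the vertex at `z` absorbed.
[cite: GlimmJaffeQP1987, Prop. 8.3.1] -/
theorem derivAlong_wick4_4 (y z : Site P j) (i k : Fin N) :
    DerivAlong (hx w c M2 y k)
      (fun φ : Cfg P j N => 8 * G w c M2 z y ^ 3 * (⟪φ z, 𝐞 k⟫_ℝ + 2 * ⟪𝐞 k, 𝐞 i⟫_ℝ * ⟪φ z, 𝐞 i⟫_ℝ))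
      (fun _ => 8 * G w c M2 z y ^ 4 * (1 + 2 * ⟪𝐞 k, 𝐞 i⟫_ℝ ^ 2)) := by
  have hk := DerivAlong.inner_apply (hx w c M2 y k) z (𝐞 k)
  have hi := DerivAlong.inner_apply (hx w c M2 y k) z (𝐞 i)
  exact ((hk.add (hi.const_mul _)).const_mul _).congr fun φ => by
    rw [inner_hx_left, inner_hx_left, inner_basis, if_pos rfl]; ring

/-- **THE VACUUM GRAPH WITH TWO QUARTIC VERTICES ("basketball")**: `∫W·:∣φ(y)∣⁴:·:∣φ(z)∣⁴: = 8N(N+2)·C(z,y)⁴·Z` — all four legs of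
each Wick-ordered vertex contracted into the other (`4!` bijections weighted by the `O(N)` index sums, `8N² + 16N`): the
second-order vacuum term of the perturbative expansion of the normalization `Z^ε` in (1.19) (and of `log Z` in (1.24)), by this seat's
contraction rule `B3WickVertexCalculus.integral_wick4_mul` with the four contractions above.
[cite: Balaban1983Higgs3, (1.19)–(1.21) p.416] [cite: GlimmJaffeQP1987, Prop. 8.3.1, Cor. 8.3.2] -/
theorem integral_wick4_wick4 (hw : 0 < w) (hM : 0 < M2) (y z : Site P j) :
    ∫ φ, W φ * (wick4 w c M2 y φ * wick4 w c M2 z φ) = 8 * (N * (N + 2)) * G w c M2 z y ^ 4 * ∫ φ, W φ := by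
  have key := integral_wick4_mul C η w c M2 hw hM y (R := fun φ : Cfg P j N => wick4 w c M2 z φ)
    (R₁ := fun i φ => 4 * G w c M2 z y * (⟪φ z, 𝐞 i⟫_ℝ * (‖φ z‖ ^ 2 - (N + 2) * G w c M2 z z)))
    (R₂ := fun i φ => 4 * G w c M2 z y ^ 2 *
      ((‖φ z‖ ^ 2 - (N + 2) * G w c M2 z z) + 2 * (⟪φ z, 𝐞 i⟫_ℝ * ⟪φ z, 𝐞 i⟫_ℝ)))
    (R₃ := fun i k φ => 8 * G w c M2 z y ^ 3 * (⟪φ z, 𝐞 k⟫_ℝ + 2 * ⟪𝐞 k, 𝐞 i⟫_ℝ * ⟪φ z, 𝐞 i⟫_ℝ))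
    (R₄ := fun i k _ => 8 * G w c M2 z y ^ 4 * (1 + 2 * ⟪𝐞 k, 𝐞 i⟫_ℝ ^ 2))
    (expGrowth_wick4 w c M2 z)
    (fun i => ((ExpGrowth.inner_apply z _).mul ((ExpGrowth.norm_sq_apply z).sub (ExpGrowth.const _))).const_mul _)
    (fun i => (((ExpGrowth.norm_sq_apply z).sub (ExpGrowth.const _)).add
      (((ExpGrowth.inner_apply z _).mul (ExpGrowth.inner_apply z _)).const_mul 2)).const_mul _)
    (fun i k => ((ExpGrowth.inner_apply z _).add ((ExpGrowth.inner_apply z _).const_mul _)).const_mul _)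
    (fun i k => ExpGrowth.const _)
    (fun i => derivAlong_wick4_1 w c M2 y z i) (fun i => derivAlong_wick4_2 w c M2 y z i)
    (fun i k => derivAlong_wick4_3 w c M2 y z i k) (fun i k => derivAlong_wick4_4 w c M2 y z i k)
  rw [key]
  have hS : ∑ i : Fin N, ∑ k : Fin N, (1 + 2 * ⟪𝐞 k, 𝐞 i⟫_ℝ ^ 2) = (N : ℝ) * N + 2 * N := by
    have h1 : ∀ i : Fin N, ∑ k : Fin N, (1 + 2 * ⟪𝐞 k, 𝐞 i⟫_ℝ ^ 2) = N + 2 * ∑ k : Fin N, ⟪𝐞 k, 𝐞 i⟫_ℝ ^ 2 :=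
      fun i => by
      rw [Finset.sum_add_distrib, Finset.sum_const, Finset.card_univ, Fintype.card_fin, nsmul_eq_mul, mul_one,
        Finset.mul_sum]
    simp_rw [h1]
    rw [Finset.sum_add_distrib, Finset.sum_const, Finset.card_univ, Fintype.card_fin, nsmul_eq_mul, ← Finset.mul_sum,
      sum_sum_inner_basis_sq]
  simp_rw [integral_mul_const, ← Finset.mul_sum]
  rw [hS]
  ring

/-! ## §9 (v1.1) THE SUNSET ⑥: two Wick-ordered quartic vertices against the two legs, print's factor `4²(2N+4)` -/

/-- cross second contraction of the legs: `D_{y,k}D_{y,i}(φ_a(x)φ_b(x′)) = C(x,y)C(x′,y)(δ_{ia}δ_{kb} + δ_{ka}δ_{ib})`.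
[cite: GlimmJaffeQP1987, Thm 6.3.1 (6.3.3)] -/
theorem derivAlong_legs_cross (a b : Fin N) (x x' y : Site P j) (i k : Fin N) :
    DerivAlong (hx w c M2 y k)
      (fun φ : Cfg P j N => G w c M2 x y * ⟪𝐞 i, 𝐞 a⟫_ℝ * ⟪φ x', 𝐞 b⟫_ℝ + ⟪φ x, 𝐞 a⟫_ℝ * (G w c M2 x' y * ⟪𝐞 i, 𝐞 b⟫_ℝ))
      (fun _ => G w c M2 x y * G w c M2 x' y * (⟪𝐞 i, 𝐞 a⟫_ℝ * ⟪𝐞 k, 𝐞 b⟫_ℝ + ⟪𝐞 k, 𝐞 a⟫_ℝ * ⟪𝐞 i, 𝐞 b⟫_ℝ)) :=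
  ((((DerivAlong.inner_apply (hx w c M2 y k) x' (𝐞 b)).const_mul _)).add
    ((DerivAlong.inner_apply (hx w c M2 y k) x (𝐞 a)).mul (DerivAlong.const _ _))).congr
    fun φ => by rw [inner_hx_left, inner_hx_left]; ring

omit C η in
/-- the mixed contraction `D_{y,k}D_{y,i}:∣φ(z)∣⁴: = 4u²(δ_{ki}(∣φ(z)∣² − (N+2)g) + 2φ_i(z)φ_k(z))`.
[cite: GlimmJaffeQP1987, Prop. 8.3.1] -/
theorem derivAlong_wick4_1k (y z : Site P j) (i k : Fin N) :
    DerivAlong (hx w c M2 y k)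
      (fun φ : Cfg P j N => 4 * G w c M2 z y * (⟪φ z, 𝐞 i⟫_ℝ * (‖φ z‖ ^ 2 - (N + 2) * G w c M2 z z)))
      (fun φ => 4 * G w c M2 z y ^ 2 *
        (⟪𝐞 k, 𝐞 i⟫_ℝ * (‖φ z‖ ^ 2 - (N + 2) * G w c M2 z z) + 2 * (⟪φ z, 𝐞 i⟫_ℝ * ⟪φ z, 𝐞 k⟫_ℝ))) := by
  have nsq := DerivAlong.norm_sq_apply (hx w c M2 y k) z
  have hin := DerivAlong.inner_apply (hx w c M2 y k) z (𝐞 i)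
  exact ((hin.mul (nsq.sub (DerivAlong.const _ _))).const_mul _).congr fun φ => by
    rw [inner_hx_right, inner_hx_left]; ring

omit C η in
/-- and once more: `D_{y,k}[4u²(δ_{ki}(∣φ(z)∣² − (N+2)g) + 2φ_iφ_k)] = 8u³(2δ_{ki}φ_k(z) + φ_i(z))`.
[cite: GlimmJaffeQP1987, Prop. 8.3.1] -/
theorem derivAlong_wick4_1kk (y z : Site P j) (i k : Fin N) :
    DerivAlong (hx w c M2 y k)
      (fun φ : Cfg P j N => 4 * G w c M2 z y ^ 2 *
        (⟪𝐞 k, 𝐞 i⟫_ℝ * (‖φ z‖ ^ 2 - (N + 2) * G w c M2 z z) + 2 * (⟪φ z, 𝐞 i⟫_ℝ * ⟪φ z, 𝐞 k⟫_ℝ)))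
      (fun φ => 8 * G w c M2 z y ^ 3 * (2 * ⟪𝐞 k, 𝐞 i⟫_ℝ * ⟪φ z, 𝐞 k⟫_ℝ + ⟪φ z, 𝐞 i⟫_ℝ)) := by
  have nsq := DerivAlong.norm_sq_apply (hx w c M2 y k) z
  have hi := DerivAlong.inner_apply (hx w c M2 y k) z (𝐞 i)
  have hk := DerivAlong.inner_apply (hx w c M2 y k) z (𝐞 k)
  exact ((((nsq.sub (DerivAlong.const _ _)).const_mul _).add ((hi.mul hk).const_mul 2)).const_mul _).congr fun φ => by
    rw [inner_hx_right, inner_hx_left, inner_hx_left, inner_basis k k, if_pos rfl]; ring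

/-- the elementary Gaussian integrals at the vertex `z` that the second vertex leaves behind: the Wick-ordered remainders of
degree two integrate to ZERO (`∫W[∣φ(z)∣² − (N+2)g + 2φ_i(z)²] = 0`, `∫W[δ_{ki}(∣φ(z)∣² − (N+2)g) + 2φ_i(z)φ_k(z)] = 0`) — two legs of
`:∣φ(z)∣⁴:` left uncontracted give no self-line. [cite: GlimmJaffeQP1987, Cor. 8.3.2] -/
theorem integral_wick4_rem2 (hw : 0 < w) (hM : 0 < M2) (z : Site P j) (i k : Fin N) :
    (∫ φ, W φ * (⟪𝐞 k, 𝐞 i⟫_ℝ * (‖φ z‖ ^ 2 - (N + 2) * G w c M2 z z) + 2 * (⟪φ z, 𝐞 i⟫_ℝ * ⟪φ z, 𝐞 k⟫_ℝ))) = 0 := by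
  have hnsq : ∫ φ, W φ * ‖φ z‖ ^ 2 = N * G w c M2 z z * ∫ φ, W φ := by
    have h := integral_norm_sq_mul C η w c M2 hw hM z (R := fun _ => (1 : ℝ)) (R₁ := fun _ _ => 0) (R₂ := fun _ _ => 0)
      (ExpGrowth.const 1) (fun _ => ExpGrowth.const 0) (fun _ => ExpGrowth.const 0) (fun a => DerivAlong.const _ 1)
      (fun a => DerivAlong.const _ 0)
    simpa using h
  have hii : ∫ φ, W φ * (⟪φ z, 𝐞 i⟫_ℝ * ⟪φ z, 𝐞 k⟫_ℝ) = (∫ φ, W φ) * (G w c M2 z z * ⟪𝐞 i, 𝐞 k⟫_ℝ) :=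
    moment2 C η w c M2 hw hM z z _ _
  have i1 := (ExpGrowth.norm_sq_apply (P := P) (j := j) (N := N) z).integrable C η w c M2 hw hM
  have i2 := (ExpGrowth.const (P := P) (j := j) (N := N) ((N + 2) * G w c M2 z z)).integrable C η w c M2 hw hM
  have e : (fun φ : Cfg P j N => W φ * (⟪𝐞 k, 𝐞 i⟫_ℝ * (‖φ z‖ ^ 2 - (N + 2) * G w c M2 z z)
      + 2 * (⟪φ z, 𝐞 i⟫_ℝ * ⟪φ z, 𝐞 k⟫_ℝ))) = fun φ =>
      ⟪𝐞 k, 𝐞 i⟫_ℝ * (W φ * ‖φ z‖ ^ 2) - ⟪𝐞 k, 𝐞 i⟫_ℝ * (W φ * ((N + 2) * G w c M2 z z))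
        + 2 * (W φ * (⟪φ z, 𝐞 i⟫_ℝ * ⟪φ z, 𝐞 k⟫_ℝ)) := by
    funext φ; ring
  have i3' : Integrable (fun φ : Cfg P j N => 2 * (W φ * (⟪φ z, 𝐞 i⟫_ℝ * ⟪φ z, 𝐞 k⟫_ℝ))) :=
    (((ExpGrowth.inner_apply z (𝐞 i)).mul (ExpGrowth.inner_apply z (𝐞 k))).integrable C η w c M2 hw hM).const_mul 2
  have i12 : Integrable (fun φ : Cfg P j N => ⟪𝐞 k, 𝐞 i⟫_ℝ * (W φ * ‖φ z‖ ^ 2)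
      - ⟪𝐞 k, 𝐞 i⟫_ℝ * (W φ * ((N + 2) * G w c M2 z z))) := (i1.const_mul _).sub (i2.const_mul _)
  rw [e, integral_add i12 i3', integral_sub (i1.const_mul _) (i2.const_mul _),
    integral_const_mul, integral_const_mul, integral_const_mul, hnsq, integral_mul_const, hii, real_inner_comm (𝐞 i) (𝐞 k)]
  ring

/-- the diagonal case of `integral_wick4_rem2`: `∫W[(∣φ(z)∣² − (N+2)g) + 2φ_i(z)²] = 0`. [cite: GlimmJaffeQP1987, Cor. 8.3.2] -/
theorem integral_wick4_rem2' (hw : 0 < w) (hM : 0 < M2) (z : Site P j) (i : Fin N) :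
    (∫ φ, W φ * ((‖φ z‖ ^ 2 - (N + 2) * G w c M2 z z) + 2 * (⟪φ z, 𝐞 i⟫_ℝ * ⟪φ z, 𝐞 i⟫_ℝ))) = 0 := by
  have h := integral_wick4_rem2 C η w c M2 hw hM z i i
  rw [inner_basis, if_pos rfl] at h
  simpa only [one_mul] using h

/-- a leg of the vertex at `z` against an external leg: `∫W φ_m(z)φ_n(x″) = Z·C(z,x″)δ_{mn}` and `∫W φ_n(x″)φ_m(z) = Z·C(x″,z)δ_{nm}`
(`B3WTCovariance.moment2`). [cite: Balaban1983Higgs3, (1.19) p.416] -/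
theorem integral_leg_leg (hw : 0 < w) (hM : 0 < M2) (z x'' : Site P j) (m n : Fin N) :
    (∫ φ, W φ * (⟪φ z, 𝐞 m⟫_ℝ * ⟪φ x'', 𝐞 n⟫_ℝ)) = (∫ φ, W φ) * (G w c M2 z x'' * ⟪𝐞 m, 𝐞 n⟫_ℝ) :=
  moment2 C η w c M2 hw hM z x'' _ _

/-- a linear form in the legs of the vertex at `z` against the once-contracted external legs: four propagators
(`B3WTCovariance.moment2` termwise). [cite: Balaban1983Higgs3, (1.22) p.416] -/
theorem integral_zlin_mul_f1 (hw : 0 < w) (hM : 0 < M2) (a b : Fin N) (x x' z : Site P j) (i k : Fin N) (p q r t : ℝ) :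
    ∫ φ, W φ * ((p * ⟪φ z, 𝐞 k⟫_ℝ + q * ⟪φ z, 𝐞 i⟫_ℝ) * (r * ⟪φ x', 𝐞 b⟫_ℝ + ⟪φ x, 𝐞 a⟫_ℝ * t)) =
      (∫ φ, W φ) * (p * r * (G w c M2 z x' * ⟪𝐞 k, 𝐞 b⟫_ℝ) + q * r * (G w c M2 z x' * ⟪𝐞 i, 𝐞 b⟫_ℝ)
        + p * t * (G w c M2 x z * ⟪𝐞 a, 𝐞 k⟫_ℝ) + q * t * (G w c M2 x z * ⟪𝐞 a, 𝐞 i⟫_ℝ)) := by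
  have m1 := moment2 C η w c M2 hw hM z x' (𝐞 k) (𝐞 b)
  have m2 := moment2 C η w c M2 hw hM z x' (𝐞 i) (𝐞 b)
  have m3 := moment2 C η w c M2 hw hM x z (𝐞 a) (𝐞 k)
  have m4 := moment2 C η w c M2 hw hM x z (𝐞 a) (𝐞 i)
  have i1 := ((ExpGrowth.inner_apply z (𝐞 k)).mul (ExpGrowth.inner_apply x' (𝐞 b))).integrable C η w c M2 hw hM
  have i2 := ((ExpGrowth.inner_apply z (𝐞 i)).mul (ExpGrowth.inner_apply x' (𝐞 b))).integrable C η w c M2 hw hM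
  have i3 := ((ExpGrowth.inner_apply x (𝐞 a)).mul (ExpGrowth.inner_apply z (𝐞 k))).integrable C η w c M2 hw hM
  have i4 := ((ExpGrowth.inner_apply x (𝐞 a)).mul (ExpGrowth.inner_apply z (𝐞 i))).integrable C η w c M2 hw hM
  have e : (fun φ : Cfg P j N => W φ * ((p * ⟪φ z, 𝐞 k⟫_ℝ + q * ⟪φ z, 𝐞 i⟫_ℝ) * (r * ⟪φ x', 𝐞 b⟫_ℝ + ⟪φ x, 𝐞 a⟫_ℝ * t)))
      = fun φ => p * r * (W φ * (⟪φ z, 𝐞 k⟫_ℝ * ⟪φ x', 𝐞 b⟫_ℝ)) + (q * r * (W φ * (⟪φ z, 𝐞 i⟫_ℝ * ⟪φ x', 𝐞 b⟫_ℝ))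
        + (p * t * (W φ * (⟪φ x, 𝐞 a⟫_ℝ * ⟪φ z, 𝐞 k⟫_ℝ)) + q * t * (W φ * (⟪φ x, 𝐞 a⟫_ℝ * ⟪φ z, 𝐞 i⟫_ℝ)))) := by
    funext φ; ring
  have j4 : Integrable (fun φ : Cfg P j N => q * t * (W φ * (⟪φ x, 𝐞 a⟫_ℝ * ⟪φ z, 𝐞 i⟫_ℝ))) := i4.const_mul _
  have j34 : Integrable (fun φ : Cfg P j N => p * t * (W φ * (⟪φ x, 𝐞 a⟫_ℝ * ⟪φ z, 𝐞 k⟫_ℝ))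
      + q * t * (W φ * (⟪φ x, 𝐞 a⟫_ℝ * ⟪φ z, 𝐞 i⟫_ℝ))) := (i3.const_mul _).add j4
  have j234 : Integrable (fun φ : Cfg P j N => q * r * (W φ * (⟪φ z, 𝐞 i⟫_ℝ * ⟪φ x', 𝐞 b⟫_ℝ))
      + (p * t * (W φ * (⟪φ x, 𝐞 a⟫_ℝ * ⟪φ z, 𝐞 k⟫_ℝ)) + q * t * (W φ * (⟪φ x, 𝐞 a⟫_ℝ * ⟪φ z, 𝐞 i⟫_ℝ)))) :=
    (i2.const_mul _).add j34
  rw [e, integral_add (i1.const_mul _) j234, integral_add (i2.const_mul _) j34, integral_add (i3.const_mul _) j4,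
    integral_const_mul, integral_const_mul, integral_const_mul, integral_const_mul, m1, m2, m3, m4]
  ring

/-- **WICK'S THEOREM FOR TWO QUARTIC VERTICES AGAINST THE TWO LEGS — THE SUNSET ⑥ OF (1.22)**:
`∫W·:∣φ(y)∣⁴:·:∣φ(z)∣⁴:·φ_a(x)φ_b(x′) = Z·δ_{ab}·[8N(N+2)C(z,y)⁴·C(x,x′) + 4²(2N+4)·C(z,y)³·(C(x,y)C(z,x′) + C(x′,y)C(z,x))]` —
the basketball times the free line (vacuum part), plus the SUNSET: one external leg into each vertex and the three remaining legs of
each vertex contracted with each other, in the two assignments of the external legs; print's combinatoric factor `4²(2N+4)` of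
*"4²(2N+4)λ²(C^ε_0(x−x′))³"* DERIVED from the pairing count (`4·4` choices of the absorbing legs × the `O(N)` index weight `2N+4` of the
`3!` internal pairings); with two legs of `:∣φ(z)∣⁴:` left over the Gaussian integral vanishes (`integral_wick4_rem2`), so no other
pattern survives. [cite: Balaban1983Higgs3, (1.22) p.416] [cite: GlimmJaffeQP1987, Prop. 8.3.1, Cor. 8.3.2] -/
theorem integral_wick4_wick4_legs (hw : 0 < w) (hM : 0 < M2) (a b : Fin N) (x x' y z : Site P j) :
    ∫ φ, W φ * (wick4 w c M2 y φ * (wick4 w c M2 z φ * (⟪φ x, 𝐞 a⟫_ℝ * ⟪φ x', 𝐞 b⟫_ℝ))) =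
      (∫ φ, W φ) * ⟪𝐞 a, 𝐞 b⟫_ℝ *
        (8 * (N * (N + 2)) * G w c M2 z y ^ 4 * G w c M2 x x'
          + 4 ^ 2 * (2 * N + 4) * G w c M2 z y ^ 3 * (G w c M2 x y * G w c M2 z x' + G w c M2 x' y * G w c M2 z x)) := by
  -- the pieces: the vertex at `z` (`A`'s), the legs (`F`'s)
  -- F  := ⟪φ x, e_a⟫⟪φ x', e_b⟫,  f1 i := D_{y,i}F,  f2 i := D_{y,i}f1 i (const),  f11 i k := D_{y,k} f1 i (const)
  have hF := expGrowth_legs (P := P) (j := j) a b x x'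
  have hDF : ∀ i, DerivAlong (hx w c M2 y i) (fun φ : Cfg P j N => ⟪φ x, 𝐞 a⟫_ℝ * ⟪φ x', 𝐞 b⟫_ℝ)
      (fun φ => G w c M2 x y * ⟪𝐞 i, 𝐞 a⟫_ℝ * ⟪φ x', 𝐞 b⟫_ℝ + ⟪φ x, 𝐞 a⟫_ℝ * (G w c M2 x' y * ⟪𝐞 i, 𝐞 b⟫_ℝ)) :=
    fun i => derivAlong_legs w c M2 a b x x' y i
  have hDf1 : ∀ i, DerivAlong (hx w c M2 y i)
      (fun φ : Cfg P j N => G w c M2 x y * ⟪𝐞 i, 𝐞 a⟫_ℝ * ⟪φ x', 𝐞 b⟫_ℝ + ⟪φ x, 𝐞 a⟫_ℝ * (G w c M2 x' y * ⟪𝐞 i, 𝐞 b⟫_ℝ))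
      (fun _ => 2 * (G w c M2 x y * ⟪𝐞 i, 𝐞 a⟫_ℝ) * (G w c M2 x' y * ⟪𝐞 i, 𝐞 b⟫_ℝ)) :=
    fun i => derivAlong_legs' w c M2 a b x x' y i
  have hDf1k : ∀ i k, DerivAlong (hx w c M2 y k)
      (fun φ : Cfg P j N => G w c M2 x y * ⟪𝐞 i, 𝐞 a⟫_ℝ * ⟪φ x', 𝐞 b⟫_ℝ + ⟪φ x, 𝐞 a⟫_ℝ * (G w c M2 x' y * ⟪𝐞 i, 𝐞 b⟫_ℝ))
      (fun _ => G w c M2 x y * G w c M2 x' y * (⟪𝐞 i, 𝐞 a⟫_ℝ * ⟪𝐞 k, 𝐞 b⟫_ℝ + ⟪𝐞 k, 𝐞 a⟫_ℝ * ⟪𝐞 i, 𝐞 b⟫_ℝ)) :=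
    fun i k => derivAlong_legs_cross w c M2 a b x x' y i k
  have hf1g : ∀ i, ExpGrowth (fun φ : Cfg P j N =>
      G w c M2 x y * ⟪𝐞 i, 𝐞 a⟫_ℝ * ⟪φ x', 𝐞 b⟫_ℝ + ⟪φ x, 𝐞 a⟫_ℝ * (G w c M2 x' y * ⟪𝐞 i, 𝐞 b⟫_ℝ)) :=
    fun i => (((ExpGrowth.inner_apply x' _).const_mul _)).add ((ExpGrowth.inner_apply x _).mul (ExpGrowth.const _))
  -- the vertex at `z` and its contractions (§8)
  have hA := expGrowth_wick4 (P := P) (j := j) (N := N) w c M2 z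
  have hA1g : ∀ i, ExpGrowth (fun φ : Cfg P j N => 4 * G w c M2 z y * (⟪φ z, 𝐞 i⟫_ℝ * (‖φ z‖ ^ 2 - (N + 2) * G w c M2 z z))) :=
    fun i => ((ExpGrowth.inner_apply z _).mul ((ExpGrowth.norm_sq_apply z).sub (ExpGrowth.const _))).const_mul _
  have hA2g : ∀ i k, ExpGrowth (fun φ : Cfg P j N => 4 * G w c M2 z y ^ 2 *
      (⟪𝐞 k, 𝐞 i⟫_ℝ * (‖φ z‖ ^ 2 - (N + 2) * G w c M2 z z) + 2 * (⟪φ z, 𝐞 i⟫_ℝ * ⟪φ z, 𝐞 k⟫_ℝ))) :=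
    fun i k => ((((ExpGrowth.norm_sq_apply z).sub (ExpGrowth.const _)).const_mul _).add
      (((ExpGrowth.inner_apply z _).mul (ExpGrowth.inner_apply z _)).const_mul 2)).const_mul _
  have hBpg : ∀ i k, ExpGrowth (fun φ : Cfg P j N => 8 * G w c M2 z y ^ 3 *
      (2 * ⟪𝐞 k, 𝐞 i⟫_ℝ * ⟪φ z, 𝐞 k⟫_ℝ + ⟪φ z, 𝐞 i⟫_ℝ)) :=
    fun i k => (((ExpGrowth.inner_apply z _).const_mul _).add (ExpGrowth.inner_apply z _)).const_mul _
  have hA2g' : ∀ i, ExpGrowth (fun φ : Cfg P j N => 4 * G w c M2 z y ^ 2 *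
      ((‖φ z‖ ^ 2 - (N + 2) * G w c M2 z z) + 2 * (⟪φ z, 𝐞 i⟫_ℝ * ⟪φ z, 𝐞 i⟫_ℝ))) :=
    fun i => (((ExpGrowth.norm_sq_apply z).sub (ExpGrowth.const _)).add
      (((ExpGrowth.inner_apply z _).mul (ExpGrowth.inner_apply z _)).const_mul 2)).const_mul _
  have hA3g : ∀ i k, ExpGrowth (fun φ : Cfg P j N => 8 * G w c M2 z y ^ 3 *
      (⟪φ z, 𝐞 k⟫_ℝ + 2 * ⟪𝐞 k, 𝐞 i⟫_ℝ * ⟪φ z, 𝐞 i⟫_ℝ)) :=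
    fun i k => ((ExpGrowth.inner_apply z _).add ((ExpGrowth.inner_apply z _).const_mul _)).const_mul _
  -- names for the pieces (as functions)
  set F : Cfg P j N → ℝ := fun φ => ⟪φ x, 𝐞 a⟫_ℝ * ⟪φ x', 𝐞 b⟫_ℝ with hFdef
  set f1 : Fin N → Cfg P j N → ℝ := fun i φ =>
    G w c M2 x y * ⟪𝐞 i, 𝐞 a⟫_ℝ * ⟪φ x', 𝐞 b⟫_ℝ + ⟪φ x, 𝐞 a⟫_ℝ * (G w c M2 x' y * ⟪𝐞 i, 𝐞 b⟫_ℝ) with hf1def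
  set f2 : Fin N → ℝ := fun i => 2 * (G w c M2 x y * ⟪𝐞 i, 𝐞 a⟫_ℝ) * (G w c M2 x' y * ⟪𝐞 i, 𝐞 b⟫_ℝ) with hf2def
  set f11 : Fin N → Fin N → ℝ := fun i k =>
    G w c M2 x y * G w c M2 x' y * (⟪𝐞 i, 𝐞 a⟫_ℝ * ⟪𝐞 k, 𝐞 b⟫_ℝ + ⟪𝐞 k, 𝐞 a⟫_ℝ * ⟪𝐞 i, 𝐞 b⟫_ℝ) with hf11def
  set A : Cfg P j N → ℝ := fun φ => wick4 w c M2 z φ with hAdef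
  set A1 : Fin N → Cfg P j N → ℝ := fun i φ =>
    4 * G w c M2 z y * (⟪φ z, 𝐞 i⟫_ℝ * (‖φ z‖ ^ 2 - (N + 2) * G w c M2 z z)) with hA1def
  set A2 : Fin N → Cfg P j N → ℝ := fun i φ =>
    4 * G w c M2 z y ^ 2 * ((‖φ z‖ ^ 2 - (N + 2) * G w c M2 z z) + 2 * (⟪φ z, 𝐞 i⟫_ℝ * ⟪φ z, 𝐞 i⟫_ℝ)) with hA2def
  set B : Fin N → Fin N → Cfg P j N → ℝ := fun i k φ =>
    4 * G w c M2 z y ^ 2 * (⟪𝐞 k, 𝐞 i⟫_ℝ * (‖φ z‖ ^ 2 - (N + 2) * G w c M2 z z) + 2 * (⟪φ z, 𝐞 i⟫_ℝ * ⟪φ z, 𝐞 k⟫_ℝ))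
    with hBdef
  set Bp : Fin N → Fin N → Cfg P j N → ℝ := fun i k φ =>
    8 * G w c M2 z y ^ 3 * (2 * ⟪𝐞 k, 𝐞 i⟫_ℝ * ⟪φ z, 𝐞 k⟫_ℝ + ⟪φ z, 𝐞 i⟫_ℝ) with hBpdef
  set A3 : Fin N → Fin N → Cfg P j N → ℝ := fun i k φ =>
    8 * G w c M2 z y ^ 3 * (⟪φ z, 𝐞 k⟫_ℝ + 2 * ⟪𝐞 k, 𝐞 i⟫_ℝ * ⟪φ z, 𝐞 i⟫_ℝ) with hA3def
  set A4 : Fin N → Fin N → ℝ := fun i k => 8 * G w c M2 z y ^ 4 * (1 + 2 * ⟪𝐞 k, 𝐞 i⟫_ℝ ^ 2) with hA4def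
  -- the derivative facts in these names
  have dA : ∀ i, DerivAlong (hx w c M2 y i) A (A1 i) := fun i => derivAlong_wick4_1 w c M2 y z i
  have dA1 : ∀ i, DerivAlong (hx w c M2 y i) (A1 i) (A2 i) := fun i => derivAlong_wick4_2 w c M2 y z i
  have dA1k : ∀ i k, DerivAlong (hx w c M2 y k) (A1 i) (B i k) := fun i k => derivAlong_wick4_1k w c M2 y z i k
  have dB : ∀ i k, DerivAlong (hx w c M2 y k) (B i k) (Bp i k) := fun i k => derivAlong_wick4_1kk w c M2 y z i k
  have dA2 : ∀ i k, DerivAlong (hx w c M2 y k) (A2 i) (A3 i k) := fun i k => derivAlong_wick4_3 w c M2 y z i k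
  have dA3 : ∀ i k, DerivAlong (hx w c M2 y k) (A3 i k) (fun _ => A4 i k) := fun i k => derivAlong_wick4_4 w c M2 y z i k
  have dF : ∀ i, DerivAlong (hx w c M2 y i) F (f1 i) := hDF
  have df1 : ∀ i, DerivAlong (hx w c M2 y i) (f1 i) (fun _ => f2 i) := hDf1
  have df1k : ∀ i k, DerivAlong (hx w c M2 y k) (f1 i) (fun _ => f11 i k) := hDf1k
  -- the raw Leibniz chain
  have key := integral_wick4_mul C η w c M2 hw hM y (R := fun φ : Cfg P j N => A φ * F φ)
    (R₁ := fun i φ => A1 i φ * F φ + A φ * f1 i φ)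
    (R₂ := fun i φ => (A2 i φ * F φ + A1 i φ * f1 i φ) + (A1 i φ * f1 i φ + A φ * f2 i))
    (R₃ := fun i k φ => ((A3 i k φ * F φ + A2 i φ * f1 k φ) + (B i k φ * f1 i φ + A1 i φ * f11 i k))
      + ((B i k φ * f1 i φ + A1 i φ * f11 i k) + (A1 k φ * f2 i + A φ * 0)))
    (R₄ := fun i k φ => (((A4 i k * F φ + A3 i k φ * f1 k φ) + (A3 i k φ * f1 k φ + A2 i φ * f2 k))
        + ((Bp i k φ * f1 i φ + B i k φ * f11 i k) + (B i k φ * f11 i k + A1 i φ * 0)))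
      + (((Bp i k φ * f1 i φ + B i k φ * f11 i k) + (B i k φ * f11 i k + A1 i φ * 0))
        + ((A2 k φ * f2 i + A1 k φ * 0) + (A1 k φ * 0 + A φ * 0))))
    (hA.mul hF)
    (fun i => ((hA1g i).mul hF).add (hA.mul (hf1g i)))
    (fun i => (((hA2g' i).mul hF).add ((hA1g i).mul (hf1g i))).add (((hA1g i).mul (hf1g i)).add
      (hA.mul (ExpGrowth.const _))))
    (fun i k => ((((hA3g i k).mul hF).add ((hA2g' i).mul (hf1g k))).add (((hA2g i k).mul (hf1g i)).add
      ((hA1g i).mul (ExpGrowth.const _)))).add ((((hA2g i k).mul (hf1g i)).add ((hA1g i).mul (ExpGrowth.const _))).add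
      (((hA1g k).mul (ExpGrowth.const _)).add (hA.mul (ExpGrowth.const _)))))
    (fun i k => (((((ExpGrowth.const _).mul hF).add ((hA3g i k).mul (hf1g k))).add (((hA3g i k).mul (hf1g k)).add
      ((hA2g' i).mul (ExpGrowth.const _)))).add ((((hBpg i k).mul (hf1g i)).add ((hA2g i k).mul (ExpGrowth.const _))).add
      (((hA2g i k).mul (ExpGrowth.const _)).add ((hA1g i).mul (ExpGrowth.const _))))).add
      (((((hBpg i k).mul (hf1g i)).add ((hA2g i k).mul (ExpGrowth.const _))).add
      (((hA2g i k).mul (ExpGrowth.const _)).add ((hA1g i).mul (ExpGrowth.const _)))).add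
      ((((hA2g' k).mul (ExpGrowth.const _)).add ((hA1g k).mul (ExpGrowth.const _))).add
      (((hA1g k).mul (ExpGrowth.const _)).add (hA.mul (ExpGrowth.const _))))))
    (fun i => (dA i).mul (dF i))
    (fun i => ((dA1 i).mul (dF i)).add ((dA i).mul (df1 i)))
    (fun i k => (((dA2 i k).mul (dF k)).add ((dA1k i k).mul (df1k i k))).add
      (((dA1k i k).mul (df1k i k)).add (((dA k).mul (DerivAlong.const _ _)))))
    (fun i k => ((((dA3 i k).mul (dF k)).add ((dA2 i k).mul (df1 k))).add
      (((dB i k).mul (df1k i k)).add ((dA1k i k).mul (DerivAlong.const _ _)))).add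
      ((((dB i k).mul (df1k i k)).add ((dA1k i k).mul (DerivAlong.const _ _))).add
      (((dA1 k).mul (DerivAlong.const _ _)).add ((dA k).mul (DerivAlong.const _ _)))))
  -- per-(i,k) evaluation of the fourth contraction
  have hZ := (∫ φ, W φ)
  have vP1 : ∀ i k, ∫ φ, W φ * (A4 i k * F φ) = A4 i k * ((∫ φ, W φ) * (G w c M2 x x' * ⟪𝐞 a, 𝐞 b⟫_ℝ)) := by
    intro i k
    have e : (fun φ : Cfg P j N => W φ * (A4 i k * F φ)) = fun φ => A4 i k * (W φ * F φ) := by funext φ; ring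
    rw [e, integral_const_mul, hFdef, integral_legs C η w c M2 hw hM]
  have vP2 : ∀ i k, ∫ φ, W φ * (2 * (A3 i k φ * f1 k φ)) = 2 * ((∫ φ, W φ) *
      ((8 * G w c M2 z y ^ 3) * (G w c M2 x y * ⟪𝐞 k, 𝐞 a⟫_ℝ) * (G w c M2 z x' * ⟪𝐞 k, 𝐞 b⟫_ℝ)
        + (8 * G w c M2 z y ^ 3 * (2 * ⟪𝐞 k, 𝐞 i⟫_ℝ)) * (G w c M2 x y * ⟪𝐞 k, 𝐞 a⟫_ℝ) * (G w c M2 z x' * ⟪𝐞 i, 𝐞 b⟫_ℝ)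
        + (8 * G w c M2 z y ^ 3) * (G w c M2 x' y * ⟪𝐞 k, 𝐞 b⟫_ℝ) * (G w c M2 x z * ⟪𝐞 a, 𝐞 k⟫_ℝ)
        + (8 * G w c M2 z y ^ 3 * (2 * ⟪𝐞 k, 𝐞 i⟫_ℝ)) * (G w c M2 x' y * ⟪𝐞 k, 𝐞 b⟫_ℝ) * (G w c M2 x z * ⟪𝐞 a, 𝐞 i⟫_ℝ))) := by
    intro i k
    have e : (fun φ : Cfg P j N => W φ * (2 * (A3 i k φ * f1 k φ))) = fun φ => 2 * (W φ *
        (((8 * G w c M2 z y ^ 3) * ⟪φ z, 𝐞 k⟫_ℝ + (8 * G w c M2 z y ^ 3 * (2 * ⟪𝐞 k, 𝐞 i⟫_ℝ)) * ⟪φ z, 𝐞 i⟫_ℝ)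
          * ((G w c M2 x y * ⟪𝐞 k, 𝐞 a⟫_ℝ) * ⟪φ x', 𝐞 b⟫_ℝ + ⟪φ x, 𝐞 a⟫_ℝ * (G w c M2 x' y * ⟪𝐞 k, 𝐞 b⟫_ℝ)))) := by
      funext φ; simp only [hA3def, hf1def]; ring
    rw [e, integral_const_mul, integral_zlin_mul_f1 C η w c M2 hw hM]
  have vP3 : ∀ i k, ∫ φ, W φ * (2 * (Bp i k φ * f1 i φ)) = 2 * ((∫ φ, W φ) *
      ((8 * G w c M2 z y ^ 3 * (2 * ⟪𝐞 k, 𝐞 i⟫_ℝ)) * (G w c M2 x y * ⟪𝐞 i, 𝐞 a⟫_ℝ) * (G w c M2 z x' * ⟪𝐞 k, 𝐞 b⟫_ℝ)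
        + (8 * G w c M2 z y ^ 3) * (G w c M2 x y * ⟪𝐞 i, 𝐞 a⟫_ℝ) * (G w c M2 z x' * ⟪𝐞 i, 𝐞 b⟫_ℝ)
        + (8 * G w c M2 z y ^ 3 * (2 * ⟪𝐞 k, 𝐞 i⟫_ℝ)) * (G w c M2 x' y * ⟪𝐞 i, 𝐞 b⟫_ℝ) * (G w c M2 x z * ⟪𝐞 a, 𝐞 k⟫_ℝ)
        + (8 * G w c M2 z y ^ 3) * (G w c M2 x' y * ⟪𝐞 i, 𝐞 b⟫_ℝ) * (G w c M2 x z * ⟪𝐞 a, 𝐞 i⟫_ℝ))) := by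
    intro i k
    have e : (fun φ : Cfg P j N => W φ * (2 * (Bp i k φ * f1 i φ))) = fun φ => 2 * (W φ *
        (((8 * G w c M2 z y ^ 3 * (2 * ⟪𝐞 k, 𝐞 i⟫_ℝ)) * ⟪φ z, 𝐞 k⟫_ℝ + (8 * G w c M2 z y ^ 3) * ⟪φ z, 𝐞 i⟫_ℝ)
          * ((G w c M2 x y * ⟪𝐞 i, 𝐞 a⟫_ℝ) * ⟪φ x', 𝐞 b⟫_ℝ + ⟪φ x, 𝐞 a⟫_ℝ * (G w c M2 x' y * ⟪𝐞 i, 𝐞 b⟫_ℝ)))) := by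
      funext φ; simp only [hBpdef, hf1def]; ring
    rw [e, integral_const_mul, integral_zlin_mul_f1 C η w c M2 hw hM]
  have vA2 : ∀ i, ∫ φ, W φ * A2 i φ = 0 := by
    intro i
    have e : (fun φ : Cfg P j N => W φ * A2 i φ) = fun φ => 4 * G w c M2 z y ^ 2 *
        (W φ * ((‖φ z‖ ^ 2 - (N + 2) * G w c M2 z z) + 2 * (⟪φ z, 𝐞 i⟫_ℝ * ⟪φ z, 𝐞 i⟫_ℝ))) := by
      funext φ; simp only [hA2def]; ring
    rw [e, integral_const_mul, integral_wick4_rem2' C η w c M2 hw hM, mul_zero]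
  have vB : ∀ i k, ∫ φ, W φ * B i k φ = 0 := by
    intro i k
    have e : (fun φ : Cfg P j N => W φ * B i k φ) = fun φ => 4 * G w c M2 z y ^ 2 *
        (W φ * (⟪𝐞 k, 𝐞 i⟫_ℝ * (‖φ z‖ ^ 2 - (N + 2) * G w c M2 z z) + 2 * (⟪φ z, 𝐞 i⟫_ℝ * ⟪φ z, 𝐞 k⟫_ℝ))) := by
      funext φ; simp only [hBdef]; ring
    rw [e, integral_const_mul, integral_wick4_rem2 C η w c M2 hw hM, mul_zero]
  have vP4 : ∀ i k, ∫ φ, W φ * (A2 i φ * f2 k) = 0 := by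
    intro i k
    have e : (fun φ : Cfg P j N => W φ * (A2 i φ * f2 k)) = fun φ => (W φ * A2 i φ) * f2 k := by funext φ; ring
    rw [e, integral_mul_const, vA2, zero_mul]
  have vP5 : ∀ i k, ∫ φ, W φ * (4 * (B i k φ * f11 i k)) = 0 := by
    intro i k
    have e : (fun φ : Cfg P j N => W φ * (4 * (B i k φ * f11 i k))) = fun φ => (W φ * B i k φ) * (4 * f11 i k) := by
      funext φ; ring
    rw [e, integral_mul_const, vB, zero_mul]
  have vP6 : ∀ i k, ∫ φ, W φ * (A2 k φ * f2 i) = 0 := by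
    intro i k
    have e : (fun φ : Cfg P j N => W φ * (A2 k φ * f2 i)) = fun φ => (W φ * A2 k φ) * f2 i := by funext φ; ring
    rw [e, integral_mul_const, vA2, zero_mul]
  -- integrate the fourth contraction termwise
  have hterm : ∀ i k, ∫ φ, W φ * ((((A4 i k * F φ + A3 i k φ * f1 k φ) + (A3 i k φ * f1 k φ + A2 i φ * f2 k))
        + ((Bp i k φ * f1 i φ + B i k φ * f11 i k) + (B i k φ * f11 i k + A1 i φ * 0)))
      + (((Bp i k φ * f1 i φ + B i k φ * f11 i k) + (B i k φ * f11 i k + A1 i φ * 0))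
        + ((A2 k φ * f2 i + A1 k φ * 0) + (A1 k φ * 0 + A φ * 0))))
      = A4 i k * ((∫ φ, W φ) * (G w c M2 x x' * ⟪𝐞 a, 𝐞 b⟫_ℝ))
        + (2 * ((∫ φ, W φ) *
          ((8 * G w c M2 z y ^ 3) * (G w c M2 x y * ⟪𝐞 k, 𝐞 a⟫_ℝ) * (G w c M2 z x' * ⟪𝐞 k, 𝐞 b⟫_ℝ)
          + (8 * G w c M2 z y ^ 3 * (2 * ⟪𝐞 k, 𝐞 i⟫_ℝ)) * (G w c M2 x y * ⟪𝐞 k, 𝐞 a⟫_ℝ) * (G w c M2 z x' * ⟪𝐞 i, 𝐞 b⟫_ℝ)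
          + (8 * G w c M2 z y ^ 3) * (G w c M2 x' y * ⟪𝐞 k, 𝐞 b⟫_ℝ) * (G w c M2 x z * ⟪𝐞 a, 𝐞 k⟫_ℝ)
          + (8 * G w c M2 z y ^ 3 * (2 * ⟪𝐞 k, 𝐞 i⟫_ℝ)) * (G w c M2 x' y * ⟪𝐞 k, 𝐞 b⟫_ℝ) * (G w c M2 x z * ⟪𝐞 a, 𝐞 i⟫_ℝ)))
        + 2 * ((∫ φ, W φ) *
          ((8 * G w c M2 z y ^ 3 * (2 * ⟪𝐞 k, 𝐞 i⟫_ℝ)) * (G w c M2 x y * ⟪𝐞 i, 𝐞 a⟫_ℝ) * (G w c M2 z x' * ⟪𝐞 k, 𝐞 b⟫_ℝ)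
          + (8 * G w c M2 z y ^ 3) * (G w c M2 x y * ⟪𝐞 i, 𝐞 a⟫_ℝ) * (G w c M2 z x' * ⟪𝐞 i, 𝐞 b⟫_ℝ)
          + (8 * G w c M2 z y ^ 3 * (2 * ⟪𝐞 k, 𝐞 i⟫_ℝ)) * (G w c M2 x' y * ⟪𝐞 i, 𝐞 b⟫_ℝ) * (G w c M2 x z * ⟪𝐞 a, 𝐞 k⟫_ℝ)
          + (8 * G w c M2 z y ^ 3) * (G w c M2 x' y * ⟪𝐞 i, 𝐞 b⟫_ℝ) * (G w c M2 x z * ⟪𝐞 a, 𝐞 i⟫_ℝ)))) := by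
    intro i k
    have I1 : Integrable (fun φ : Cfg P j N => W φ * (A4 i k * F φ)) := (hF.const_mul _).integrable C η w c M2 hw hM
    have I2 : Integrable (fun φ : Cfg P j N => W φ * (2 * (A3 i k φ * f1 k φ))) :=
      (((hA3g i k).mul (hf1g k)).const_mul _).integrable C η w c M2 hw hM
    have I3 : Integrable (fun φ : Cfg P j N => W φ * (2 * (Bp i k φ * f1 i φ))) :=
      (((hBpg i k).mul (hf1g i)).const_mul _).integrable C η w c M2 hw hM
    have I4 : Integrable (fun φ : Cfg P j N => W φ * (A2 i φ * f2 k)) :=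
      ((hA2g' i).mul (ExpGrowth.const _)).integrable C η w c M2 hw hM
    have I5 : Integrable (fun φ : Cfg P j N => W φ * (4 * (B i k φ * f11 i k))) :=
      (((hA2g i k).mul (ExpGrowth.const _)).const_mul _).integrable C η w c M2 hw hM
    have I6 : Integrable (fun φ : Cfg P j N => W φ * (A2 k φ * f2 i)) :=
      ((hA2g' k).mul (ExpGrowth.const _)).integrable C η w c M2 hw hM
    have e : (fun φ : Cfg P j N => W φ * ((((A4 i k * F φ + A3 i k φ * f1 k φ) + (A3 i k φ * f1 k φ + A2 i φ * f2 k))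
        + ((Bp i k φ * f1 i φ + B i k φ * f11 i k) + (B i k φ * f11 i k + A1 i φ * 0)))
      + (((Bp i k φ * f1 i φ + B i k φ * f11 i k) + (B i k φ * f11 i k + A1 i φ * 0))
        + ((A2 k φ * f2 i + A1 k φ * 0) + (A1 k φ * 0 + A φ * 0)))))
        = fun φ => W φ * (A4 i k * F φ) + (W φ * (2 * (A3 i k φ * f1 k φ)) + (W φ * (2 * (Bp i k φ * f1 i φ))
          + (W φ * (A2 i φ * f2 k) + (W φ * (4 * (B i k φ * f11 i k)) + W φ * (A2 k φ * f2 i))))) := by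
      funext φ; ring
    have I56 : Integrable (fun φ : Cfg P j N => W φ * (4 * (B i k φ * f11 i k)) + W φ * (A2 k φ * f2 i)) := I5.add I6
    have I456 : Integrable (fun φ : Cfg P j N => W φ * (A2 i φ * f2 k) + (W φ * (4 * (B i k φ * f11 i k))
        + W φ * (A2 k φ * f2 i))) := I4.add I56
    have I3456 : Integrable (fun φ : Cfg P j N => W φ * (2 * (Bp i k φ * f1 i φ)) + (W φ * (A2 i φ * f2 k)
        + (W φ * (4 * (B i k φ * f11 i k)) + W φ * (A2 k φ * f2 i)))) := I3.add I456
    have I23456 : Integrable (fun φ : Cfg P j N => W φ * (2 * (A3 i k φ * f1 k φ)) + (W φ * (2 * (Bp i k φ * f1 i φ))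
        + (W φ * (A2 i φ * f2 k) + (W φ * (4 * (B i k φ * f11 i k)) + W φ * (A2 k φ * f2 i))))) := I2.add I3456
    rw [e, integral_add I1 I23456, integral_add I2 I3456, integral_add I3 I456, integral_add I4 I56, integral_add I5 I6,
      vP1, vP2, vP3, vP4, vP5, vP6]
    ring
  rw [show (∫ φ, W φ * (wick4 w c M2 y φ * (wick4 w c M2 z φ * (⟪φ x, 𝐞 a⟫_ℝ * ⟪φ x', 𝐞 b⟫_ℝ))))
      = ∫ φ, W φ * (wick4 w c M2 y φ * (A φ * F φ)) from rfl, key]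
  simp_rw [hterm]
  simp only [hA4def]
  rw [G_symm w c M2 x z]
  classical
  simp only [inner_basis, mul_ite, ite_mul, mul_one, mul_zero, zero_mul, ite_pow, one_pow, zero_pow (two_ne_zero),
    mul_add, Finset.sum_add_distrib, Finset.sum_ite_irrel, Finset.sum_const_zero, Finset.sum_ite_eq,
    Finset.sum_ite_eq', Finset.mem_univ, if_true, Finset.sum_const, Finset.card_univ, Fintype.card_fin, nsmul_eq_mul]
  by_cases hab : a = b
  · subst hab
    simp only [if_true, mul_add, add_mul, ite_mul, zero_mul, Finset.sum_add_distrib, Finset.sum_ite_eq',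
      Finset.mem_univ, Finset.sum_const, Finset.card_univ, Fintype.card_fin, nsmul_eq_mul]
    ring
  · simp only [hab, if_false, Ne.symm hab, add_zero]

/-! ## §10 (v1.1) SECOND-ORDER PERTURBATION THEORY FOR THE WICK-ORDERED VERTEX `λΣ_yη^d:∣φ(y)∣⁴:` (the form (2.28) of the
quartic interaction): the order-`λ²` Taylor coefficient of the two-point function IS THE SUNSET ⑥ —
`λ²G″_{ab}(0⁺)/2! = Σ_{y,z}η^{2d}C₀(x,y)·sig6(y,z)·C₀(z,x′)·δ_{ab}` with p26's typed `sig6 = 4²(2N+4)λ²(C^ε_0)³` -/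

/-- **interactions bounded below suffice** (the Wick-ordered vertex is not positive): for `V ≥ −K` and `F` of exponential-linear
growth, `λ ↦ ∫We^{−λV}F` has right-derivative `−∫WVF` at `λ = 0⁺` — §4 applied to `V + K ≥ 0`, `e^{−λV} = e^{λK}e^{−λ(V+K)}`.
[cite: GlimmJaffeQP1987, §8.4–8.5] -/
theorem hasDerivWithinAt_gaussInt_exp_neg_of_le (hw : 0 < w) (hM : 0 < M2) {V F : Cfg P j N → ℝ}
    (hV : ExpGrowth V) {K : ℝ} (hVK : ∀ φ, -K ≤ V φ) (hF : ExpGrowth F) :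
    HasDerivWithinAt (fun lam : ℝ => ∫ φ, W φ * (Real.exp (-(lam * V φ)) * F φ))
      (-(∫ φ, W φ * (V φ * F φ))) (Set.Ici 0) 0 := by
  have hV' : ExpGrowth (fun φ : Cfg P j N => V φ + K) := hV.add (ExpGrowth.const K)
  have hV'0 : ∀ φ : Cfg P j N, 0 ≤ V φ + K := fun φ => by linarith [hVK φ]
  have h := hasDerivWithinAt_gaussInt_exp_neg C η w c M2 hw hM hV' hV'0 hF
  have hWF : Integrable (fun φ : Cfg P j N => W φ * F φ) := hF.integrable C η w c M2 hw hM
  have hWVF : Integrable (fun φ : Cfg P j N => W φ * (V φ * F φ)) := (hV.mul hF).integrable C η w c M2 hw hM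
  have hexp : HasDerivWithinAt (fun lam : ℝ => Real.exp (lam * K)) K (Set.Ici 0) 0 := by
    have h1 : HasDerivAt (fun lam : ℝ => lam * K) K 0 := hasDerivAt_mul_const K
    have h2 := h1.exp
    simp only [zero_mul, Real.exp_zero, one_mul] at h2
    exact h2.hasDerivWithinAt
  have hfun : (fun lam : ℝ => ∫ φ, W φ * (Real.exp (-(lam * V φ)) * F φ))
      = fun lam => Real.exp (lam * K) * ∫ φ, W φ * (Real.exp (-(lam * (V φ + K))) * F φ) := by
    funext lam
    rw [← integral_const_mul]
    refine integral_congr_ae (Filter.Eventually.of_forall fun φ => ?_)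
    show W φ * (Real.exp (-(lam * V φ)) * F φ)
        = Real.exp (lam * K) * (W φ * (Real.exp (-(lam * (V φ + K))) * F φ))
    have e : Real.exp (-(lam * V φ)) = Real.exp (lam * K) * Real.exp (-(lam * (V φ + K))) := by
      rw [← Real.exp_add]; congr 1; ring
    rw [e]; ring
  rw [hfun]
  refine (hexp.mul h).congr_deriv ?_
  simp only [zero_mul, neg_zero, Real.exp_zero, one_mul]
  have hsplit : (∫ φ, W φ * ((V φ + K) * F φ)) = (∫ φ, W φ * (V φ * F φ)) + K * ∫ φ, W φ * F φ := by
    have hKWF : Integrable (fun φ : Cfg P j N => K * (W φ * F φ)) := hWF.const_mul K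
    rw [← integral_const_mul, ← integral_add hWVF hKWF]
    refine integral_congr_ae (Filter.Eventually.of_forall fun φ => ?_)
    show W φ * ((V φ + K) * F φ) = W φ * (V φ * F φ) + K * (W φ * F φ)
    ring
  rw [hsplit]
  ring

/-- **THE SECOND-ORDER COEFFICIENT, GENERAL FORM** (§7 for any interaction `V ≥ −K` and observable `F` of exponential-linear
growth): the quotient-rule expression `D₁(λ) = (−N_{VF}N_1 + N_FN_V)/N_1²` of `(d/dλ)[N_F/N_1]`, `N_g(λ) = ∫We^{−λV}g`, is
right-differentiable at `0⁺` with derivative `E₀[V²F] − E₀[F]E₀[V²] − 2E₀[V]E₀[VF] + 2E₀[F]E₀[V]²` (`E₀ = Z^{−1}∫W·(−)`).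
[cite: Balaban1983Higgs3, (1.21) p.416] [cite: GlimmJaffeQP1987, §8.4–8.5] -/
theorem hasDerivWithinAt_firstDeriv_twoPoint_of_le (hw : 0 < w) (hM : 0 < M2) {V F : Cfg P j N → ℝ}
    (hV : ExpGrowth V) {K : ℝ} (hVK : ∀ φ, -K ≤ V φ) (hF : ExpGrowth F) :
    HasDerivWithinAt
      (fun lam : ℝ =>
        ((-(∫ φ, W φ * (Real.exp (-(lam * V φ)) * (V φ * F φ)))) * (∫ φ, W φ * (Real.exp (-(lam * V φ)) * 1))
          + (∫ φ, W φ * (Real.exp (-(lam * V φ)) * F φ))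
            * (∫ φ, W φ * (Real.exp (-(lam * V φ)) * (V φ * 1))))
          / (∫ φ, W φ * (Real.exp (-(lam * V φ)) * 1)) ^ 2)
      ((∫ φ, W φ * (V φ ^ 2 * F φ)) / (∫ φ, W φ)
        - (∫ φ, W φ * F φ) * (∫ φ, W φ * V φ ^ 2) / (∫ φ, W φ) ^ 2
        - 2 * (∫ φ, W φ * V φ) * (∫ φ, W φ * (V φ * F φ)) / (∫ φ, W φ) ^ 2
        + 2 * (∫ φ, W φ * F φ) * (∫ φ, W φ * V φ) ^ 2 / (∫ φ, W φ) ^ 3)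
      (Set.Ici 0) 0 := by
  have hVF := hasDerivWithinAt_gaussInt_exp_neg_of_le C η w c M2 hw hM hV hVK (hV.mul hF)
  have h1 := hasDerivWithinAt_gaussInt_exp_neg_of_le C η w c M2 hw hM hV hVK (ExpGrowth.const 1)
  have hFd := hasDerivWithinAt_gaussInt_exp_neg_of_le C η w c M2 hw hM hV hVK hF
  have hV1 := hasDerivWithinAt_gaussInt_exp_neg_of_le C η w c M2 hw hM hV hVK (hV.mul (ExpGrowth.const 1))
  have hZ : 0 < ∫ φ, W φ := B3WT226Traces.Z_pos C η w c M2 hw hM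
  have hden0 : (∫ φ : Cfg P j N, W φ * (Real.exp (-(0 * V φ)) * 1)) = ∫ φ, W φ := by
    rw [gaussInt_exp_neg_zero]; simp only [mul_one]
  have h := ((hVF.neg.mul h1).add (hFd.mul hV1)).div (h1.pow 2) (by
    show (∫ φ : Cfg P j N, W φ * (Real.exp (-(0 * V φ)) * 1)) ^ 2 ≠ 0
    rw [hden0]; exact pow_ne_zero 2 hZ.ne')
  refine h.congr_deriv ?_
  simp only [Pi.pow_apply, Pi.neg_apply, Pi.mul_apply, Pi.add_apply, zero_mul, neg_zero, Real.exp_zero, one_mul, mul_one]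
  have e1 : (∫ φ : Cfg P j N, W φ * (V φ * (V φ * F φ))) = ∫ φ, W φ * (V φ ^ 2 * F φ) :=
    integral_congr_ae (Filter.Eventually.of_forall fun φ => by ring)
  have e2 : (∫ φ : Cfg P j N, W φ * (V φ * V φ)) = ∫ φ, W φ * V φ ^ 2 :=
    integral_congr_ae (Filter.Eventually.of_forall fun φ => by ring)
  rw [e1, e2]
  set Z : ℝ := ∫ φ, W φ with hZdef
  set IF : ℝ := ∫ φ, W φ * F φ
  set IV : ℝ := ∫ φ, W φ * V φ
  set IVF : ℝ := ∫ φ, W φ * (V φ * F φ)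
  set IV2F : ℝ := ∫ φ, W φ * (V φ ^ 2 * F φ)
  set IV2 : ℝ := ∫ φ, W φ * V φ ^ 2
  have hZne : Z ≠ 0 := hZ.ne'
  field_simp
  ring

omit C η in
/-- `:∣φ(y)∣⁴: + 2(N+2)C(y,y)² = (∣φ(y)∣² − (N+2)C(y,y))² ≥ 0`: the Wick-ordered quartic vertex is bounded below (it is not
positive). [cite: GlimmJaffeQP1987, (9.1.5)] -/
theorem neg_le_wick4 (y : Site P j) (φ : Cfg P j N) : -(2 * (N + 2) * G w c M2 y y ^ 2) ≤ wick4 w c M2 y φ := by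
  rw [wick4_def]
  have h4 : ‖φ y‖ ^ 4 = (‖φ y‖ ^ 2) ^ 2 := by ring
  rw [h4]
  nlinarith [sq_nonneg (‖φ y‖ ^ 2 - (N + 2) * G w c M2 y y)]

omit C η in
/-- hence the Wick-ordered interaction `Σ_yη^d:∣φ(y)∣⁴:` is bounded below by `−Σ_yη^d·2(N+2)C(y,y)²` (`η^d > 0`).
[cite: Balaban1983Higgs3, (2.28) p.431] -/
theorem neg_le_sum_wick4 (hw : 0 < w) (φ : Cfg P j N) :
    -(∑ y : Site P j, w * (2 * (N + 2) * G w c M2 y y ^ 2)) ≤ ∑ y : Site P j, w * wick4 w c M2 y φ := by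
  rw [← Finset.sum_neg_distrib]
  refine Finset.sum_le_sum fun y _ => ?_
  rw [← mul_neg]
  exact mul_le_mul_of_nonneg_left (neg_le_wick4 w c M2 y φ) hw.le

omit C η in
/-- growth of the Wick-ordered interaction. [cite: Balaban1983Higgs3, (2.28) p.431] -/
theorem expGrowth_sum_wick4 : ExpGrowth (fun φ : Cfg P j N => ∑ y : Site P j, w * wick4 w c M2 y φ) :=
  ExpGrowth.sum _ fun y _ => (expGrowth_wick4 w c M2 y).const_mul w

/-- **a Wick-ordered vertex cannot absorb only two legs**: `∫W·:∣φ(y)∣⁴:·φ_a(x)φ_b(x′) = 0` — with the Wick-ordered interaction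
there is NO first-order term (no tadpole ①). (`B3WickVertexCalculus.integral_wick4_mul_of_deg2` with §1's two contractions of the
legs.) [cite: GlimmJaffeQP1987, Cor. 8.3.2 (8.3.8)–(8.3.9)] -/
theorem integral_wick4_legs (hw : 0 < w) (hM : 0 < M2) (a b : Fin N) (x x' y : Site P j) :
    ∫ φ, W φ * (wick4 w c M2 y φ * (⟪φ x, 𝐞 a⟫_ℝ * ⟪φ x', 𝐞 b⟫_ℝ)) = 0 :=
  integral_wick4_mul_of_deg2 C η w c M2 hw hM y (expGrowth_legs a b x x')
    (fun _ => (((ExpGrowth.inner_apply x' _).const_mul _)).add ((ExpGrowth.inner_apply x _).mul (ExpGrowth.const _)))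
    (fun _ => ExpGrowth.const _)
    (fun i => derivAlong_legs w c M2 a b x x' y i) (fun i => derivAlong_legs' w c M2 a b x x' y i)
    (fun _ _ => DerivAlong.const _ _)

/-- `∫W·V_:·φ_a(x)φ_b(x′) = 0` for `V_: = Σ_yη^d:∣φ(y)∣⁴:`. [cite: GlimmJaffeQP1987, Cor. 8.3.2] -/
theorem integral_sumWick4_mul_legs (hw : 0 < w) (hM : 0 < M2) (a b : Fin N) (x x' : Site P j) :
    ∫ φ, W φ * ((∑ y : Site P j, w * wick4 w c M2 y φ) * (⟪φ x, 𝐞 a⟫_ℝ * ⟪φ x', 𝐞 b⟫_ℝ)) = 0 := by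
  have hi : ∀ y : Site P j,
      Integrable (fun φ : Cfg P j N => W φ * (w * (wick4 w c M2 y φ * (⟪φ x, 𝐞 a⟫_ℝ * ⟪φ x', 𝐞 b⟫_ℝ)))) :=
    fun y => (((expGrowth_wick4 w c M2 y).mul (expGrowth_legs a b x x')).const_mul w).integrable C η w c M2 hw hM
  have e1 : (fun φ : Cfg P j N => W φ * ((∑ y : Site P j, w * wick4 w c M2 y φ) * (⟪φ x, 𝐞 a⟫_ℝ * ⟪φ x', 𝐞 b⟫_ℝ)))
      = fun φ => ∑ y : Site P j, W φ * (w * (wick4 w c M2 y φ * (⟪φ x, 𝐞 a⟫_ℝ * ⟪φ x', 𝐞 b⟫_ℝ))) := by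
    funext φ; rw [Finset.sum_mul, Finset.mul_sum]; exact Finset.sum_congr rfl fun y _ => by ring
  rw [e1, integral_finsetSum _ (fun y _ => hi y)]
  refine Finset.sum_eq_zero fun y _ => ?_
  have e2 : (fun φ : Cfg P j N => W φ * (w * (wick4 w c M2 y φ * (⟪φ x, 𝐞 a⟫_ℝ * ⟪φ x', 𝐞 b⟫_ℝ))))
      = fun φ => w * (W φ * (wick4 w c M2 y φ * (⟪φ x, 𝐞 a⟫_ℝ * ⟪φ x', 𝐞 b⟫_ℝ))) := by
    funext φ; ring
  rw [e2, integral_const_mul, integral_wick4_legs C η w c M2 hw hM a b x x' y, mul_zero]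

/-- `∫W·V_: = 0` (`B3WickVertexCalculus.integral_wick4`: the Wick-ordered vertex has mean zero — no first-order vacuum graph).
[cite: GlimmJaffeQP1987, (6.3.12)] -/
theorem integral_sumWick4 (hw : 0 < w) (hM : 0 < M2) :
    ∫ φ, W φ * (∑ y : Site P j, w * wick4 w c M2 y φ) = 0 := by
  have hi : ∀ y : Site P j, Integrable (fun φ : Cfg P j N => W φ * (w * wick4 w c M2 y φ)) :=
    fun y => ((expGrowth_wick4 w c M2 y).const_mul w).integrable C η w c M2 hw hM
  have e1 : (fun φ : Cfg P j N => W φ * ∑ y : Site P j, w * wick4 w c M2 y φ)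
      = fun φ => ∑ y : Site P j, W φ * (w * wick4 w c M2 y φ) := by
    funext φ; rw [Finset.mul_sum]
  rw [e1, integral_finsetSum _ (fun y _ => hi y)]
  refine Finset.sum_eq_zero fun y _ => ?_
  have e2 : (fun φ : Cfg P j N => W φ * (w * wick4 w c M2 y φ)) = fun φ => w * (W φ * wick4 w c M2 y φ) := by
    funext φ; ring
  rw [e2, integral_const_mul, integral_wick4 C η w c M2 hw hM y, mul_zero]

/-- `∫W·V_:² = Z·Σ_{y,z}η^{2d}·8N(N+2)C(z,y)⁴` — the second-order vacuum graphs of the Wick-ordered interaction are the basketballs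
(§8). [cite: GlimmJaffeQP1987, §8.3] -/
theorem integral_sumWick4_sq (hw : 0 < w) (hM : 0 < M2) :
    ∫ φ, W φ * (∑ y : Site P j, w * wick4 w c M2 y φ) ^ 2
      = (∫ φ, W φ) * ∑ y : Site P j, ∑ z : Site P j, w * w * (8 * (N * (N + 2)) * G w c M2 z y ^ 4) := by
  have hi : ∀ y z : Site P j, Integrable (fun φ : Cfg P j N => W φ * (w * w * (wick4 w c M2 y φ * wick4 w c M2 z φ))) :=
    fun y z => (((expGrowth_wick4 w c M2 y).mul (expGrowth_wick4 w c M2 z)).const_mul (w * w)).integrable C η w c M2 hw hM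
  have e1 : (fun φ : Cfg P j N => W φ * (∑ y : Site P j, w * wick4 w c M2 y φ) ^ 2)
      = fun φ => ∑ y : Site P j, ∑ z : Site P j, W φ * (w * w * (wick4 w c M2 y φ * wick4 w c M2 z φ)) := by
    funext φ
    rw [sq, Finset.sum_mul_sum, Finset.mul_sum]
    refine Finset.sum_congr rfl fun y _ => ?_
    rw [Finset.mul_sum]
    exact Finset.sum_congr rfl fun z _ => by ring
  rw [e1, integral_finsetSum _ (fun y _ => integrable_finsetSum _ fun z _ => hi y z), Finset.mul_sum]
  refine Finset.sum_congr rfl fun y _ => ?_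
  rw [integral_finsetSum _ (fun z _ => hi y z), Finset.mul_sum]
  refine Finset.sum_congr rfl fun z _ => ?_
  have e2 : (fun φ : Cfg P j N => W φ * (w * w * (wick4 w c M2 y φ * wick4 w c M2 z φ)))
      = fun φ => (w * w) * (W φ * (wick4 w c M2 y φ * wick4 w c M2 z φ)) := by
    funext φ; ring
  rw [e2, integral_const_mul, integral_wick4_wick4 C η w c M2 hw hM y z]
  ring

/-- `∫W·V_:²·φ_a(x)φ_b(x′) = Z·δ_{ab}·Σ_{y,z}η^{2d}[8N(N+2)C(z,y)⁴C(x,x′) + 4²(2N+4)C(z,y)³(C(x,y)C(z,x′) + C(x′,y)C(z,x))]`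
(§9 summed over the two vertices). [cite: Balaban1983Higgs3, (1.22) p.416] -/
theorem integral_sumWick4_sq_legs (hw : 0 < w) (hM : 0 < M2) (a b : Fin N) (x x' : Site P j) :
    ∫ φ, W φ * ((∑ y : Site P j, w * wick4 w c M2 y φ) ^ 2 * (⟪φ x, 𝐞 a⟫_ℝ * ⟪φ x', 𝐞 b⟫_ℝ))
      = (∫ φ, W φ) * ⟪𝐞 a, 𝐞 b⟫_ℝ * ∑ y : Site P j, ∑ z : Site P j, w * w *
          (8 * (N * (N + 2)) * G w c M2 z y ^ 4 * G w c M2 x x'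
            + 4 ^ 2 * (2 * N + 4) * G w c M2 z y ^ 3
              * (G w c M2 x y * G w c M2 z x' + G w c M2 x' y * G w c M2 z x)) := by
  have hi : ∀ y z : Site P j, Integrable (fun φ : Cfg P j N =>
      W φ * (w * w * (wick4 w c M2 y φ * (wick4 w c M2 z φ * (⟪φ x, 𝐞 a⟫_ℝ * ⟪φ x', 𝐞 b⟫_ℝ))))) :=
    fun y z => (((expGrowth_wick4 w c M2 y).mul ((expGrowth_wick4 w c M2 z).mul (expGrowth_legs a b x x'))).const_mul
      (w * w)).integrable C η w c M2 hw hM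
  have e1 : (fun φ : Cfg P j N => W φ * ((∑ y : Site P j, w * wick4 w c M2 y φ) ^ 2 * (⟪φ x, 𝐞 a⟫_ℝ * ⟪φ x', 𝐞 b⟫_ℝ)))
      = fun φ => ∑ y : Site P j, ∑ z : Site P j,
          W φ * (w * w * (wick4 w c M2 y φ * (wick4 w c M2 z φ * (⟪φ x, 𝐞 a⟫_ℝ * ⟪φ x', 𝐞 b⟫_ℝ)))) := by
    funext φ
    rw [sq, Finset.sum_mul_sum, Finset.sum_mul, Finset.mul_sum]
    refine Finset.sum_congr rfl fun y _ => ?_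
    rw [Finset.sum_mul, Finset.mul_sum]
    exact Finset.sum_congr rfl fun z _ => by ring
  rw [e1, integral_finsetSum _ (fun y _ => integrable_finsetSum _ fun z _ => hi y z), Finset.mul_sum]
  refine Finset.sum_congr rfl fun y _ => ?_
  rw [integral_finsetSum _ (fun z _ => hi y z), Finset.mul_sum]
  refine Finset.sum_congr rfl fun z _ => ?_
  have e2 : (fun φ : Cfg P j N => W φ * (w * w * (wick4 w c M2 y φ * (wick4 w c M2 z φ * (⟪φ x, 𝐞 a⟫_ℝ * ⟪φ x', 𝐞 b⟫_ℝ)))))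
      = fun φ => (w * w) * (W φ * (wick4 w c M2 y φ * (wick4 w c M2 z φ * (⟪φ x, 𝐞 a⟫_ℝ * ⟪φ x', 𝐞 b⟫_ℝ)))) := by
    funext φ; ring
  rw [e2, integral_const_mul, integral_wick4_wick4_legs C η w c M2 hw hM a b x x' y z]
  ring

/-- **SECOND-ORDER PERTURBATION THEORY FOR THE WICK-ORDERED `λ∣φ∣⁴` THEORY = THE SUNSET.**  For the two-point function
`G^{:}_λ,ab(x,x′) = ∫We^{−λV_:}φ_a(x)φ_b(x′)/∫We^{−λV_:}`, `V_: = Σ_yη^d:∣φ(y)∣⁴:` (`λ ≥ 0`; `e^{−λV_:}` is integrable since `V_:`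
is bounded below), the first derivative (§4/§10: here it VANISHES at `0⁺`, `integral_sumWick4_mul_legs`/`integral_sumWick4` — no
tadpole) is right-differentiable at `0⁺` and `G^{:}″_{ab}(0⁺) = δ_{ab}·Σ_{y,z}η^{2d}·4²(2N+4)·C(z,y)³·[C(x,y)C(z,x′) + C(x′,y)C(z,x)]`:
the vacuum basketballs CANCEL between numerator and normalization (`integral_sumWick4_sq_legs` against `integral_legs ×
integral_sumWick4_sq`), and what remains is the sunset ⑥ of (1.22) between two free propagators, in both orientations — the
only amputated connected (and 1PI) two-leg graph with two Wick-ordered quartic vertices.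
[cite: Balaban1983Higgs3, (1.21)–(1.22) p.416] [cite: GlimmJaffeQP1987, §8.4–8.5] -/
theorem hasDerivWithinAt_firstDeriv_twoPointWick4 (hw : 0 < w) (hM : 0 < M2) (a b : Fin N) (x x' : Site P j) :
    HasDerivWithinAt
      (fun lam : ℝ =>
        ((-(∫ φ, W φ * (Real.exp (-(lam * ∑ y : Site P j, w * wick4 w c M2 y φ))
              * ((∑ y : Site P j, w * wick4 w c M2 y φ) * (⟪φ x, 𝐞 a⟫_ℝ * ⟪φ x', 𝐞 b⟫_ℝ)))))
            * (∫ φ, W φ * (Real.exp (-(lam * ∑ y : Site P j, w * wick4 w c M2 y φ)) * 1))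
          + (∫ φ, W φ * (Real.exp (-(lam * ∑ y : Site P j, w * wick4 w c M2 y φ)) * (⟪φ x, 𝐞 a⟫_ℝ * ⟪φ x', 𝐞 b⟫_ℝ)))
            * (∫ φ, W φ * (Real.exp (-(lam * ∑ y : Site P j, w * wick4 w c M2 y φ))
                * ((∑ y : Site P j, w * wick4 w c M2 y φ) * 1))))
          / (∫ φ, W φ * (Real.exp (-(lam * ∑ y : Site P j, w * wick4 w c M2 y φ)) * 1)) ^ 2)
      (⟪𝐞 a, 𝐞 b⟫_ℝ * ∑ y : Site P j, ∑ z : Site P j, w * w * (4 ^ 2 * (2 * N + 4) * G w c M2 z y ^ 3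
          * (G w c M2 x y * G w c M2 z x' + G w c M2 x' y * G w c M2 z x)))
      (Set.Ici 0) 0 := by
  have h := hasDerivWithinAt_firstDeriv_twoPoint_of_le C η w c M2 hw hM (expGrowth_sum_wick4 w c M2)
    (neg_le_sum_wick4 w c M2 hw) (expGrowth_legs a b x x')
  refine h.congr_deriv ?_
  rw [integral_sumWick4_sq_legs C η w c M2 hw hM a b x x', integral_legs C η w c M2 hw hM a b x x',
    integral_sumWick4_sq C η w c M2 hw hM, integral_sumWick4 C η w c M2 hw hM,
    integral_sumWick4_mul_legs C η w c M2 hw hM a b x x']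
  have hsum : (∑ y : Site P j, ∑ z : Site P j, w * w *
        (8 * (N * (N + 2)) * G w c M2 z y ^ 4 * G w c M2 x x'
          + 4 ^ 2 * (2 * N + 4) * G w c M2 z y ^ 3 * (G w c M2 x y * G w c M2 z x' + G w c M2 x' y * G w c M2 z x)))
      = G w c M2 x x' * (∑ y : Site P j, ∑ z : Site P j, w * w * (8 * (N * (N + 2)) * G w c M2 z y ^ 4))
        + ∑ y : Site P j, ∑ z : Site P j, w * w * (4 ^ 2 * (2 * N + 4) * G w c M2 z y ^ 3
          * (G w c M2 x y * G w c M2 z x' + G w c M2 x' y * G w c M2 z x)) := by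
    rw [Finset.mul_sum, ← Finset.sum_add_distrib]
    refine Finset.sum_congr rfl fun y _ => ?_
    rw [Finset.mul_sum, ← Finset.sum_add_distrib]
    exact Finset.sum_congr rfl fun z _ => by ring
  rw [hsum]
  set Z : ℝ := ∫ φ, W φ with hZdef
  have hZne : Z ≠ 0 := (B3WT226Traces.Z_pos C η w c M2 hw hM).ne'
  field_simp
  ring

/-- **DICTIONARY: THE ORDER-λ² TERM IS `C₀·⑥·C₀`.**  For p26's data `D : B3Eq123Counterterms.SEData` carrying this propagator
(`D.C0 = C`, `D.N = N`), `λ²·G^{:}″(0⁺)/2!` (per `δ_{ab}`) `= Σ_{y,z}η^{2d}C(x,y)·sig6 D(y,z)·C(z,x′)` — p26 typed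
`sig6 = 4²(2N+4)λ²(C^ε_0(y−z))³` AS PRINTED in (1.22)⑥; here its coefficient `4²(2N+4)` and its place in (1.21) (the `n = 1` term with
the insertion ⑥, the two orientations of §9 merging into the Taylor factor `1/2!`) are theorems about the Wick-ordered measure.
[cite: Balaban1983Higgs3, (1.21)–(1.22) p.416] -/
theorem secondCoeff_eq_C0_sig6_C0 (D : SEData P j) (hC0 : D.C0 = G w c M2) (hN : D.N = N) (x x' : Site P j) :
    D.lam ^ 2 * (∑ y : Site P j, ∑ z : Site P j, w * w * (4 ^ 2 * (2 * N + 4) * G w c M2 z y ^ 3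
        * (G w c M2 x y * G w c M2 z x' + G w c M2 x' y * G w c M2 z x))) / 2
      = ∑ y : Site P j, ∑ z : Site P j, w * w * (G w c M2 x y * sig6 D y z * G w c M2 z x') := by
  have hswap : (∑ y : Site P j, ∑ z : Site P j, w * w * (4 ^ 2 * (2 * N + 4) * G w c M2 z y ^ 3
        * (G w c M2 x' y * G w c M2 z x)))
      = ∑ y : Site P j, ∑ z : Site P j, w * w * (4 ^ 2 * (2 * N + 4) * G w c M2 z y ^ 3
        * (G w c M2 x y * G w c M2 z x')) := by
    rw [Finset.sum_comm]
    refine Finset.sum_congr rfl fun y _ => Finset.sum_congr rfl fun z _ => ?_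
    rw [G_symm w c M2 y z, G_symm w c M2 x' z, G_symm w c M2 y x, G_symm w c M2 z x']
    ring
  have hsplit : (∑ y : Site P j, ∑ z : Site P j, w * w * (4 ^ 2 * (2 * N + 4) * G w c M2 z y ^ 3
        * (G w c M2 x y * G w c M2 z x' + G w c M2 x' y * G w c M2 z x)))
      = (∑ y : Site P j, ∑ z : Site P j, w * w * (4 ^ 2 * (2 * N + 4) * G w c M2 z y ^ 3
          * (G w c M2 x y * G w c M2 z x')))
        + ∑ y : Site P j, ∑ z : Site P j, w * w * (4 ^ 2 * (2 * N + 4) * G w c M2 z y ^ 3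
          * (G w c M2 x' y * G w c M2 z x)) := by
    rw [← Finset.sum_add_distrib]
    refine Finset.sum_congr rfl fun y _ => ?_
    rw [← Finset.sum_add_distrib]
    exact Finset.sum_congr rfl fun z _ => by ring
  rw [hsplit, hswap, ← two_mul]
  have e : ∀ y z : Site P j, w * w * (G w c M2 x y * sig6 D y z * G w c M2 z x')
      = D.lam ^ 2 * (w * w * (4 ^ 2 * (2 * N + 4) * G w c M2 z y ^ 3 * (G w c M2 x y * G w c M2 z x'))) := by
    intro y z
    simp only [sig6, hC0, hN]
    rw [G_symm w c M2 y z]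
    ring
  have hR : (∑ y : Site P j, ∑ z : Site P j, w * w * (G w c M2 x y * sig6 D y z * G w c M2 z x'))
      = D.lam ^ 2 * ∑ y : Site P j, ∑ z : Site P j, w * w * (4 ^ 2 * (2 * N + 4) * G w c M2 z y ^ 3
          * (G w c M2 x y * G w c M2 z x')) := by
    refine Eq.trans (Finset.sum_congr rfl fun y _ => Finset.sum_congr rfl fun z _ => e y z) ?_
    refine Eq.trans (Finset.sum_congr rfl fun y _ => (Finset.mul_sum _ _ _).symm) ?_
    exact (Finset.mul_sum _ _ _).symm
  linear_combination (-1 : ℝ) * hR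

/-- **… in r15's `B3Sect1TwoPoint.dysonTerm` vocabulary**: the matrix of the order-`λ²` term `λ²·G^{:}″(0⁺)/2!` of the
Wick-ordered theory (per `δ_{ab}`, with the volume element `η^d`) is `dysonTerm (η^d·C₀) (η^d·sig6) 1 = C₀[⑥]C₀` — the `n = 1`
term of (1.21) with the 1PI insertion ⑥. [cite: Balaban1983Higgs3, (1.21)–(1.22) p.416] -/
theorem secondCoeff_eq_dysonTerm_one (D : SEData P j) (hC0 : D.C0 = G w c M2) (hN : D.N = N) :
    (Matrix.of fun x x' : Site P j =>
        w * (D.lam ^ 2 * (∑ y : Site P j, ∑ z : Site P j, w * w * (4 ^ 2 * (2 * N + 4) * G w c M2 z y ^ 3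
          * (G w c M2 x y * G w c M2 z x' + G w c M2 x' y * G w c M2 z x))) / 2))
      = B3Sect1TwoPoint.dysonTerm (w • G w c M2) (Matrix.of fun y z : Site P j => w * sig6 D y z) 1 := by
  ext x x'
  simp only [B3Sect1TwoPoint.dysonTerm, pow_one, Matrix.mul_apply, Matrix.of_apply, Matrix.smul_apply, smul_eq_mul]
  rw [secondCoeff_eq_C0_sig6_C0 w c M2 D hC0 hN x x', Finset.mul_sum]
  refine Finset.sum_congr rfl fun y _ => ?_
  rw [Finset.mul_sum, Finset.mul_sum]
  exact Finset.sum_congr rfl fun z _ => by ring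

/-! ## §11 (v1.2) THE PLAIN VERTEX AT ORDER λ²: the local two-loop kernel and the tadpole chain -/

omit C η in
/-- `∣φ(y)∣⁴ = :∣φ(y)∣⁴: + 2(N+2)C(y,y)·:∣φ(y)∣²: + N(N+2)C(y,y)²` — the plain quartic vertex of (1.20) through the Wick-ordered
square and fourth power (`wick4_def`, `wick2_def`). [cite: GlimmJaffeQP1987, (9.1.5)] -/
theorem norm_four_eq_wick (y : Site P j) (φ : Cfg P j N) :
    ‖φ y‖ ^ 4 = wick4 w c M2 y φ + 2 * (N + 2) * G w c M2 y y * wick2 w c M2 y φ + N * (N + 2) * G w c M2 y y ^ 2 := by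
  rw [wick4_def, wick2_def]; ring

omit C η in
/-- `D_{y,i}:∣φ(z)∣²: = 2C(z,y)φ_i(z)`. [cite: GlimmJaffeQP1987, (9.1.3)] -/
theorem derivAlong_wick2 (y z : Site P j) (i : Fin N) :
    DerivAlong (hx w c M2 y i) (fun φ : Cfg P j N => wick2 w c M2 z φ)
      (fun φ => 2 * (G w c M2 z y * ⟪φ z, 𝐞 i⟫_ℝ)) := by
  have ew : (fun φ : Cfg P j N => wick2 w c M2 z φ) = fun φ => ‖φ z‖ ^ 2 - N * G w c M2 z z :=
    funext fun φ => by rw [wick2_def]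
  rw [ew]
  exact ((DerivAlong.norm_sq_apply (hx w c M2 y i) z).sub (DerivAlong.const _ _)).congr fun φ => by
    rw [inner_hx_right]; ring

omit C η in
/-- `D_{y,k}(2C(z,y)φ_i(z)) = 2C(z,y)²δ_{ki}`. [cite: GlimmJaffeQP1987, (9.1.3)] -/
theorem derivAlong_wick2' (y z : Site P j) (i k : Fin N) :
    DerivAlong (hx w c M2 y k) (fun φ : Cfg P j N => 2 * (G w c M2 z y * ⟪φ z, 𝐞 i⟫_ℝ))
      (fun _ => 2 * (G w c M2 z y * (G w c M2 z y * ⟪𝐞 k, 𝐞 i⟫_ℝ))) :=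
  (((DerivAlong.inner_apply (hx w c M2 y k) z (𝐞 i)).const_mul _).const_mul _).congr fun φ => by
    rw [inner_hx_left]

/-- `∫W·:∣φ(z)∣²:·φ_a(x)φ_b(x′) = 2Z·C(x,z)C(x′,z)δ_{ab}` — both legs of the Wick-ordered square into the external legs (the
amputated mass-type insertion). [cite: GlimmJaffeQP1987, Cor. 8.3.2] -/
theorem integral_wick2_legs (hw : 0 < w) (hM : 0 < M2) (a b : Fin N) (x x' z : Site P j) :
    ∫ φ, W φ * (wick2 w c M2 z φ * (⟪φ x, 𝐞 a⟫_ℝ * ⟪φ x', 𝐞 b⟫_ℝ))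
      = (∫ φ, W φ) * ⟪𝐞 a, 𝐞 b⟫_ℝ * (2 * (G w c M2 x z * G w c M2 x' z)) := by
  have h := integral_wick2_mul C η w c M2 hw hM z (expGrowth_legs a b x x')
    (fun _ => (((ExpGrowth.inner_apply x' _).const_mul _)).add ((ExpGrowth.inner_apply x _).mul (ExpGrowth.const _)))
    (fun _ => ExpGrowth.const _)
    (fun i => derivAlong_legs w c M2 a b x x' z i) (fun i => derivAlong_legs' w c M2 a b x x' z i)
  rw [h]
  have e : ∀ i : Fin N, ∫ φ : Cfg P j N, W φ * (2 * (G w c M2 x z * ⟪𝐞 i, 𝐞 a⟫_ℝ) * (G w c M2 x' z * ⟪𝐞 i, 𝐞 b⟫_ℝ)) =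
      (∫ φ, W φ) * (2 * (G w c M2 x z * G w c M2 x' z)) * (⟪𝐞 i, 𝐞 a⟫_ℝ * ⟪𝐞 i, 𝐞 b⟫_ℝ) := fun i => by
    rw [integral_mul_const]; ring
  simp_rw [e]
  rw [← Finset.mul_sum, sum_inner_basis_mul]
  ring

/-- `∫W·:∣φ(y)∣²:·:∣φ(z)∣²: = 2N·C(z,y)²·Z` (the one-loop bubble). [cite: GlimmJaffeQP1987, Cor. 8.3.2] -/
theorem integral_wick2_wick2 (hw : 0 < w) (hM : 0 < M2) (y z : Site P j) :
    ∫ φ, W φ * (wick2 w c M2 y φ * wick2 w c M2 z φ) = 2 * N * G w c M2 z y ^ 2 * ∫ φ, W φ := by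
  have h := integral_wick2_mul C η w c M2 hw hM y (expGrowth_wick2 w c M2 z)
    (fun i => ((ExpGrowth.inner_apply z _).const_mul _).const_mul _) (fun _ => ExpGrowth.const _)
    (fun i => derivAlong_wick2 w c M2 y z i) (fun i => derivAlong_wick2' w c M2 y z i i)
  rw [h]
  have e : ∀ i : Fin N, ∫ φ : Cfg P j N, W φ * (2 * (G w c M2 z y * (G w c M2 z y * ⟪𝐞 i, 𝐞 i⟫_ℝ)))
      = 2 * G w c M2 z y ^ 2 * ∫ φ, W φ := fun i => by
    rw [integral_mul_const, inner_basis, if_pos rfl]; ring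
  simp_rw [e]
  rw [Finset.sum_const, Finset.card_univ, Fintype.card_fin, nsmul_eq_mul]
  ring

/-- **THE CHAIN KERNEL**: `∫W·:∣φ(y)∣²:·:∣φ(z)∣²:·φ_a(x)φ_b(x′) = Z·δ_{ab}·[2N·C(z,y)²C(x,x′) + 4C(z,y)(C(x,y)C(z,x′) + C(x′,y)C(z,x))]`
— the bubble times the free line, plus the CHAIN `x → y → z → x′` (both orientations): two mass-type insertions in a row, the
one-particle REDUCIBLE second-order graph (`dysonTerm … 2`). [cite: Balaban1983Higgs3, (1.21) p.416] [cite: GlimmJaffeQP1987, §8.3] -/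
theorem integral_wick2_wick2_legs (hw : 0 < w) (hM : 0 < M2) (a b : Fin N) (x x' y z : Site P j) :
    ∫ φ, W φ * (wick2 w c M2 y φ * (wick2 w c M2 z φ * (⟪φ x, 𝐞 a⟫_ℝ * ⟪φ x', 𝐞 b⟫_ℝ)))
      = (∫ φ, W φ) * ⟪𝐞 a, 𝐞 b⟫_ℝ * (2 * N * G w c M2 z y ^ 2 * G w c M2 x x'
          + 4 * G w c M2 z y * (G w c M2 x y * G w c M2 z x' + G w c M2 x' y * G w c M2 z x)) := by
  have hF := expGrowth_legs (P := P) (j := j) a b x x'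
  have hf1g : ∀ i, ExpGrowth (fun φ : Cfg P j N =>
      G w c M2 x y * ⟪𝐞 i, 𝐞 a⟫_ℝ * ⟪φ x', 𝐞 b⟫_ℝ + ⟪φ x, 𝐞 a⟫_ℝ * (G w c M2 x' y * ⟪𝐞 i, 𝐞 b⟫_ℝ)) :=
    fun i => (((ExpGrowth.inner_apply x' _).const_mul _)).add ((ExpGrowth.inner_apply x _).mul (ExpGrowth.const _))
  have hQ := expGrowth_wick2 (P := P) (j := j) (N := N) w c M2 z
  have hZ1 : ∀ i, ExpGrowth (fun φ : Cfg P j N => 2 * (G w c M2 z y * ⟪φ z, 𝐞 i⟫_ℝ)) :=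
    fun i => ((ExpGrowth.inner_apply z _).const_mul _).const_mul _
  set F : Cfg P j N → ℝ := fun φ => ⟪φ x, 𝐞 a⟫_ℝ * ⟪φ x', 𝐞 b⟫_ℝ with hFdef
  set f1 : Fin N → Cfg P j N → ℝ := fun i φ =>
    G w c M2 x y * ⟪𝐞 i, 𝐞 a⟫_ℝ * ⟪φ x', 𝐞 b⟫_ℝ + ⟪φ x, 𝐞 a⟫_ℝ * (G w c M2 x' y * ⟪𝐞 i, 𝐞 b⟫_ℝ) with hf1def
  set f2 : Fin N → ℝ := fun i => 2 * (G w c M2 x y * ⟪𝐞 i, 𝐞 a⟫_ℝ) * (G w c M2 x' y * ⟪𝐞 i, 𝐞 b⟫_ℝ) with hf2def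
  set Q : Cfg P j N → ℝ := fun φ => wick2 w c M2 z φ with hQdef
  set Z1 : Fin N → Cfg P j N → ℝ := fun i φ => 2 * (G w c M2 z y * ⟪φ z, 𝐞 i⟫_ℝ) with hZ1def
  set cc : Fin N → Fin N → ℝ := fun i k => 2 * (G w c M2 z y * (G w c M2 z y * ⟪𝐞 k, 𝐞 i⟫_ℝ)) with hccdef
  have dQ : ∀ i, DerivAlong (hx w c M2 y i) Q (Z1 i) := fun i => derivAlong_wick2 w c M2 y z i
  have dZ1 : ∀ i k, DerivAlong (hx w c M2 y k) (Z1 i) (fun _ => cc i k) := fun i k => derivAlong_wick2' w c M2 y z i k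
  have dF : ∀ i, DerivAlong (hx w c M2 y i) F (f1 i) := fun i => derivAlong_legs w c M2 a b x x' y i
  have df1 : ∀ i, DerivAlong (hx w c M2 y i) (f1 i) (fun _ => f2 i) := fun i => derivAlong_legs' w c M2 a b x x' y i
  have key := integral_wick2_mul C η w c M2 hw hM y (R := fun φ : Cfg P j N => Q φ * F φ)
    (R₁ := fun i φ => Z1 i φ * F φ + Q φ * f1 i φ)
    (R₂ := fun i φ => (cc i i * F φ + Z1 i φ * f1 i φ) + (Z1 i φ * f1 i φ + Q φ * f2 i))
    (hQ.mul hF) (fun i => ((hZ1 i).mul hF).add (hQ.mul (hf1g i)))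
    (fun i => (((ExpGrowth.const _).mul hF).add ((hZ1 i).mul (hf1g i))).add
      (((hZ1 i).mul (hf1g i)).add (hQ.mul (ExpGrowth.const _))))
    (fun i => (dQ i).mul (dF i)) (fun i => ((dZ1 i i).mul (dF i)).add ((dQ i).mul (df1 i)))
  rw [show (∫ φ, W φ * (wick2 w c M2 y φ * (wick2 w c M2 z φ * (⟪φ x, 𝐞 a⟫_ℝ * ⟪φ x', 𝐞 b⟫_ℝ))))
      = ∫ φ, W φ * (wick2 w c M2 y φ * (Q φ * F φ)) from rfl, key]
  -- termwise
  have v1 : ∀ i, ∫ φ, W φ * (cc i i * F φ) = cc i i * ((∫ φ, W φ) * (G w c M2 x x' * ⟪𝐞 a, 𝐞 b⟫_ℝ)) := by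
    intro i
    have e : (fun φ : Cfg P j N => W φ * (cc i i * F φ)) = fun φ => cc i i * (W φ * F φ) := by funext φ; ring
    rw [e, integral_const_mul, hFdef, integral_legs C η w c M2 hw hM]
  have v2 : ∀ i, ∫ φ, W φ * (Z1 i φ * f1 i φ) = (∫ φ, W φ) *
      (0 * (G w c M2 x y * ⟪𝐞 i, 𝐞 a⟫_ℝ) * (G w c M2 z x' * ⟪𝐞 i, 𝐞 b⟫_ℝ)
        + 2 * G w c M2 z y * (G w c M2 x y * ⟪𝐞 i, 𝐞 a⟫_ℝ) * (G w c M2 z x' * ⟪𝐞 i, 𝐞 b⟫_ℝ)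
        + 0 * (G w c M2 x' y * ⟪𝐞 i, 𝐞 b⟫_ℝ) * (G w c M2 x z * ⟪𝐞 a, 𝐞 i⟫_ℝ)
        + 2 * G w c M2 z y * (G w c M2 x' y * ⟪𝐞 i, 𝐞 b⟫_ℝ) * (G w c M2 x z * ⟪𝐞 a, 𝐞 i⟫_ℝ)) := by
    intro i
    have e : (fun φ : Cfg P j N => W φ * (Z1 i φ * f1 i φ)) = fun φ => W φ *
        ((0 * ⟪φ z, 𝐞 i⟫_ℝ + (2 * G w c M2 z y) * ⟪φ z, 𝐞 i⟫_ℝ)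
          * ((G w c M2 x y * ⟪𝐞 i, 𝐞 a⟫_ℝ) * ⟪φ x', 𝐞 b⟫_ℝ + ⟪φ x, 𝐞 a⟫_ℝ * (G w c M2 x' y * ⟪𝐞 i, 𝐞 b⟫_ℝ))) := by
      funext φ; simp only [hZ1def, hf1def]; ring
    rw [e, integral_zlin_mul_f1 C η w c M2 hw hM]
  have v3 : ∀ i, ∫ φ, W φ * (Q φ * f2 i) = 0 := by
    intro i
    have e : (fun φ : Cfg P j N => W φ * (Q φ * f2 i)) = fun φ => (W φ * Q φ) * f2 i := by funext φ; ring
    rw [e, integral_mul_const, hQdef, integral_wick2 C η w c M2 hw hM z, zero_mul]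
  have hterm : ∀ i, ∫ φ, W φ * ((cc i i * F φ + Z1 i φ * f1 i φ) + (Z1 i φ * f1 i φ + Q φ * f2 i))
      = cc i i * ((∫ φ, W φ) * (G w c M2 x x' * ⟪𝐞 a, 𝐞 b⟫_ℝ)) + 2 * ((∫ φ, W φ) *
      (0 * (G w c M2 x y * ⟪𝐞 i, 𝐞 a⟫_ℝ) * (G w c M2 z x' * ⟪𝐞 i, 𝐞 b⟫_ℝ)
        + 2 * G w c M2 z y * (G w c M2 x y * ⟪𝐞 i, 𝐞 a⟫_ℝ) * (G w c M2 z x' * ⟪𝐞 i, 𝐞 b⟫_ℝ)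
        + 0 * (G w c M2 x' y * ⟪𝐞 i, 𝐞 b⟫_ℝ) * (G w c M2 x z * ⟪𝐞 a, 𝐞 i⟫_ℝ)
        + 2 * G w c M2 z y * (G w c M2 x' y * ⟪𝐞 i, 𝐞 b⟫_ℝ) * (G w c M2 x z * ⟪𝐞 a, 𝐞 i⟫_ℝ))) := by
    intro i
    have I1 : Integrable (fun φ : Cfg P j N => W φ * (cc i i * F φ)) := (hF.const_mul _).integrable C η w c M2 hw hM
    have I2 : Integrable (fun φ : Cfg P j N => W φ * (Z1 i φ * f1 i φ)) :=
      ((hZ1 i).mul (hf1g i)).integrable C η w c M2 hw hM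
    have I3 : Integrable (fun φ : Cfg P j N => W φ * (Q φ * f2 i)) :=
      (hQ.mul (ExpGrowth.const _)).integrable C η w c M2 hw hM
    have e : (fun φ : Cfg P j N => W φ * ((cc i i * F φ + Z1 i φ * f1 i φ) + (Z1 i φ * f1 i φ + Q φ * f2 i)))
        = fun φ => (W φ * (cc i i * F φ) + W φ * (Z1 i φ * f1 i φ)) + (W φ * (Z1 i φ * f1 i φ) + W φ * (Q φ * f2 i)) := by
      funext φ; ring
    have I12 : Integrable (fun φ : Cfg P j N => W φ * (cc i i * F φ) + W φ * (Z1 i φ * f1 i φ)) := I1.add I2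
    have I23 : Integrable (fun φ : Cfg P j N => W φ * (Z1 i φ * f1 i φ) + W φ * (Q φ * f2 i)) := I2.add I3
    rw [e, integral_add I12 I23, integral_add I1 I2, integral_add I2 I3, v1, v2, v3]
    ring
  simp_rw [hterm]
  simp only [hccdef]
  classical
  simp only [inner_basis, mul_ite, ite_mul, mul_one, mul_zero, zero_mul, mul_add,
    Finset.sum_add_distrib, Finset.sum_ite_eq, Finset.sum_ite_eq', Finset.mem_univ, if_true, Finset.sum_const,
    Finset.card_univ, Fintype.card_fin, nsmul_eq_mul]
  by_cases hab : a = b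
  · subst hab
    simp only [if_true]
    rw [G_symm w c M2 x z]
    ring
  · simp only [hab, if_false, Ne.symm hab]
    ring

/-- **THE LOCAL TWO-LOOP KERNEL**: `∫W·:∣φ(y)∣⁴:·:∣φ(z)∣²:·φ_a(x)φ_b(x′) = Z·δ_{ab}·8(N+2)·C(z,y)²·C(x,y)C(x′,y)` — all four legs
of the Wick-ordered quartic vertex at `y` contracted: two into the external legs, two into the two legs of the square at `z` (a loop
`y → z → y`); with the square weighted by `2(N+2)C(z,z)` (the `:∣φ∣²:`-part of the plain vertex at `z`, `norm_four_eq_wick`) this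
is the local two-loop self-energy graph — a tadpole sitting on the loop of a tadpole. [cite: Balaban1983Higgs3, (1.21)–(1.22) p.416]
[cite: GlimmJaffeQP1987, Prop. 8.3.1, Cor. 8.3.2] -/
theorem integral_wick4_wick2_legs (hw : 0 < w) (hM : 0 < M2) (a b : Fin N) (x x' y z : Site P j) :
    ∫ φ, W φ * (wick4 w c M2 y φ * (wick2 w c M2 z φ * (⟪φ x, 𝐞 a⟫_ℝ * ⟪φ x', 𝐞 b⟫_ℝ)))
      = (∫ φ, W φ) * ⟪𝐞 a, 𝐞 b⟫_ℝ * (8 * (N + 2) * G w c M2 z y ^ 2 * (G w c M2 x y * G w c M2 x' y)) := by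
  have hF := expGrowth_legs (P := P) (j := j) a b x x'
  have hf1g : ∀ i, ExpGrowth (fun φ : Cfg P j N =>
      G w c M2 x y * ⟪𝐞 i, 𝐞 a⟫_ℝ * ⟪φ x', 𝐞 b⟫_ℝ + ⟪φ x, 𝐞 a⟫_ℝ * (G w c M2 x' y * ⟪𝐞 i, 𝐞 b⟫_ℝ)) :=
    fun i => (((ExpGrowth.inner_apply x' _).const_mul _)).add ((ExpGrowth.inner_apply x _).mul (ExpGrowth.const _))
  have hQ := expGrowth_wick2 (P := P) (j := j) (N := N) w c M2 z
  have hZ1 : ∀ i, ExpGrowth (fun φ : Cfg P j N => 2 * (G w c M2 z y * ⟪φ z, 𝐞 i⟫_ℝ)) :=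
    fun i => ((ExpGrowth.inner_apply z _).const_mul _).const_mul _
  set F : Cfg P j N → ℝ := fun φ => ⟪φ x, 𝐞 a⟫_ℝ * ⟪φ x', 𝐞 b⟫_ℝ with hFdef
  set f1 : Fin N → Cfg P j N → ℝ := fun i φ =>
    G w c M2 x y * ⟪𝐞 i, 𝐞 a⟫_ℝ * ⟪φ x', 𝐞 b⟫_ℝ + ⟪φ x, 𝐞 a⟫_ℝ * (G w c M2 x' y * ⟪𝐞 i, 𝐞 b⟫_ℝ) with hf1def
  set f2 : Fin N → ℝ := fun i => 2 * (G w c M2 x y * ⟪𝐞 i, 𝐞 a⟫_ℝ) * (G w c M2 x' y * ⟪𝐞 i, 𝐞 b⟫_ℝ) with hf2def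
  set f11 : Fin N → Fin N → ℝ := fun i k =>
    G w c M2 x y * G w c M2 x' y * (⟪𝐞 i, 𝐞 a⟫_ℝ * ⟪𝐞 k, 𝐞 b⟫_ℝ + ⟪𝐞 k, 𝐞 a⟫_ℝ * ⟪𝐞 i, 𝐞 b⟫_ℝ) with hf11def
  set Q : Cfg P j N → ℝ := fun φ => wick2 w c M2 z φ with hQdef
  set Z1 : Fin N → Cfg P j N → ℝ := fun i φ => 2 * (G w c M2 z y * ⟪φ z, 𝐞 i⟫_ℝ) with hZ1def
  set cc : Fin N → Fin N → ℝ := fun i k => 2 * (G w c M2 z y * (G w c M2 z y * ⟪𝐞 k, 𝐞 i⟫_ℝ)) with hccdef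
  have dQ : ∀ i, DerivAlong (hx w c M2 y i) Q (Z1 i) := fun i => derivAlong_wick2 w c M2 y z i
  have dZ1 : ∀ i k, DerivAlong (hx w c M2 y k) (Z1 i) (fun _ => cc i k) := fun i k => derivAlong_wick2' w c M2 y z i k
  have dF : ∀ i, DerivAlong (hx w c M2 y i) F (f1 i) := fun i => derivAlong_legs w c M2 a b x x' y i
  have df1 : ∀ i, DerivAlong (hx w c M2 y i) (f1 i) (fun _ => f2 i) := fun i => derivAlong_legs' w c M2 a b x x' y i
  have df1k : ∀ i k, DerivAlong (hx w c M2 y k) (f1 i) (fun _ => f11 i k) :=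
    fun i k => derivAlong_legs_cross w c M2 a b x x' y i k
  have key := integral_wick4_mul C η w c M2 hw hM y (R := fun φ : Cfg P j N => Q φ * F φ)
    (R₁ := fun i φ => Z1 i φ * F φ + Q φ * f1 i φ)
    (R₂ := fun i φ => (cc i i * F φ + Z1 i φ * f1 i φ) + (Z1 i φ * f1 i φ + Q φ * f2 i))
    (R₃ := fun i k φ => ((0 * F φ + cc i i * f1 k φ) + (cc i k * f1 i φ + Z1 i φ * f11 i k))
      + ((cc i k * f1 i φ + Z1 i φ * f11 i k) + (Z1 k φ * f2 i + Q φ * 0)))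
    (R₄ := fun i k φ => (((0 * F φ + 0 * f1 k φ) + (0 * f1 k φ + cc i i * f2 k))
        + ((0 * f1 i φ + cc i k * f11 i k) + (cc i k * f11 i k + Z1 i φ * 0)))
      + (((0 * f1 i φ + cc i k * f11 i k) + (cc i k * f11 i k + Z1 i φ * 0))
        + ((cc k k * f2 i + Z1 k φ * 0) + (Z1 k φ * 0 + Q φ * 0))))
    (hQ.mul hF) (fun i => ((hZ1 i).mul hF).add (hQ.mul (hf1g i)))
    (fun i => (((ExpGrowth.const _).mul hF).add ((hZ1 i).mul (hf1g i))).add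
      (((hZ1 i).mul (hf1g i)).add (hQ.mul (ExpGrowth.const _))))
    (fun i k => ((((ExpGrowth.const _).mul hF).add ((ExpGrowth.const _).mul (hf1g k))).add
      (((ExpGrowth.const _).mul (hf1g i)).add ((hZ1 i).mul (ExpGrowth.const _)))).add
      ((((ExpGrowth.const _).mul (hf1g i)).add ((hZ1 i).mul (ExpGrowth.const _))).add
      (((hZ1 k).mul (ExpGrowth.const _)).add (hQ.mul (ExpGrowth.const _)))))
    (fun i k => (((((ExpGrowth.const _).mul hF).add ((ExpGrowth.const _).mul (hf1g k))).add
      (((ExpGrowth.const _).mul (hf1g k)).add ((ExpGrowth.const _).mul (ExpGrowth.const _)))).add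
      ((((ExpGrowth.const _).mul (hf1g i)).add ((ExpGrowth.const _).mul (ExpGrowth.const _))).add
      (((ExpGrowth.const _).mul (ExpGrowth.const _)).add ((hZ1 i).mul (ExpGrowth.const _))))).add
      (((((ExpGrowth.const _).mul (hf1g i)).add ((ExpGrowth.const _).mul (ExpGrowth.const _))).add
      (((ExpGrowth.const _).mul (ExpGrowth.const _)).add ((hZ1 i).mul (ExpGrowth.const _)))).add
      ((((ExpGrowth.const _).mul (ExpGrowth.const _)).add ((hZ1 k).mul (ExpGrowth.const _))).add
      (((hZ1 k).mul (ExpGrowth.const _)).add (hQ.mul (ExpGrowth.const _))))))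
    (fun i => (dQ i).mul (dF i))
    (fun i => ((dZ1 i i).mul (dF i)).add ((dQ i).mul (df1 i)))
    (fun i k => (((DerivAlong.const _ _).mul (dF k)).add ((dZ1 i k).mul (df1k i k))).add
      (((dZ1 i k).mul (df1k i k)).add ((dQ k).mul (DerivAlong.const _ _))))
    (fun i k => ((((DerivAlong.const _ _).mul (dF k)).add ((DerivAlong.const _ _).mul (df1 k))).add
      (((DerivAlong.const _ _).mul (df1k i k)).add ((dZ1 i k).mul (DerivAlong.const _ _)))).add
      ((((DerivAlong.const _ _).mul (df1k i k)).add ((dZ1 i k).mul (DerivAlong.const _ _))).add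
      (((dZ1 k k).mul (DerivAlong.const _ _)).add ((dQ k).mul (DerivAlong.const _ _)))))
  rw [show (∫ φ, W φ * (wick4 w c M2 y φ * (wick2 w c M2 z φ * (⟪φ x, 𝐞 a⟫_ℝ * ⟪φ x', 𝐞 b⟫_ℝ))))
      = ∫ φ, W φ * (wick4 w c M2 y φ * (Q φ * F φ)) from rfl, key]
  -- the fourth contraction is a constant
  have hterm : ∀ i k, ∫ φ, W φ * ((((0 * F φ + 0 * f1 k φ) + (0 * f1 k φ + cc i i * f2 k))
        + ((0 * f1 i φ + cc i k * f11 i k) + (cc i k * f11 i k + Z1 i φ * 0)))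
      + (((0 * f1 i φ + cc i k * f11 i k) + (cc i k * f11 i k + Z1 i φ * 0))
        + ((cc k k * f2 i + Z1 k φ * 0) + (Z1 k φ * 0 + Q φ * 0))))
      = (∫ φ, W φ) * (cc i i * f2 k + 4 * (cc i k * f11 i k) + cc k k * f2 i) := by
    intro i k
    have e : (fun φ : Cfg P j N => W φ * ((((0 * F φ + 0 * f1 k φ) + (0 * f1 k φ + cc i i * f2 k))
        + ((0 * f1 i φ + cc i k * f11 i k) + (cc i k * f11 i k + Z1 i φ * 0)))
      + (((0 * f1 i φ + cc i k * f11 i k) + (cc i k * f11 i k + Z1 i φ * 0))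
        + ((cc k k * f2 i + Z1 k φ * 0) + (Z1 k φ * 0 + Q φ * 0)))))
        = fun φ => W φ * (cc i i * f2 k + 4 * (cc i k * f11 i k) + cc k k * f2 i) := by
      funext φ; ring
    rw [e, integral_mul_const]
  simp_rw [hterm]
  rw [show (∑ i : Fin N, ∑ k : Fin N, (∫ φ, W φ) * (cc i i * f2 k + 4 * (cc i k * f11 i k) + cc k k * f2 i))
      = (∫ φ, W φ) * ∑ i : Fin N, ∑ k : Fin N, (cc i i * f2 k + 4 * (cc i k * f11 i k) + cc k k * f2 i) from by
    rw [Finset.mul_sum]; exact Finset.sum_congr rfl fun i _ => by rw [Finset.mul_sum]]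
  simp only [hccdef, hf2def, hf11def]
  classical
  simp only [inner_basis, mul_ite, ite_mul, mul_one, mul_zero, zero_mul, mul_add, add_mul,
    Finset.sum_add_distrib, Finset.sum_ite_irrel, Finset.sum_const_zero, Finset.sum_ite_eq',
    Finset.mem_univ, if_true, Finset.sum_const, Finset.card_univ, Fintype.card_fin, nsmul_eq_mul]
  by_cases hab : a = b
  · subst hab
    simp only [if_true]
    ring
  · simp only [hab, if_false, Ne.symm hab, add_zero]

/-- linearity of the Gaussian integral on three observables of exponential-linear growth (bookkeeping helper).
[cite: GlimmJaffeQP1987, §8.3] -/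
theorem integral_W_lin3 (hw : 0 < w) (hM : 0 < M2) {g₁ g₂ g₃ : Cfg P j N → ℝ} (h₁ : ExpGrowth g₁) (h₂ : ExpGrowth g₂)
    (h₃ : ExpGrowth g₃) (c₁ c₂ c₃ : ℝ) :
    ∫ φ, W φ * (c₁ * g₁ φ + c₂ * g₂ φ + c₃ * g₃ φ)
      = c₁ * (∫ φ, W φ * g₁ φ) + c₂ * (∫ φ, W φ * g₂ φ) + c₃ * (∫ φ, W φ * g₃ φ) := by
  have i₁ := h₁.integrable C η w c M2 hw hM
  have i₂ := h₂.integrable C η w c M2 hw hM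
  have i₃ := h₃.integrable C η w c M2 hw hM
  have e : (fun φ : Cfg P j N => W φ * (c₁ * g₁ φ + c₂ * g₂ φ + c₃ * g₃ φ))
      = fun φ => c₁ * (W φ * g₁ φ) + c₂ * (W φ * g₂ φ) + c₃ * (W φ * g₃ φ) := by
    funext φ; ring
  have j₁ : Integrable (fun φ : Cfg P j N => c₁ * (W φ * g₁ φ)) := i₁.const_mul c₁
  have j₂ : Integrable (fun φ : Cfg P j N => c₂ * (W φ * g₂ φ)) := i₂.const_mul c₂
  have j₃ : Integrable (fun φ : Cfg P j N => c₃ * (W φ * g₃ φ)) := i₃.const_mul c₃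
  have j₁₂ : Integrable (fun φ : Cfg P j N => c₁ * (W φ * g₁ φ) + c₂ * (W φ * g₂ φ)) := j₁.add j₂
  rw [e, integral_add j₁₂ j₃, integral_add j₁ j₂, integral_const_mul, integral_const_mul, integral_const_mul]

/-- `∫W·:∣φ(y)∣⁴:·:∣φ(z)∣²: = 0` — the quartic Wick vertex cannot absorb only two legs. [cite: GlimmJaffeQP1987, Cor. 8.3.2] -/
theorem integral_wick4_wick2 (hw : 0 < w) (hM : 0 < M2) (y z : Site P j) :
    ∫ φ, W φ * (wick4 w c M2 y φ * wick2 w c M2 z φ) = 0 :=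
  integral_wick4_mul_of_deg2 C η w c M2 hw hM y (expGrowth_wick2 w c M2 z)
    (fun _ => ((ExpGrowth.inner_apply z _).const_mul _).const_mul _) (fun _ => ExpGrowth.const _)
    (fun i => derivAlong_wick2 w c M2 y z i) (fun i => derivAlong_wick2' w c M2 y z i i)
    (fun _ _ => DerivAlong.const _ _)

/-- **TWO PLAIN QUARTIC VERTICES AGAINST THE TWO LEGS** (`norm_four_eq_wick` at both vertices, then §9/§11's kernels):
`∫W∣φ(y)∣⁴∣φ(z)∣⁴φ_a(x)φ_b(x′) = Z·δ_{ab}·[…]` with, writing `α_v = 2(N+2)C(v,v)`, `β_v = N(N+2)C(v,v)²`: the basketball × free line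
and the sunset (from `:φ⁴::φ⁴:`), `α_z`× the two-loop kernel and `α_y`× its mirror, `α_yα_z`×(bubble × free line + chain),
`2α_yβ_z C(x,y)C(x′,y)` and `2β_yα_z C(x,z)C(x′,z)` (a tadpole insertion times the other vertex's vacuum double self-line) and
`β_yβ_zC(x,x′)`. [cite: Balaban1983Higgs3, (1.21)–(1.22) p.416] [cite: GlimmJaffeQP1987, Prop. 8.3.1] -/
theorem integral_norm4_norm4_legs (hw : 0 < w) (hM : 0 < M2) (a b : Fin N) (x x' y z : Site P j) :
    ∫ φ, W φ * (‖φ y‖ ^ 4 * (‖φ z‖ ^ 4 * (⟪φ x, 𝐞 a⟫_ℝ * ⟪φ x', 𝐞 b⟫_ℝ)))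
      = (∫ φ, W φ) * ⟪𝐞 a, 𝐞 b⟫_ℝ *
        ((8 * (N * (N + 2)) * G w c M2 z y ^ 4 * G w c M2 x x'
            + 4 ^ 2 * (2 * N + 4) * G w c M2 z y ^ 3 * (G w c M2 x y * G w c M2 z x' + G w c M2 x' y * G w c M2 z x))
          + 2 * (N + 2) * G w c M2 z z * (8 * (N + 2) * G w c M2 z y ^ 2 * (G w c M2 x y * G w c M2 x' y))
          + 2 * (N + 2) * G w c M2 y y *
            (8 * (N + 2) * G w c M2 y z ^ 2 * (G w c M2 x z * G w c M2 x' z)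
              + 2 * (N + 2) * G w c M2 z z * (2 * N * G w c M2 z y ^ 2 * G w c M2 x x'
                + 4 * G w c M2 z y * (G w c M2 x y * G w c M2 z x' + G w c M2 x' y * G w c M2 z x))
              + N * (N + 2) * G w c M2 z z ^ 2 * (2 * (G w c M2 x y * G w c M2 x' y)))
          + N * (N + 2) * G w c M2 y y ^ 2 *
            (N * (N + 2) * G w c M2 z z ^ 2 * G w c M2 x x' + 4 * (N + 2) * G w c M2 z z * (G w c M2 x z * G w c M2 x' z))) := by
  have hF := expGrowth_legs (P := P) (j := j) a b x x'
  have h4y := expGrowth_wick4 (P := P) (j := j) (N := N) w c M2 y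
  have h4z := expGrowth_wick4 (P := P) (j := j) (N := N) w c M2 z
  have h2y := expGrowth_wick2 (P := P) (j := j) (N := N) w c M2 y
  have h2z := expGrowth_wick2 (P := P) (j := j) (N := N) w c M2 z
  have hn4z : ExpGrowth (fun φ : Cfg P j N => ‖φ z‖ ^ 4) := by
    have e : (fun φ : Cfg P j N => ‖φ z‖ ^ 4) = fun φ => ‖φ z‖ ^ 2 * ‖φ z‖ ^ 2 := by funext φ; ring
    rw [e]; exact (ExpGrowth.norm_sq_apply z).mul (ExpGrowth.norm_sq_apply z)
  -- level A: expand the vertex at `y`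
  have eA : (fun φ : Cfg P j N => W φ * (‖φ y‖ ^ 4 * (‖φ z‖ ^ 4 * (⟪φ x, 𝐞 a⟫_ℝ * ⟪φ x', 𝐞 b⟫_ℝ))))
      = fun φ => W φ * (1 * (wick4 w c M2 y φ * (‖φ z‖ ^ 4 * (⟪φ x, 𝐞 a⟫_ℝ * ⟪φ x', 𝐞 b⟫_ℝ)))
        + 2 * (N + 2) * G w c M2 y y * (wick2 w c M2 y φ * (‖φ z‖ ^ 4 * (⟪φ x, 𝐞 a⟫_ℝ * ⟪φ x', 𝐞 b⟫_ℝ)))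
        + N * (N + 2) * G w c M2 y y ^ 2 * (‖φ z‖ ^ 4 * (⟪φ x, 𝐞 a⟫_ℝ * ⟪φ x', 𝐞 b⟫_ℝ))) := by
    funext φ; rw [norm_four_eq_wick w c M2 y φ]; ring
  rw [show (∫ φ, W φ * (‖φ y‖ ^ 4 * (‖φ z‖ ^ 4 * (⟪φ x, 𝐞 a⟫_ℝ * ⟪φ x', 𝐞 b⟫_ℝ))))
      = ∫ φ, (fun φ : Cfg P j N => W φ * (‖φ y‖ ^ 4 * (‖φ z‖ ^ 4 * (⟪φ x, 𝐞 a⟫_ℝ * ⟪φ x', 𝐞 b⟫_ℝ)))) φ from rfl,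
    eA, integral_W_lin3 C η w c M2 hw hM (h4y.mul (hn4z.mul hF)) (h2y.mul (hn4z.mul hF)) (hn4z.mul hF)]
  -- level B: expand the vertex at `z` inside the two Wick-ordered pieces
  have eB1 : (fun φ : Cfg P j N => W φ * (wick4 w c M2 y φ * (‖φ z‖ ^ 4 * (⟪φ x, 𝐞 a⟫_ℝ * ⟪φ x', 𝐞 b⟫_ℝ))))
      = fun φ => W φ * (1 * (wick4 w c M2 y φ * (wick4 w c M2 z φ * (⟪φ x, 𝐞 a⟫_ℝ * ⟪φ x', 𝐞 b⟫_ℝ)))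
        + 2 * (N + 2) * G w c M2 z z * (wick4 w c M2 y φ * (wick2 w c M2 z φ * (⟪φ x, 𝐞 a⟫_ℝ * ⟪φ x', 𝐞 b⟫_ℝ)))
        + N * (N + 2) * G w c M2 z z ^ 2 * (wick4 w c M2 y φ * (⟪φ x, 𝐞 a⟫_ℝ * ⟪φ x', 𝐞 b⟫_ℝ))) := by
    funext φ; rw [norm_four_eq_wick w c M2 z φ]; ring
  have eB2 : (fun φ : Cfg P j N => W φ * (wick2 w c M2 y φ * (‖φ z‖ ^ 4 * (⟪φ x, 𝐞 a⟫_ℝ * ⟪φ x', 𝐞 b⟫_ℝ))))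
      = fun φ => W φ * (1 * (wick4 w c M2 z φ * (wick2 w c M2 y φ * (⟪φ x, 𝐞 a⟫_ℝ * ⟪φ x', 𝐞 b⟫_ℝ)))
        + 2 * (N + 2) * G w c M2 z z * (wick2 w c M2 y φ * (wick2 w c M2 z φ * (⟪φ x, 𝐞 a⟫_ℝ * ⟪φ x', 𝐞 b⟫_ℝ)))
        + N * (N + 2) * G w c M2 z z ^ 2 * (wick2 w c M2 y φ * (⟪φ x, 𝐞 a⟫_ℝ * ⟪φ x', 𝐞 b⟫_ℝ))) := by
    funext φ; rw [norm_four_eq_wick w c M2 z φ]; ring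
  rw [show (∫ φ, W φ * (wick4 w c M2 y φ * (‖φ z‖ ^ 4 * (⟪φ x, 𝐞 a⟫_ℝ * ⟪φ x', 𝐞 b⟫_ℝ))))
      = ∫ φ, (fun φ : Cfg P j N => W φ * (wick4 w c M2 y φ * (‖φ z‖ ^ 4 * (⟪φ x, 𝐞 a⟫_ℝ * ⟪φ x', 𝐞 b⟫_ℝ)))) φ
      from rfl, eB1,
    integral_W_lin3 C η w c M2 hw hM (h4y.mul (h4z.mul hF)) (h4y.mul (h2z.mul hF)) (h4y.mul hF),
    show (∫ φ, W φ * (wick2 w c M2 y φ * (‖φ z‖ ^ 4 * (⟪φ x, 𝐞 a⟫_ℝ * ⟪φ x', 𝐞 b⟫_ℝ))))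
      = ∫ φ, (fun φ : Cfg P j N => W φ * (wick2 w c M2 y φ * (‖φ z‖ ^ 4 * (⟪φ x, 𝐞 a⟫_ℝ * ⟪φ x', 𝐞 b⟫_ℝ)))) φ
      from rfl, eB2,
    integral_W_lin3 C η w c M2 hw hM (h4z.mul (h2y.mul hF)) (h2y.mul (h2z.mul hF)) (h2y.mul hF),
    integral_wick4_wick4_legs C η w c M2 hw hM a b x x' y z, integral_wick4_wick2_legs C η w c M2 hw hM a b x x' y z,
    integral_wick4_legs C η w c M2 hw hM a b x x' y, integral_wick4_wick2_legs C η w c M2 hw hM a b x x' z y,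
    integral_wick2_wick2_legs C η w c M2 hw hM a b x x' y z, integral_wick2_legs C η w c M2 hw hM a b x x' y,
    integral_norm_four_mul_legs C η w c M2 hw hM a b x x' z]
  ring

/-- two plain quartic vertices in the vacuum: `∫W∣φ(y)∣⁴∣φ(z)∣⁴ = Z·[8N(N+2)C(z,y)⁴ + α_yα_z·2N·C(z,y)² + β_yβ_z]` (basketball,
bubble with two tadpole factors, and the disconnected double self-lines). [cite: GlimmJaffeQP1987, Prop. 8.3.1] -/
theorem integral_norm4_norm4 (hw : 0 < w) (hM : 0 < M2) (y z : Site P j) :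
    ∫ φ, W φ * (‖φ y‖ ^ 4 * ‖φ z‖ ^ 4)
      = (∫ φ, W φ) * (8 * (N * (N + 2)) * G w c M2 z y ^ 4
          + 2 * (N + 2) * G w c M2 y y * (2 * (N + 2) * G w c M2 z z) * (2 * N * G w c M2 z y ^ 2)
          + N * (N + 2) * G w c M2 y y ^ 2 * (N * (N + 2) * G w c M2 z z ^ 2)) := by
  have h4y := expGrowth_wick4 (P := P) (j := j) (N := N) w c M2 y
  have h4z := expGrowth_wick4 (P := P) (j := j) (N := N) w c M2 z
  have h2y := expGrowth_wick2 (P := P) (j := j) (N := N) w c M2 y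
  have h2z := expGrowth_wick2 (P := P) (j := j) (N := N) w c M2 z
  have hn4z : ExpGrowth (fun φ : Cfg P j N => ‖φ z‖ ^ 4) := by
    have e : (fun φ : Cfg P j N => ‖φ z‖ ^ 4) = fun φ => ‖φ z‖ ^ 2 * ‖φ z‖ ^ 2 := by funext φ; ring
    rw [e]; exact (ExpGrowth.norm_sq_apply z).mul (ExpGrowth.norm_sq_apply z)
  have eA : (fun φ : Cfg P j N => W φ * (‖φ y‖ ^ 4 * ‖φ z‖ ^ 4))
      = fun φ => W φ * (1 * (wick4 w c M2 y φ * ‖φ z‖ ^ 4) + 2 * (N + 2) * G w c M2 y y * (wick2 w c M2 y φ * ‖φ z‖ ^ 4)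
        + N * (N + 2) * G w c M2 y y ^ 2 * ‖φ z‖ ^ 4) := by
    funext φ; rw [norm_four_eq_wick w c M2 y φ]; ring
  have eB1 : (fun φ : Cfg P j N => W φ * (wick4 w c M2 y φ * ‖φ z‖ ^ 4))
      = fun φ => W φ * (1 * (wick4 w c M2 y φ * wick4 w c M2 z φ)
        + 2 * (N + 2) * G w c M2 z z * (wick4 w c M2 y φ * wick2 w c M2 z φ)
        + N * (N + 2) * G w c M2 z z ^ 2 * wick4 w c M2 y φ) := by
    funext φ; rw [norm_four_eq_wick w c M2 z φ]; ring
  have eB2 : (fun φ : Cfg P j N => W φ * (wick2 w c M2 y φ * ‖φ z‖ ^ 4))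
      = fun φ => W φ * (1 * (wick4 w c M2 z φ * wick2 w c M2 y φ)
        + 2 * (N + 2) * G w c M2 z z * (wick2 w c M2 y φ * wick2 w c M2 z φ)
        + N * (N + 2) * G w c M2 z z ^ 2 * wick2 w c M2 y φ) := by
    funext φ; rw [norm_four_eq_wick w c M2 z φ]; ring
  rw [show (∫ φ, W φ * (‖φ y‖ ^ 4 * ‖φ z‖ ^ 4)) = ∫ φ, (fun φ : Cfg P j N => W φ * (‖φ y‖ ^ 4 * ‖φ z‖ ^ 4)) φ from rfl,
    eA, integral_W_lin3 C η w c M2 hw hM (h4y.mul hn4z) (h2y.mul hn4z) hn4z,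
    show (∫ φ, W φ * (wick4 w c M2 y φ * ‖φ z‖ ^ 4)) = ∫ φ, (fun φ : Cfg P j N => W φ * (wick4 w c M2 y φ * ‖φ z‖ ^ 4)) φ
      from rfl, eB1, integral_W_lin3 C η w c M2 hw hM (h4y.mul h4z) (h4y.mul h2z) h4y,
    show (∫ φ, W φ * (wick2 w c M2 y φ * ‖φ z‖ ^ 4)) = ∫ φ, (fun φ : Cfg P j N => W φ * (wick2 w c M2 y φ * ‖φ z‖ ^ 4)) φ
      from rfl, eB2, integral_W_lin3 C η w c M2 hw hM (h4z.mul h2y) (h2y.mul h2z) h2y,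
    integral_wick4_wick4 C η w c M2 hw hM y z, integral_wick4_wick2 C η w c M2 hw hM y z, integral_wick4 C η w c M2 hw hM y,
    integral_wick4_wick2 C η w c M2 hw hM z y, integral_wick2_wick2 C η w c M2 hw hM y z, integral_wick2 C η w c M2 hw hM y,
    integral_norm_four C η w c M2 hw hM z]
  ring

/-- `∫W·V²·φ_a(x)φ_b(x′)` for the plain interaction `V = Σ_yη^d∣φ(y)∣⁴`, organised by graph: free line × basketballs, the
connected 1PI + chain part `D₃` (sunset ⑥ + two-loop local graph, both placements, + chain with its tadpole factors), free line ×
bubbles, tadpole × vacuum double self-line (both placements), free line × (double self-line)². [cite: Balaban1983Higgs3, (1.21)–(1.22) p.416] -/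
theorem integral_V_sq_legs (hw : 0 < w) (hM : 0 < M2) (a b : Fin N) (x x' : Site P j) :
    ∫ φ, W φ * ((∑ y : Site P j, w * ‖φ y‖ ^ 4) ^ 2 * (⟪φ x, 𝐞 a⟫_ℝ * ⟪φ x', 𝐞 b⟫_ℝ))
      = (∫ φ, W φ) * ⟪𝐞 a, 𝐞 b⟫_ℝ *
        (G w c M2 x x' * (∑ y : Site P j, ∑ z : Site P j, w * w * (8 * (N * (N + 2)) * G w c M2 z y ^ 4))
          + (∑ y : Site P j, ∑ z : Site P j, w * w *
              (4 ^ 2 * (2 * N + 4) * G w c M2 z y ^ 3 * (G w c M2 x y * G w c M2 z x' + G w c M2 x' y * G w c M2 z x)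
                + 2 * (N + 2) * G w c M2 z z * (8 * (N + 2) * G w c M2 z y ^ 2 * (G w c M2 x y * G w c M2 x' y))
                + 2 * (N + 2) * G w c M2 y y * (8 * (N + 2) * G w c M2 y z ^ 2 * (G w c M2 x z * G w c M2 x' z))
                + 2 * (N + 2) * G w c M2 y y * (2 * (N + 2) * G w c M2 z z)
                  * (4 * G w c M2 z y * (G w c M2 x y * G w c M2 z x' + G w c M2 x' y * G w c M2 z x))))
          + G w c M2 x x' * (∑ y : Site P j, ∑ z : Site P j, w * w *
              (2 * (N + 2) * G w c M2 y y * (2 * (N + 2) * G w c M2 z z) * (2 * N * G w c M2 z y ^ 2)))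
          + 2 * (∑ y : Site P j, ∑ z : Site P j, w * w *
              (2 * (N + 2) * G w c M2 y y * (N * (N + 2) * G w c M2 z z ^ 2) * (G w c M2 x y * G w c M2 x' y)))
          + G w c M2 x x' * (∑ y : Site P j, ∑ z : Site P j, w * w *
              (N * (N + 2) * G w c M2 y y ^ 2 * (N * (N + 2) * G w c M2 z z ^ 2)))
          + 2 * (∑ y : Site P j, ∑ z : Site P j, w * w *
              (N * (N + 2) * G w c M2 y y ^ 2 * (2 * (N + 2) * G w c M2 z z) * (G w c M2 x z * G w c M2 x' z)))) := by
  have hn4 : ∀ v : Site P j, ExpGrowth (fun φ : Cfg P j N => ‖φ v‖ ^ 4) := fun v => by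
    have e : (fun φ : Cfg P j N => ‖φ v‖ ^ 4) = fun φ => ‖φ v‖ ^ 2 * ‖φ v‖ ^ 2 := by funext φ; ring
    rw [e]; exact (ExpGrowth.norm_sq_apply v).mul (ExpGrowth.norm_sq_apply v)
  have hi : ∀ y z : Site P j, Integrable (fun φ : Cfg P j N =>
      W φ * (w * w * (‖φ y‖ ^ 4 * (‖φ z‖ ^ 4 * (⟪φ x, 𝐞 a⟫_ℝ * ⟪φ x', 𝐞 b⟫_ℝ))))) :=
    fun y z => (((hn4 y).mul ((hn4 z).mul (expGrowth_legs a b x x'))).const_mul (w * w)).integrable C η w c M2 hw hM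
  have e1 : (fun φ : Cfg P j N => W φ * ((∑ y : Site P j, w * ‖φ y‖ ^ 4) ^ 2 * (⟪φ x, 𝐞 a⟫_ℝ * ⟪φ x', 𝐞 b⟫_ℝ)))
      = fun φ => ∑ y : Site P j, ∑ z : Site P j,
          W φ * (w * w * (‖φ y‖ ^ 4 * (‖φ z‖ ^ 4 * (⟪φ x, 𝐞 a⟫_ℝ * ⟪φ x', 𝐞 b⟫_ℝ)))) := by
    funext φ
    rw [sq, Finset.sum_mul_sum, Finset.sum_mul, Finset.mul_sum]
    refine Finset.sum_congr rfl fun y _ => ?_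
    rw [Finset.sum_mul, Finset.mul_sum]
    exact Finset.sum_congr rfl fun z _ => by ring
  have e2 : ∀ y z : Site P j,
      (∫ φ, W φ * (w * w * (‖φ y‖ ^ 4 * (‖φ z‖ ^ 4 * (⟪φ x, 𝐞 a⟫_ℝ * ⟪φ x', 𝐞 b⟫_ℝ)))))
        = (w * w) * ∫ φ, W φ * (‖φ y‖ ^ 4 * (‖φ z‖ ^ 4 * (⟪φ x, 𝐞 a⟫_ℝ * ⟪φ x', 𝐞 b⟫_ℝ))) := by
    intro y z
    rw [← integral_const_mul]
    exact integral_congr_ae (Filter.Eventually.of_forall fun φ => by ring)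
  rw [e1, integral_finsetSum _ (fun y _ => integrable_finsetSum _ fun z _ => hi y z)]
  simp_rw [integral_finsetSum _ (fun z _ => hi _ z), e2, integral_norm4_norm4_legs C η w c M2 hw hM a b x x']
  simp only [Finset.mul_sum, mul_add, ← Finset.sum_add_distrib]
  exact Finset.sum_congr rfl fun y _ => Finset.sum_congr rfl fun z _ => by ring

/-- `∫W·V²` for `V = Σ_yη^d∣φ(y)∣⁴`: basketballs + bubbles with tadpole factors + (double self-line)². [cite: GlimmJaffeQP1987, §8.3] -/
theorem integral_V_sq (hw : 0 < w) (hM : 0 < M2) :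
    ∫ φ, W φ * (∑ y : Site P j, w * ‖φ y‖ ^ 4) ^ 2
      = (∫ φ, W φ) *
        ((∑ y : Site P j, ∑ z : Site P j, w * w * (8 * (N * (N + 2)) * G w c M2 z y ^ 4))
          + (∑ y : Site P j, ∑ z : Site P j, w * w *
              (2 * (N + 2) * G w c M2 y y * (2 * (N + 2) * G w c M2 z z) * (2 * N * G w c M2 z y ^ 2)))
          + (∑ y : Site P j, ∑ z : Site P j, w * w *
              (N * (N + 2) * G w c M2 y y ^ 2 * (N * (N + 2) * G w c M2 z z ^ 2)))) := by
  have hn4 : ∀ v : Site P j, ExpGrowth (fun φ : Cfg P j N => ‖φ v‖ ^ 4) := fun v => by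
    have e : (fun φ : Cfg P j N => ‖φ v‖ ^ 4) = fun φ => ‖φ v‖ ^ 2 * ‖φ v‖ ^ 2 := by funext φ; ring
    rw [e]; exact (ExpGrowth.norm_sq_apply v).mul (ExpGrowth.norm_sq_apply v)
  have hi : ∀ y z : Site P j, Integrable (fun φ : Cfg P j N => W φ * (w * w * (‖φ y‖ ^ 4 * ‖φ z‖ ^ 4))) :=
    fun y z => (((hn4 y).mul (hn4 z)).const_mul (w * w)).integrable C η w c M2 hw hM
  have e1 : (fun φ : Cfg P j N => W φ * (∑ y : Site P j, w * ‖φ y‖ ^ 4) ^ 2)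
      = fun φ => ∑ y : Site P j, ∑ z : Site P j, W φ * (w * w * (‖φ y‖ ^ 4 * ‖φ z‖ ^ 4)) := by
    funext φ
    rw [sq, Finset.sum_mul_sum, Finset.mul_sum]
    refine Finset.sum_congr rfl fun y _ => ?_
    rw [Finset.mul_sum]
    exact Finset.sum_congr rfl fun z _ => by ring
  have e2 : ∀ y z : Site P j, (∫ φ, W φ * (w * w * (‖φ y‖ ^ 4 * ‖φ z‖ ^ 4)))
      = (w * w) * ∫ φ, W φ * (‖φ y‖ ^ 4 * ‖φ z‖ ^ 4) := by
    intro y z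
    rw [← integral_const_mul]
    exact integral_congr_ae (Filter.Eventually.of_forall fun φ => by ring)
  rw [e1, integral_finsetSum _ (fun y _ => integrable_finsetSum _ fun z _ => hi y z)]
  simp_rw [integral_finsetSum _ (fun z _ => hi _ z), e2, integral_norm4_norm4 C η w c M2 hw hM]
  simp only [Finset.mul_sum, mul_add, ← Finset.sum_add_distrib]
  exact Finset.sum_congr rfl fun y _ => Finset.sum_congr rfl fun z _ => by ring

/-- **SECOND-ORDER PERTURBATION THEORY FOR THE PLAIN `λ∣φ∣⁴` VERTEX OF (1.20) — THE COMPLETE ORDER-λ² TERM AS GRAPHS.**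
`G″_{ab}(0⁺) = δ_{ab}·Σ_{y,z}η^{2d}·[4²(2N+4)C(z,y)³(C(x,y)C(z,x′)+C(x′,y)C(z,x))` (the SUNSET ⑥)
` + 2(N+2)C(z,z)·8(N+2)C(z,y)²C(x,y)C(x′,y) + (y ↔ z)` (the LOCAL TWO-LOOP self-energy graph: a tadpole on the loop of a tadpole —
one of the *"…"* of (1.22), amputated and one-particle irreducible, mass-type)
` + 2(N+2)C(y,y)·2(N+2)C(z,z)·4C(z,y)(C(x,y)C(z,x′)+C(x′,y)C(z,x))]` (the CHAIN of two tadpoles ① — one-particle REDUCIBLE, the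
`n = 2` term of (1.21): `λ²/2!·(chain) = dysonTerm (η^dC₀) (η^d·sig1) 2`): every disconnected (vacuum × …) contribution of §7's
four Gaussian moments CANCELS (`integral_V_sq_legs`, `integral_V_sq`, §2–§3), as the linked-cluster theorem dictates.
[cite: Balaban1983Higgs3, (1.21)–(1.22) p.416] [cite: GlimmJaffeQP1987, §8.4–8.5] -/
theorem hasDerivWithinAt_firstDeriv_twoPointPhi4_graphs (hw : 0 < w) (hM : 0 < M2) (a b : Fin N) (x x' : Site P j) :
    HasDerivWithinAt
      (fun lam : ℝ =>
        ((-(∫ φ, W φ * (Real.exp (-(lam * ∑ y : Site P j, w * ‖φ y‖ ^ 4))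
              * ((∑ y : Site P j, w * ‖φ y‖ ^ 4) * (⟪φ x, 𝐞 a⟫_ℝ * ⟪φ x', 𝐞 b⟫_ℝ)))))
            * (∫ φ, W φ * (Real.exp (-(lam * ∑ y : Site P j, w * ‖φ y‖ ^ 4)) * 1))
          + (∫ φ, W φ * (Real.exp (-(lam * ∑ y : Site P j, w * ‖φ y‖ ^ 4)) * (⟪φ x, 𝐞 a⟫_ℝ * ⟪φ x', 𝐞 b⟫_ℝ)))
            * (∫ φ, W φ * (Real.exp (-(lam * ∑ y : Site P j, w * ‖φ y‖ ^ 4))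
                * ((∑ y : Site P j, w * ‖φ y‖ ^ 4) * 1))))
          / (∫ φ, W φ * (Real.exp (-(lam * ∑ y : Site P j, w * ‖φ y‖ ^ 4)) * 1)) ^ 2)
      (⟪𝐞 a, 𝐞 b⟫_ℝ * ∑ y : Site P j, ∑ z : Site P j, w * w *
          (4 ^ 2 * (2 * N + 4) * G w c M2 z y ^ 3 * (G w c M2 x y * G w c M2 z x' + G w c M2 x' y * G w c M2 z x)
            + 2 * (N + 2) * G w c M2 z z * (8 * (N + 2) * G w c M2 z y ^ 2 * (G w c M2 x y * G w c M2 x' y))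
            + 2 * (N + 2) * G w c M2 y y * (8 * (N + 2) * G w c M2 y z ^ 2 * (G w c M2 x z * G w c M2 x' z))
            + 2 * (N + 2) * G w c M2 y y * (2 * (N + 2) * G w c M2 z z)
              * (4 * G w c M2 z y * (G w c M2 x y * G w c M2 z x' + G w c M2 x' y * G w c M2 z x))))
      (Set.Ici 0) 0 := by
  have h := hasDerivWithinAt_firstDeriv_twoPointPhi4 C η w c M2 hw hM a b x x'
  refine h.congr_deriv ?_
  rw [integral_V_sq_legs C η w c M2 hw hM a b x x', integral_legs C η w c M2 hw hM a b x x',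
    integral_V_sq C η w c M2 hw hM, integral_V C η w c M2 hw hM, integral_V_mul_legs C η w c M2 hw hM a b x x']
  set Z : ℝ := ∫ φ, W φ with hZdef
  set dab : ℝ := ⟪𝐞 a, 𝐞 b⟫_ℝ with hdab
  set g : ℝ := G w c M2 x x' with hg
  set A : ℝ := ∑ y : Site P j, ∑ z : Site P j, w * w * (8 * (N * (N + 2)) * G w c M2 z y ^ 4) with hA
  set D3 : ℝ := ∑ y : Site P j, ∑ z : Site P j, w * w *
      (4 ^ 2 * (2 * N + 4) * G w c M2 z y ^ 3 * (G w c M2 x y * G w c M2 z x' + G w c M2 x' y * G w c M2 z x)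
        + 2 * (N + 2) * G w c M2 z z * (8 * (N + 2) * G w c M2 z y ^ 2 * (G w c M2 x y * G w c M2 x' y))
        + 2 * (N + 2) * G w c M2 y y * (8 * (N + 2) * G w c M2 y z ^ 2 * (G w c M2 x z * G w c M2 x' z))
        + 2 * (N + 2) * G w c M2 y y * (2 * (N + 2) * G w c M2 z z)
          * (4 * G w c M2 z y * (G w c M2 x y * G w c M2 z x' + G w c M2 x' y * G w c M2 z x))) with hD3
  set Bb : ℝ := ∑ y : Site P j, ∑ z : Site P j, w * w *
      (2 * (N + 2) * G w c M2 y y * (2 * (N + 2) * G w c M2 z z) * (2 * N * G w c M2 z y ^ 2)) with hBb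
  set Aab : ℝ := ∑ y : Site P j, ∑ z : Site P j, w * w *
      (2 * (N + 2) * G w c M2 y y * (N * (N + 2) * G w c M2 z z ^ 2) * (G w c M2 x y * G w c M2 x' y)) with hAab
  set Bβ : ℝ := ∑ y : Site P j, ∑ z : Site P j, w * w *
      (N * (N + 2) * G w c M2 y y ^ 2 * (N * (N + 2) * G w c M2 z z ^ 2)) with hBβ
  set Aβa : ℝ := ∑ y : Site P j, ∑ z : Site P j, w * w *
      (N * (N + 2) * G w c M2 y y ^ 2 * (2 * (N + 2) * G w c M2 z z) * (G w c M2 x z * G w c M2 x' z)) with hAβa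
  set sβ : ℝ := ∑ y : Site P j, w * (N * (N + 2) * G w c M2 y y ^ 2) with hsβ
  set s2 : ℝ := ∑ y : Site P j, w *
      (N * (N + 2) * G w c M2 y y ^ 2 * G w c M2 x x' + 4 * (N + 2) * G w c M2 y y * (G w c M2 x y * G w c M2 x' y)) with hs2
  have hs1 : sβ * s2 = g * Bβ + 2 * Aβa := by
    rw [hsβ, hs2, Finset.sum_mul_sum, hBβ, hAβa, hg, Finset.mul_sum, Finset.mul_sum, ← Finset.sum_add_distrib]
    refine Finset.sum_congr rfl fun y _ => ?_
    rw [Finset.mul_sum, Finset.mul_sum, ← Finset.sum_add_distrib]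
    exact Finset.sum_congr rfl fun z _ => by ring
  have hs2' : sβ ^ 2 = Bβ := by
    rw [hsβ, sq, Finset.sum_mul_sum, hBβ]
    exact Finset.sum_congr rfl fun y _ => Finset.sum_congr rfl fun z _ => by ring
  have hsym : Aab = Aβa := by
    rw [hAab, hAβa, Finset.sum_comm]
    exact Finset.sum_congr rfl fun y _ => Finset.sum_congr rfl fun z _ => by ring
  have hZne : Z ≠ 0 := (B3WT226Traces.Z_pos C η w c M2 hw hM).ne'
  have step : Z * dab * (g * A + D3 + g * Bb + 2 * Aab + g * Bβ + 2 * Aβa) / Z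
      - Z * (g * dab) * (Z * (A + Bb + Bβ)) / Z ^ 2 - 2 * (Z * sβ) * (Z * dab * s2) / Z ^ 2
      + 2 * (Z * (g * dab)) * (Z * sβ) ^ 2 / Z ^ 3
      = dab * (g * A + D3 + g * Bb + 2 * Aab + g * Bβ + 2 * Aβa) - g * dab * (A + Bb + Bβ) - 2 * dab * (sβ * s2)
        + 2 * g * dab * sβ ^ 2 := by
    field_simp
  rw [step]
  linear_combination (-2 * dab) * hs1 + (2 * g * dab) * hs2' + (2 * dab) * hsym

/-- **DICTIONARY FOR THE CHAIN: the `n = 2` term of (1.21).**  The matrix (with the volume element `η^d`) of `λ²/2!` times the chain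
part of `G″(0⁺)` is `dysonTerm (η^dC₀) (η^d·sig1) 2 = C₀[①]C₀[①]C₀` — two of p26's typed tadpole insertions `sig1 =
−4(N+2)λC^ε_0(0)δ^ε` in a row; the two orientations of §11 merge into the Taylor factor `1/2!`. [cite: Balaban1983Higgs3, (1.21)–(1.22) p.416] -/
theorem chain_eq_dysonTerm_two (hw : 0 < w) (D : SEData P j) (hC0 : D.C0 = G w c M2) (hN : D.N = N) (hwD : D.w = w) :
    (Matrix.of fun x x' : Site P j =>
        w * (D.lam ^ 2 * (∑ y : Site P j, ∑ z : Site P j, w * w *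
          (2 * (N + 2) * G w c M2 y y * (2 * (N + 2) * G w c M2 z z)
            * (4 * G w c M2 z y * (G w c M2 x y * G w c M2 z x' + G w c M2 x' y * G w c M2 z x)))) / 2))
      = B3Sect1TwoPoint.dysonTerm (w • G w c M2) (Matrix.of fun y y' : Site P j => w * sig1 D y y') 2 := by
  have hw0 : w ≠ 0 := hw.ne'
  ext x x'
  -- both orientations of the chain give the same double sum
  have hsplit : (∑ y : Site P j, ∑ z : Site P j, w * w *
      (2 * (N + 2) * G w c M2 y y * (2 * (N + 2) * G w c M2 z z)
        * (4 * G w c M2 z y * (G w c M2 x y * G w c M2 z x' + G w c M2 x' y * G w c M2 z x))))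
      = (∑ y : Site P j, ∑ z : Site P j, w * w *
          (2 * (N + 2) * G w c M2 y y * (2 * (N + 2) * G w c M2 z z) * (4 * G w c M2 z y * (G w c M2 x y * G w c M2 z x'))))
        + ∑ y : Site P j, ∑ z : Site P j, w * w *
          (2 * (N + 2) * G w c M2 y y * (2 * (N + 2) * G w c M2 z z) * (4 * G w c M2 z y * (G w c M2 x' y * G w c M2 z x))) := by
    rw [← Finset.sum_add_distrib]
    refine Finset.sum_congr rfl fun y _ => ?_
    rw [← Finset.sum_add_distrib]
    exact Finset.sum_congr rfl fun z _ => by ring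
  have hswap : (∑ y : Site P j, ∑ z : Site P j, w * w *
      (2 * (N + 2) * G w c M2 y y * (2 * (N + 2) * G w c M2 z z) * (4 * G w c M2 z y * (G w c M2 x' y * G w c M2 z x))))
      = ∑ y : Site P j, ∑ z : Site P j, w * w *
      (2 * (N + 2) * G w c M2 y y * (2 * (N + 2) * G w c M2 z z) * (4 * G w c M2 z y * (G w c M2 x y * G w c M2 z x'))) := by
    rw [Finset.sum_comm]
    refine Finset.sum_congr rfl fun y _ => Finset.sum_congr rfl fun z _ => ?_
    rw [G_symm w c M2 y z, G_symm w c M2 x' z, G_symm w c M2 y x, G_symm w c M2 z x']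
    ring
  have eL : w * (D.lam ^ 2 * (∑ y : Site P j, ∑ z : Site P j, w * w *
          (2 * (N + 2) * G w c M2 y y * (2 * (N + 2) * G w c M2 z z)
            * (4 * G w c M2 z y * (G w c M2 x y * G w c M2 z x' + G w c M2 x' y * G w c M2 z x)))) / 2)
      = ∑ y : Site P j, ∑ z : Site P j, (w * D.lam ^ 2) * (w * w *
          (2 * (N + 2) * G w c M2 y y * (2 * (N + 2) * G w c M2 z z) * (4 * G w c M2 z y * (G w c M2 x y * G w c M2 z x')))) := by
    rw [hsplit, hswap, ← two_mul]
    rw [show w * (D.lam ^ 2 * (2 * ∑ y : Site P j, ∑ z : Site P j, w * w *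
          (2 * (N + 2) * G w c M2 y y * (2 * (N + 2) * G w c M2 z z) * (4 * G w c M2 z y * (G w c M2 x y * G w c M2 z x'))))
          / 2)
        = (w * D.lam ^ 2) * ∑ y : Site P j, ∑ z : Site P j, w * w *
          (2 * (N + 2) * G w c M2 y y * (2 * (N + 2) * G w c M2 z z) * (4 * G w c M2 z y * (G w c M2 x y * G w c M2 z x')))
        from by ring]
    refine Eq.trans (Finset.mul_sum _ _ _) (Finset.sum_congr rfl fun y _ => ?_)
    exact Finset.mul_sum _ _ _
  rw [Matrix.of_apply, eL]
  simp only [B3Sect1TwoPoint.dysonTerm, pow_two, Matrix.mul_apply, Matrix.of_apply, Matrix.smul_apply, smul_eq_mul,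
    sig1, delta, hC0, hN, hwD]
  simp only [mul_ite, ite_mul, mul_zero, zero_mul, Finset.sum_ite_eq, Finset.mem_univ, if_true, Finset.mul_sum]
  refine Finset.sum_congr rfl fun y _ => Finset.sum_congr rfl fun z _ => ?_
  rw [G_symm w c M2 z y]
  field_simp
  ring

/-- **DICTIONARY FOR THE 1PI PART: `C₀[⑥ + Σ^ε_{loc,2}]C₀`.**  `λ²/2!` times the sunset + two-loop part of `G″(0⁺)` (per `δ_{ab}`) is
`Σ_{y,z}η^{2d}C(x,y)·[sig6 D(y,z) + Σ^ε_{loc,2}(y,z)]·C(z,x′)` with p26's typed sunset `sig6 = 4²(2N+4)λ²(C^ε_0)³` and the LOCAL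
two-loop insertion `Σ^ε_{loc,2}(y,z) = λ²·16(N+2)²·[Σ_vη^dC(v,v)C(v,y)²]·δ^ε(y−z)` (in p26's `delta`; not displayed among print's
"few terms" of (1.22), one of its "…"). [cite: Balaban1983Higgs3, (1.21)–(1.22) p.416] -/
theorem onePI_eq_C0_sig6_loc_C0 (hw : 0 < w) (D : SEData P j) (hC0 : D.C0 = G w c M2) (hN : D.N = N) (x x' : Site P j) :
    D.lam ^ 2 * (∑ y : Site P j, ∑ z : Site P j, w * w *
        (4 ^ 2 * (2 * N + 4) * G w c M2 z y ^ 3 * (G w c M2 x y * G w c M2 z x' + G w c M2 x' y * G w c M2 z x)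
          + 2 * (N + 2) * G w c M2 z z * (8 * (N + 2) * G w c M2 z y ^ 2 * (G w c M2 x y * G w c M2 x' y))
          + 2 * (N + 2) * G w c M2 y y * (8 * (N + 2) * G w c M2 y z ^ 2 * (G w c M2 x z * G w c M2 x' z)))) / 2
      = ∑ y : Site P j, ∑ z : Site P j, w * w * (G w c M2 x y
          * (sig6 D y z + D.lam ^ 2 * (16 * (N + 2) ^ 2 * ∑ v : Site P j, w * (G w c M2 v v * G w c M2 v y ^ 2)) * delta w y z)
          * G w c M2 z x') := by
  have hw0 : w ≠ 0 := hw.ne'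
  -- split the left side: sunset part (§10's dictionary) + the two mirror two-loop parts
  have hL : (∑ y : Site P j, ∑ z : Site P j, w * w *
        (4 ^ 2 * (2 * N + 4) * G w c M2 z y ^ 3 * (G w c M2 x y * G w c M2 z x' + G w c M2 x' y * G w c M2 z x)
          + 2 * (N + 2) * G w c M2 z z * (8 * (N + 2) * G w c M2 z y ^ 2 * (G w c M2 x y * G w c M2 x' y))
          + 2 * (N + 2) * G w c M2 y y * (8 * (N + 2) * G w c M2 y z ^ 2 * (G w c M2 x z * G w c M2 x' z))))
      = (∑ y : Site P j, ∑ z : Site P j, w * w *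
          (4 ^ 2 * (2 * N + 4) * G w c M2 z y ^ 3 * (G w c M2 x y * G w c M2 z x' + G w c M2 x' y * G w c M2 z x)))
        + (∑ y : Site P j, ∑ z : Site P j, w * w *
          (2 * (N + 2) * G w c M2 z z * (8 * (N + 2) * G w c M2 z y ^ 2 * (G w c M2 x y * G w c M2 x' y))))
        + (∑ y : Site P j, ∑ z : Site P j, w * w *
          (2 * (N + 2) * G w c M2 y y * (8 * (N + 2) * G w c M2 y z ^ 2 * (G w c M2 x z * G w c M2 x' z)))) := by
    rw [← Finset.sum_add_distrib, ← Finset.sum_add_distrib]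
    refine Finset.sum_congr rfl fun y _ => ?_
    rw [← Finset.sum_add_distrib, ← Finset.sum_add_distrib]
    exact Finset.sum_congr rfl fun z _ => by ring
  have hmirror : (∑ y : Site P j, ∑ z : Site P j, w * w *
        (2 * (N + 2) * G w c M2 y y * (8 * (N + 2) * G w c M2 y z ^ 2 * (G w c M2 x z * G w c M2 x' z))))
      = ∑ y : Site P j, ∑ z : Site P j, w * w *
        (2 * (N + 2) * G w c M2 z z * (8 * (N + 2) * G w c M2 z y ^ 2 * (G w c M2 x y * G w c M2 x' y))) := by
    rw [Finset.sum_comm]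
  -- split the right side: sunset sandwich + local sandwich (the `δ^ε` collapses the `z`-sum)
  have hR : (∑ y : Site P j, ∑ z : Site P j, w * w * (G w c M2 x y
          * (sig6 D y z + D.lam ^ 2 * (16 * (N + 2) ^ 2 * ∑ v : Site P j, w * (G w c M2 v v * G w c M2 v y ^ 2)) * delta w y z)
          * G w c M2 z x'))
      = (∑ y : Site P j, ∑ z : Site P j, w * w * (G w c M2 x y * sig6 D y z * G w c M2 z x'))
        + ∑ y : Site P j, w * (G w c M2 x y
          * (D.lam ^ 2 * (16 * (N + 2) ^ 2 * ∑ v : Site P j, w * (G w c M2 v v * G w c M2 v y ^ 2))) * G w c M2 y x') := by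
    rw [← Finset.sum_add_distrib]
    refine Finset.sum_congr rfl fun y _ => ?_
    have e : ∀ z : Site P j, w * w * (G w c M2 x y
          * (sig6 D y z + D.lam ^ 2 * (16 * (N + 2) ^ 2 * ∑ v : Site P j, w * (G w c M2 v v * G w c M2 v y ^ 2)) * delta w y z)
          * G w c M2 z x')
        = w * w * (G w c M2 x y * sig6 D y z * G w c M2 z x')
          + (if y = z then w * (G w c M2 x y
              * (D.lam ^ 2 * (16 * (N + 2) ^ 2 * ∑ v : Site P j, w * (G w c M2 v v * G w c M2 v y ^ 2))) * G w c M2 z x')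
            else 0) := by
      intro z
      simp only [delta]
      split_ifs with h
      · field_simp
      · ring
    rw [Finset.sum_congr rfl fun z _ => e z, Finset.sum_add_distrib, Finset.sum_ite_eq, if_pos (Finset.mem_univ y)]
  rw [hL, hmirror, hR, ← secondCoeff_eq_C0_sig6_C0 w c M2 D hC0 hN x x']
  -- the local part: `λ²·Σ_yΣ_z η^{2d}·2(N+2)C(z,z)·8(N+2)C(z,y)²C(x,y)C(x′,y) = Σ_y η^d C(x,y)·L_y·C(y,x′)`
  have hloc : (∑ y : Site P j, ∑ z : Site P j, w * w *
        (2 * (N + 2) * G w c M2 z z * (8 * (N + 2) * G w c M2 z y ^ 2 * (G w c M2 x y * G w c M2 x' y))))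
      = ∑ y : Site P j, w * (G w c M2 x y * (16 * (N + 2) ^ 2 * ∑ v : Site P j, w * (G w c M2 v v * G w c M2 v y ^ 2))
          * G w c M2 y x') := by
    refine Finset.sum_congr rfl fun y _ => ?_
    simp only [Finset.mul_sum, Finset.sum_mul]
    refine Finset.sum_congr rfl fun z _ => ?_
    rw [G_symm w c M2 y x']
    ring
  rw [hloc]
  have hpull : (∑ y : Site P j, w * (G w c M2 x y
          * (D.lam ^ 2 * (16 * (N + 2) ^ 2 * ∑ v : Site P j, w * (G w c M2 v v * G w c M2 v y ^ 2))) * G w c M2 y x'))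
      = D.lam ^ 2 * ∑ y : Site P j, w * (G w c M2 x y
          * (16 * (N + 2) ^ 2 * ∑ v : Site P j, w * (G w c M2 v v * G w c M2 v y ^ 2)) * G w c M2 y x') := by
    rw [Finset.mul_sum]
    exact Finset.sum_congr rfl fun y _ => by ring
  rw [hpull]
  ring

/-! ## §12 (v1.2) The Taylor coefficients of the two-point function at `λ = 0⁺` through order two, in Mathlib's
`derivWithin`/`iteratedDerivWithin` on `[0, ∞)` -/

/-- **`(d/dλ)G_λ,ab(x,x′)∣_{0⁺} = −δ_{ab}·4(N+2)Σ_yη^dC(y,y)C(x,y)C(x′,y)`** in `derivWithin` form (§4). [cite: Balaban1983Higgs3, (1.21)–(1.22) p.416] -/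
theorem derivWithin_twoPointPhi4_zero (hw : 0 < w) (hM : 0 < M2) (a b : Fin N) (x x' : Site P j) :
    derivWithin
      (fun lam : ℝ => (∫ φ, W φ * (Real.exp (-(lam * ∑ y : Site P j, w * ‖φ y‖ ^ 4)) * (⟪φ x, 𝐞 a⟫_ℝ * ⟪φ x', 𝐞 b⟫_ℝ)))
        / ∫ φ, W φ * (Real.exp (-(lam * ∑ y : Site P j, w * ‖φ y‖ ^ 4)) * 1)) (Set.Ici 0) 0
      = -(⟪𝐞 a, 𝐞 b⟫_ℝ * (4 * (N + 2) * ∑ y : Site P j, w * (G w c M2 y y * (G w c M2 x y * G w c M2 x' y)))) :=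
  (hasDerivWithinAt_twoPointPhi4 C η w c M2 hw hM a b x x').derivWithin (uniqueDiffOn_Ici (0 : ℝ) 0 Set.self_mem_Ici)

/-- on all of `[0, ∞)` the derivative (within `[0,∞)`) of the two-point function is the quotient-rule expression `D₁(λ)` of §7
(§4 at `0⁺`, §6 at `λ > 0`). [cite: Balaban1983Higgs3, (1.21) p.416] -/
theorem derivWithin_twoPointPhi4_eq (hw : 0 < w) (hM : 0 < M2) (a b : Fin N) (x x' : Site P j) {lam : ℝ} (hlam : 0 ≤ lam) :
    derivWithin
      (fun lam : ℝ => (∫ φ, W φ * (Real.exp (-(lam * ∑ y : Site P j, w * ‖φ y‖ ^ 4)) * (⟪φ x, 𝐞 a⟫_ℝ * ⟪φ x', 𝐞 b⟫_ℝ)))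
        / ∫ φ, W φ * (Real.exp (-(lam * ∑ y : Site P j, w * ‖φ y‖ ^ 4)) * 1)) (Set.Ici 0) lam
      = ((-(∫ φ, W φ * (Real.exp (-(lam * ∑ y : Site P j, w * ‖φ y‖ ^ 4))
              * ((∑ y : Site P j, w * ‖φ y‖ ^ 4) * (⟪φ x, 𝐞 a⟫_ℝ * ⟪φ x', 𝐞 b⟫_ℝ)))))
            * (∫ φ, W φ * (Real.exp (-(lam * ∑ y : Site P j, w * ‖φ y‖ ^ 4)) * 1))
          + (∫ φ, W φ * (Real.exp (-(lam * ∑ y : Site P j, w * ‖φ y‖ ^ 4)) * (⟪φ x, 𝐞 a⟫_ℝ * ⟪φ x', 𝐞 b⟫_ℝ)))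
            * (∫ φ, W φ * (Real.exp (-(lam * ∑ y : Site P j, w * ‖φ y‖ ^ 4))
                * ((∑ y : Site P j, w * ‖φ y‖ ^ 4) * 1))))
          / (∫ φ, W φ * (Real.exp (-(lam * ∑ y : Site P j, w * ‖φ y‖ ^ 4)) * 1)) ^ 2 := by
  rcases hlam.eq_or_lt with h | h
  · subst h
    rw [derivWithin_twoPointPhi4_zero C η w c M2 hw hM a b x x']
    simp only [zero_mul, neg_zero, Real.exp_zero, one_mul, mul_one]
    have hZne : (∫ φ, W φ) ≠ 0 := (B3WT226Traces.Z_pos C η w c M2 hw hM).ne'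
    have hc := cov_V_legs C η w c M2 hw hM a b x x'
    rw [eq_div_iff (pow_ne_zero 2 hZne)]
    linear_combination hc
  · exact ((hasDerivAt_twoPointPhi4 C η w c M2 hw hM a b x x' h).hasDerivWithinAt.derivWithin
      (uniqueDiffOn_Ici (0 : ℝ) lam hlam)).trans (by ring)

/-- **THE SECOND TAYLOR COEFFICIENT OF (1.19) AT `λ = 0⁺` (e = 0) IS THE ORDER-λ² LINE OF (1.21)/(1.22)**:
`(d²/dλ²)G_λ,ab(x,x′)∣_{0⁺}` (Mathlib's `iteratedDerivWithin 2 · (Set.Ici 0) 0`, the coefficient entering p33's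
`TiltData.taylor_tiltExpect`) `= δ_{ab}Σ_{y,z}η^{2d}[sunset ⑥ + local two-loop graph (both placements) + chain of two tadpoles]`
(§11). [cite: Balaban1983Higgs3, (1.21)–(1.22) p.416] [cite: GlimmJaffeQP1987, §8.4–8.5] -/
theorem iteratedDerivWithin_two_twoPointPhi4 (hw : 0 < w) (hM : 0 < M2) (a b : Fin N) (x x' : Site P j) :
    iteratedDerivWithin 2
      (fun lam : ℝ => (∫ φ, W φ * (Real.exp (-(lam * ∑ y : Site P j, w * ‖φ y‖ ^ 4)) * (⟪φ x, 𝐞 a⟫_ℝ * ⟪φ x', 𝐞 b⟫_ℝ)))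
        / ∫ φ, W φ * (Real.exp (-(lam * ∑ y : Site P j, w * ‖φ y‖ ^ 4)) * 1)) (Set.Ici 0) 0
      = ⟪𝐞 a, 𝐞 b⟫_ℝ * ∑ y : Site P j, ∑ z : Site P j, w * w *
          (4 ^ 2 * (2 * N + 4) * G w c M2 z y ^ 3 * (G w c M2 x y * G w c M2 z x' + G w c M2 x' y * G w c M2 z x)
            + 2 * (N + 2) * G w c M2 z z * (8 * (N + 2) * G w c M2 z y ^ 2 * (G w c M2 x y * G w c M2 x' y))
            + 2 * (N + 2) * G w c M2 y y * (8 * (N + 2) * G w c M2 y z ^ 2 * (G w c M2 x z * G w c M2 x' z))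
            + 2 * (N + 2) * G w c M2 y y * (2 * (N + 2) * G w c M2 z z)
              * (4 * G w c M2 z y * (G w c M2 x y * G w c M2 z x' + G w c M2 x' y * G w c M2 z x))) := by
  set g : ℝ → ℝ := fun lam : ℝ =>
    (∫ φ, W φ * (Real.exp (-(lam * ∑ y : Site P j, w * ‖φ y‖ ^ 4)) * (⟪φ x, 𝐞 a⟫_ℝ * ⟪φ x', 𝐞 b⟫_ℝ)))
      / ∫ φ, W φ * (Real.exp (-(lam * ∑ y : Site P j, w * ‖φ y‖ ^ 4)) * 1) with hgdef
  set D1 : ℝ → ℝ := fun lam : ℝ =>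
    ((-(∫ φ, W φ * (Real.exp (-(lam * ∑ y : Site P j, w * ‖φ y‖ ^ 4))
          * ((∑ y : Site P j, w * ‖φ y‖ ^ 4) * (⟪φ x, 𝐞 a⟫_ℝ * ⟪φ x', 𝐞 b⟫_ℝ)))))
        * (∫ φ, W φ * (Real.exp (-(lam * ∑ y : Site P j, w * ‖φ y‖ ^ 4)) * 1))
      + (∫ φ, W φ * (Real.exp (-(lam * ∑ y : Site P j, w * ‖φ y‖ ^ 4)) * (⟪φ x, 𝐞 a⟫_ℝ * ⟪φ x', 𝐞 b⟫_ℝ)))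
        * (∫ φ, W φ * (Real.exp (-(lam * ∑ y : Site P j, w * ‖φ y‖ ^ 4))
            * ((∑ y : Site P j, w * ‖φ y‖ ^ 4) * 1))))
      / (∫ φ, W φ * (Real.exp (-(lam * ∑ y : Site P j, w * ‖φ y‖ ^ 4)) * 1)) ^ 2 with hD1def
  have h2 : iteratedDerivWithin 2 g (Set.Ici 0) = derivWithin (derivWithin g (Set.Ici 0)) (Set.Ici 0) :=
    iteratedDerivWithin_succ.trans (congrArg (fun h : ℝ → ℝ => derivWithin h (Set.Ici (0 : ℝ))) iteratedDerivWithin_one)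
  have hcongr : Set.EqOn (derivWithin g (Set.Ici 0)) D1 (Set.Ici 0) := fun lam hlam => by
    rw [hgdef, hD1def]
    exact derivWithin_twoPointPhi4_eq C η w c M2 hw hM a b x x' hlam
  rw [h2, derivWithin_congr hcongr (hcongr Set.self_mem_Ici), hD1def]
  exact (hasDerivWithinAt_firstDeriv_twoPointPhi4_graphs C η w c M2 hw hM a b x x').derivWithin
    (uniqueDiffOn_Ici (0 : ℝ) 0 Set.self_mem_Ici)

/-! ## §13 (v1.2) The vacuum side — (1.24) at `e = 0`: `(∂/∂λ)^β log∫dφ e^{−S^ε}∣_{λ=0⁺}` for `β = 1, 2` are the CONNECTED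
vacuum graphs: the "8" (two self-lines at one vertex); the basketball and the bubble with two tadpole loops -/

/-- print (1.24) p. 417, verbatim: *"Now it is easy to define the vacuum energy counterterm E₁. It is defined by the following
perturbation expansion: E₁ = Σ_{1≤α+β≤n̄} (1/(α!β!)) e^αλ^β (∂^{α+β}/∂e^α∂λ^β log∫dA∫dφ e^{−S^ε(A,φ)})∣_{e=λ=0} (1.24) with n̄ > 12.
… Terms of this expansion are described by connected graphs without external legs (vacuum graphs)."*  Here, at `e = 0`: the
normalization `Z^ε(λ) = ∫We^{−λV}` is POSITIVE for every `λ ≥ 0`. [cite: Balaban1983Higgs3, (1.24) p.417] -/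
theorem gaussInt_exp_neg_pos (hw : 0 < w) (hM : 0 < M2) {lam0 : ℝ} (hlam0 : 0 ≤ lam0) :
    0 < ∫ φ : Cfg P j N, W φ * (Real.exp (-(lam0 * ∑ y : Site P j, w * ‖φ y‖ ^ 4)) * 1) := by
  have hV : ExpGrowth (fun φ : Cfg P j N => ∑ y : Site P j, w * ‖φ y‖ ^ 4) := expGrowth_V w
  have hV0 : ∀ φ : Cfg P j N, 0 ≤ ∑ y : Site P j, w * ‖φ y‖ ^ 4 := fun φ =>
    Finset.sum_nonneg fun y _ => mul_nonneg hw.le (by positivity)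
  have hexpc0 : Continuous (fun φ : Cfg P j N => Real.exp (-(lam0 * ∑ y : Site P j, w * ‖φ y‖ ^ 4))) :=
    Real.continuous_exp.comp ((continuous_const.mul hV.1).neg)
  have hi : Integrable (fun φ : Cfg P j N => W φ * (Real.exp (-(lam0 * ∑ y : Site P j, w * ‖φ y‖ ^ 4)) * 1)) := by
    have hb := ((ExpGrowth.const (1 : ℝ)).integrable C η w c M2 hw hM).bdd_mul (c := 1) hexpc0.aestronglyMeasurable
      (Filter.Eventually.of_forall fun φ => by
        rw [Real.norm_eq_abs, abs_of_pos (Real.exp_pos _)]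
        exact Real.exp_le_one_iff.mpr (by nlinarith [hV0 φ, hlam0]))
    refine hb.congr (Filter.Eventually.of_forall fun φ => ?_)
    show Real.exp (-(lam0 * ∑ y : Site P j, w * ‖φ y‖ ^ 4)) * (W φ * 1)
      = W φ * (Real.exp (-(lam0 * ∑ y : Site P j, w * ‖φ y‖ ^ 4)) * 1)
    ring
  have hptw : ∀ φ : Cfg P j N, 0 < W φ * (Real.exp (-(lam0 * ∑ y : Site P j, w * ‖φ y‖ ^ 4)) * 1) := fun φ =>
    mul_pos (weight_pos (C := C) (η := η) (w := w) (c := c) (M2 := M2) _ φ) (by rw [mul_one]; exact Real.exp_pos _)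
  rw [integral_pos_iff_support_of_nonneg (fun φ => (hptw φ).le) hi]
  have hsupp : Function.support (fun φ : Cfg P j N => W φ * (Real.exp (-(lam0 * ∑ y : Site P j, w * ‖φ y‖ ^ 4)) * 1))
      = Set.univ :=
    Set.eq_univ_iff_forall.mpr fun φ => Function.mem_support.mpr (hptw φ).ne'
  rw [hsupp]
  exact isOpen_univ.measure_pos volume Set.univ_nonempty

/-- **(1.24), β = 1, e = 0**: `(d/dλ) log Z^ε(λ)∣_{0⁺} = −Σ_yη^d·N(N+2)C(y,y)²` — the vacuum graph "8" (the two self-lines of one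
quartic vertex), connected; per unit volume `−N(N+2)C^ε_0(0)²`. [cite: Balaban1983Higgs3, (1.24) p.417] [cite: GlimmJaffeQP1987, §8.4–8.5] -/
theorem hasDerivWithinAt_logZ (hw : 0 < w) (hM : 0 < M2) :
    HasDerivWithinAt (fun lam : ℝ => Real.log (∫ φ, W φ * (Real.exp (-(lam * ∑ y : Site P j, w * ‖φ y‖ ^ 4)) * 1)))
      (-(∑ y : Site P j, w * (N * (N + 2) * G w c M2 y y ^ 2))) (Set.Ici 0) 0 := by
  have hV : ExpGrowth (fun φ : Cfg P j N => ∑ y : Site P j, w * ‖φ y‖ ^ 4) := expGrowth_V w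
  have hV0 : ∀ φ : Cfg P j N, 0 ≤ ∑ y : Site P j, w * ‖φ y‖ ^ 4 := fun φ =>
    Finset.sum_nonneg fun y _ => mul_nonneg hw.le (by positivity)
  have h1 := hasDerivWithinAt_gaussInt_exp_neg C η w c M2 hw hM hV hV0 (ExpGrowth.const 1)
  have hZ : 0 < ∫ φ, W φ := B3WT226Traces.Z_pos C η w c M2 hw hM
  have hden0 : (∫ φ : Cfg P j N, W φ * (Real.exp (-(0 * ∑ y : Site P j, w * ‖φ y‖ ^ 4)) * 1)) = ∫ φ, W φ := by
    rw [gaussInt_exp_neg_zero]; simp only [mul_one]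
  have h := h1.log (by rw [hden0]; exact hZ.ne')
  refine h.congr_deriv ?_
  rw [hden0]
  simp only [mul_one]
  rw [integral_V C η w c M2 hw hM]
  field_simp

/-- on all of `[0,∞)` the derivative (within) of `log Z^ε(λ)` is `−⟨V⟩_λ = −N_V(λ)/N_1(λ)`. [cite: Balaban1983Higgs3, (1.24) p.417] -/
theorem derivWithin_logZ_eq (hw : 0 < w) (hM : 0 < M2) {lam : ℝ} (hlam : 0 ≤ lam) :
    derivWithin (fun lam : ℝ => Real.log (∫ φ, W φ * (Real.exp (-(lam * ∑ y : Site P j, w * ‖φ y‖ ^ 4)) * 1)))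
        (Set.Ici 0) lam
      = -(∫ φ, W φ * (Real.exp (-(lam * ∑ y : Site P j, w * ‖φ y‖ ^ 4)) * ((∑ y : Site P j, w * ‖φ y‖ ^ 4) * 1)))
          / (∫ φ, W φ * (Real.exp (-(lam * ∑ y : Site P j, w * ‖φ y‖ ^ 4)) * 1)) := by
  have hV : ExpGrowth (fun φ : Cfg P j N => ∑ y : Site P j, w * ‖φ y‖ ^ 4) := expGrowth_V w
  have hV0 : ∀ φ : Cfg P j N, 0 ≤ ∑ y : Site P j, w * ‖φ y‖ ^ 4 := fun φ =>
    Finset.sum_nonneg fun y _ => mul_nonneg hw.le (by positivity)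
  have hne := (gaussInt_exp_neg_pos (P := P) (j := j) C η w c M2 hw hM hlam).ne'
  rcases hlam.eq_or_lt with h | h
  · subst h
    have h1 := hasDerivWithinAt_gaussInt_exp_neg C η w c M2 hw hM hV hV0 (hV.mul (ExpGrowth.const 1))
    have h0 := hasDerivWithinAt_gaussInt_exp_neg C η w c M2 hw hM hV hV0 (ExpGrowth.const 1)
    rw [(h0.log hne).derivWithin (uniqueDiffOn_Ici (0 : ℝ) 0 Set.self_mem_Ici)]
    simp only [zero_mul, neg_zero, Real.exp_zero, one_mul, mul_one, neg_div]
  · have h0 := hasDerivAt_gaussInt_exp_neg C η w c M2 hw hM hV hV0 (ExpGrowth.const 1) h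
    exact ((h0.log hne).hasDerivWithinAt.derivWithin (uniqueDiffOn_Ici (0 : ℝ) lam hlam)).trans (by rw [neg_div])

/-- **(1.24), β = 2, e = 0: THE CONNECTED TWO-VERTEX VACUUM GRAPHS.**  `λ ↦ −⟨V⟩_λ` (= `(d/dλ)log Z^ε` on `[0,∞)`) is
right-differentiable at `0⁺` with derivative `Var₀(V) = Σ_{y,z}η^{2d}[8N(N+2)C(z,y)⁴ + 2(N+2)C(y,y)·2(N+2)C(z,z)·2N·C(z,y)²]` — the
BASKETBALL and the BUBBLE WITH TWO TADPOLE LOOPS; the disconnected product of two "8"s (`β_yβ_z`) CANCELS, as print's *"connected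
graphs without external legs"* says. [cite: Balaban1983Higgs3, (1.24) p.417] [cite: GlimmJaffeQP1987, §8.4–8.5] -/
theorem hasDerivWithinAt_firstDeriv_logZ (hw : 0 < w) (hM : 0 < M2) :
    HasDerivWithinAt
      (fun lam : ℝ =>
        -(∫ φ, W φ * (Real.exp (-(lam * ∑ y : Site P j, w * ‖φ y‖ ^ 4)) * ((∑ y : Site P j, w * ‖φ y‖ ^ 4) * 1)))
          / ∫ φ, W φ * (Real.exp (-(lam * ∑ y : Site P j, w * ‖φ y‖ ^ 4)) * 1))
      ((∑ y : Site P j, ∑ z : Site P j, w * w * (8 * (N * (N + 2)) * G w c M2 z y ^ 4))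
        + (∑ y : Site P j, ∑ z : Site P j, w * w *
            (2 * (N + 2) * G w c M2 y y * (2 * (N + 2) * G w c M2 z z) * (2 * N * G w c M2 z y ^ 2))))
      (Set.Ici 0) 0 := by
  have hV : ExpGrowth (fun φ : Cfg P j N => ∑ y : Site P j, w * ‖φ y‖ ^ 4) := expGrowth_V w
  have hV0 : ∀ φ : Cfg P j N, 0 ≤ ∑ y : Site P j, w * ‖φ y‖ ^ 4 := fun φ =>
    Finset.sum_nonneg fun y _ => mul_nonneg hw.le (by positivity)
  have hV1 := hasDerivWithinAt_gaussInt_exp_neg C η w c M2 hw hM hV hV0 (hV.mul (ExpGrowth.const 1))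
  have h1 := hasDerivWithinAt_gaussInt_exp_neg C η w c M2 hw hM hV hV0 (ExpGrowth.const 1)
  have hZ : 0 < ∫ φ, W φ := B3WT226Traces.Z_pos C η w c M2 hw hM
  have hden0 : (∫ φ : Cfg P j N, W φ * (Real.exp (-(0 * ∑ y : Site P j, w * ‖φ y‖ ^ 4)) * 1)) = ∫ φ, W φ := by
    rw [gaussInt_exp_neg_zero]; simp only [mul_one]
  have h := hV1.neg.div h1 (by rw [hden0]; exact hZ.ne')
  refine h.congr_deriv ?_
  simp only [Pi.neg_apply, zero_mul, neg_zero, Real.exp_zero, one_mul, mul_one, neg_neg]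
  have e2 : (∫ φ : Cfg P j N, W φ * ((∑ y : Site P j, w * ‖φ y‖ ^ 4) * ∑ y : Site P j, w * ‖φ y‖ ^ 4))
      = ∫ φ, W φ * (∑ y : Site P j, w * ‖φ y‖ ^ 4) ^ 2 :=
    integral_congr_ae (Filter.Eventually.of_forall fun φ => by ring)
  rw [e2, integral_V_sq C η w c M2 hw hM, integral_V C η w c M2 hw hM]
  set Z : ℝ := ∫ φ, W φ with hZdef
  set A : ℝ := ∑ y : Site P j, ∑ z : Site P j, w * w * (8 * (N * (N + 2)) * G w c M2 z y ^ 4) with hA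
  set Bb : ℝ := ∑ y : Site P j, ∑ z : Site P j, w * w *
      (2 * (N + 2) * G w c M2 y y * (2 * (N + 2) * G w c M2 z z) * (2 * N * G w c M2 z y ^ 2)) with hBb
  set Bβ : ℝ := ∑ y : Site P j, ∑ z : Site P j, w * w *
      (N * (N + 2) * G w c M2 y y ^ 2 * (N * (N + 2) * G w c M2 z z ^ 2)) with hBβ
  set sβ : ℝ := ∑ y : Site P j, w * (N * (N + 2) * G w c M2 y y ^ 2) with hsβ
  have hs2 : sβ ^ 2 = Bβ := by
    rw [hsβ, sq, Finset.sum_mul_sum, hBβ]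
    exact Finset.sum_congr rfl fun y _ => Finset.sum_congr rfl fun z _ => by ring
  have hZne : Z ≠ 0 := hZ.ne'
  have step : (Z * (A + Bb + Bβ) * Z - Z * sβ * (Z * sβ)) / Z ^ 2 = A + Bb + Bβ - sβ ^ 2 := by
    field_simp
  rw [show (Z * (A + Bb + Bβ) * Z - -(Z * sβ) * -(Z * sβ)) / Z ^ 2 = (Z * (A + Bb + Bβ) * Z - Z * sβ * (Z * sβ)) / Z ^ 2
      from by ring, step, hs2]
  ring

end Literature.MathematicalPhysics.QuantumFieldTheory.Balaban1983to89.B3Eq122FirstOrderWick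

end
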